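import Summits.AnomalousDissipation.AnomalousDissipation.Theorems.SawtoothPulseCascadeK1LocalisedCascadeKHCombAmplitude
import Summits.AnomalousDissipation.AnomalousDissipation.Theorems.SawtoothPulseCascadeK1LocalisedCascadeKHCombEnergy
import Summits.AnomalousDissipation.AnomalousDissipation.Theorems.SawtoothPulseCascadeK1LocalisedCascadeKHModeCreation
import Summits.AnomalousDissipation.AnomalousDissipation.Theorems.SawtoothPulseCascadeK1LocalisedCascadeKHTransportParseval
import Summits.AnomalousDissipation.AnomalousDissipation.Theorems.SawtoothPulseCascadeK1LocalisedCascadeKHTransportCoeff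
import Summits.AnomalousDissipation.AnomalousDissipation.Theorems.SawtoothPulseCascadeK1LocalisedCascadeKHStraightPairEnergy
import Summits.AnomalousDissipation.AnomalousDissipation.Theorems.SawtoothPulseCascadeK1LocalisedCascadeKHTransportDuality
import Summits.AnomalousDissipation.AnomalousDissipation.Theorems.SawtoothPulseCascadeK1LocalisedCascadeKHSingleModeCreation
import Summits.AnomalousDissipation.AnomalousDissipation.Theorems.SawtoothPulseCascadeK1LocalisedCascadeKHLineKernel
import Summits.AnomalousDissipation.AnomalousDissipation.Theorems.SawtoothPulseCascadeK1LocalisedCascadeKHSheetPairEnergy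

/-!
# K2 lane — E5 TAIL BY NAME: the comb-column creation law `CombColumnCreation 8 K s (2.23·(√2)⁻¹^(s−1))` for every shell `s ≥ 3`

prover ad-k1loc-p2 g11 (K2 lane, arbiter A26-12/A26-13 «P2-T» + «P2-S»), crux workfile on the dir of stmt-AnomalousDissipation-19491.
Over p4's verbatim definitions (`K2ConeSketch.lean` v1.4 §0–§1–§2–§4–§6.4, reproduced below in this namespace because `Cruxes/…` modules are not
importable) this file proves, from the tree theorems `…KHCombSource` (p700079), `…KHCombDuhamel` (p700326), `…KHCombAmplitude`, `…KHCombEnergy`: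

* `sheetAmps_const_interior` — linearity: a constant interior `c` creates `c •` the pair of `pureMode`;
* `sheetAmps_pureMode_apply_0/1` — the created pair of the unit comb column (interior `1`, Bloch phase `0`) IS the tree's Duhamel integral;
* `sheetAmps_neg_pureMode` — **P2-S at Bloch phase 0**: `sheetAmps (−a) 0 θ pureMode i = conj (sheetAmps a 0 θ pureMode i)` (all real `a`, `θ`);
* `norm_sheetAmps_pureMode_le` — **‖sheetAmps a 0 θ pureMode i‖ ≤ 0.8865/|a| for |a| ≥ 4, 0 ≤ θ ≤ 8**;
* `energy_column_le` — the created pair of a column `|b| ≥ 4` has (full lattice) energy `≤ (4.94/|b|)·(1/(4π²b²))`;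
* `norm_sheetAmps_singleMode_le` (v2, P2-E6 kernel) — **‖sheetAmps a β θ (singleMode ξ) i‖ ≤ 0.889/a for EVERY mode ξ and Bloch phase β**
  (`a ≥ 4`, `0 ≤ θ ≤ 8`; tree `…KHModeSource` p702359 + `…KHModeCreation`: the two Doppler envelopes + the `arsinh` window inequality);
* `norm_sheetAmps_singleMode_resolved` / `norm_sheetAmps_modeProfile_resolved` (v2, E6-a) — the ξ-RESOLVED weight by name and the COHERENT
  per-line bound `‖sheetAmps a β θ ⟨modeProfile β K c, []⟩ i‖ ≤ Σ_n ‖c n‖·W(a,β,β+n,θ)` (`a ≥ 1`); uniform corollary `≤ (Σ‖c n‖)·0.889/a` (`a ≥ 4`);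
* `energy_transport_singleMode_le` (v3, E6-b) — the transported mode has energy `≤ 1/(4π²a²)` (Parseval, tree `…KHTransportParseval`; Orr bound
  `1 + (ξ/a)²`), `energy_nosheet_le` for any continuous interior with `|g| ≤ 1`; `continuous_triWave`;
* `energy_created_singleMode_sharp` (v4, P1″ single-mode by name) — `E_created ≤ 4.97(1+(ξ/a)²)/a · E_mode` (`a ≥ 4`, θ ≤ 8, any β; p2 g10 had
  `2900/a`); cascade-type corollary `≤ 6.92/a`;
* `energy_created_modeProfile_le` (v5, P1″ PROFILE level, true shape after F-p2g11-2) — cascade-type profiles: `E_created ≤ 10.5 · E_profile`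
  (`a ≥ 4`, θ ≤ 8, any β, K- and a-uniform); `coeff_modeProfile`, `energy_modeProfile`, `card_filter_abs_le`;
* `norm_hTransport_le` / `norm_hTransport_le_sum` (v6, E6-b locality by name) — p4's `hTransport` entries ≤ profile-weighted sinc tails
  `Σ_n ‖ζ m n‖(4/|Λ₊| + 2/|Λ₋|)`, `Λ± = 2π(n−n′±(α+m)θ)` (tree `…KHTransportCoeff`: `transport_coeff_eq` closed form), and `≤ Σ_n ‖ζ m n‖`;
* `cEnergy_inputState_V` / `cEnergy_inputState_V_lower` (v7, E6 piece (i) sub-lemma L-i-c BY NAME) — the input energy of a V source in p4's `Transfer`: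
  `cEnergy α β 0 K (inputState α β θ K V d) ≥ (1/4π²)·Σ_{|n|≤K} (‖d n 0‖²+‖d n 1‖²)(π/|β+n| − 2/(K+1) − 4/(β+n)²)` for class offsets `α ∈ [0,1]`
  (tree `…KHStraightPairEnergy`, p707331: straight-pair column energy two-sided, window defect explicit);
* `cEnergy_vTransport_le` / `cEnergy_hTransport_le` (v8, E6 sub-lemma L-i-b IN FULL, by name) — **`cEnergy α β ℓ K (vTransport α β θ K ζ) ≤ (θ²+2)·cEnergy α β ℓ K ζ`**
  and the same for `hTransport`, for EVERY class, level, window and state (tree `…KHTransportDuality`, p709500: 1-D duality, `‖ζ∘Φ‖_{Ḣ⁻¹} ≤ ‖DΦ⁻¹‖_∞‖ζ‖_{Ḣ⁻¹}`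
  on the lattice; θ = 8 gives 66, measured worst case 2.6, job j327934);
* `combColumnCreation_tail` — **`∀ K, ∀ s ≥ 3, CombColumnCreation 8 K s (2.23 · (√2)⁻¹ ^ (s − 1))`** (p4's E5 entry, K-uniform, every shell from
  the third on: columns `|b| ≥ 4`; the S4 line of record needs `C ≤ 2.4` for the tail `s ≥ 7`, A26-12), and `combColumnLaw_of_head` — `CombColumnLaw 8 K₀ C`
  follows from the two head shells (`s = 1, 2`: columns `±1, ±2, ±3`, p4's certified numerics) for any `C ≥ 2.23`.

MECHANISM (why no stationary phase is needed at this precision): for the mode `ξ = 0` all six closed-form source terms share the Lorentz denominator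
`κ(1 ∓ is)`, so the source is ONE coherent corner pulse `−2e^{−iπas/2}/(2κ²(1−q)(1−is))` plus `O(e^{−πa/2})` images (pointwise envelope
`N(a)/(2κ²(1−q)√(1+s²))`, `N → 2`); the Bloch-0 block row is a unimodular phase up to `(p+2|S|)/√(p²−4|S|²) − 1 = O(e^{−2πa})`; the plain envelope
integral `∫₀⁸ ds/√(1+s²) = arsinh 8 ≤ 2.777` then gives amplitude `≤ 0.8865/a`, energy ratio `≤ 4.94/a`, i.e. `C = 2.23 < 2.4`. The true large-`a`
constant is `|∫₀⁸ e^{−is}/(1−is) ds|·√(2/π) = 1.04` (one oscillatory integral; certified quadrature would recover the law of record `63/50`).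
WHAT THIS IS NOT: not shells `s = 1, 2` (columns `|b| ≤ 3`: numerics), not `StableBlockCreation` for general profiles, not S3/S4, not the lattice ↔ PDE
identification (S-2). Nothing here is about the crux by name (19491 is the ACL item only).
-/

open Set MeasureTheory intervalIntegral

set_option linter.dupNamespace false

namespace Summit.AnomalousDissipation.AnomalousDissipation.Cruxes.K1LocalisedCascade.K2CombColumnLaw

open Literature.Analysis.FluidPDE.SawtoothCascade
open Summit.AnomalousDissipation.AnomalousDissipation.Theorems.SawtoothPulseCascade.K2PhaseBudget

noncomputable section

/-! ## Verbatim copies (p4: `K2ConeSketch.lean` v1.4 §0.1–§0.3, §1, §2, §4, §6.4) -/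

/-- The periodised Biot–Savart LINE KERNEL (p2's corrected sign). -/
def lineKernel (a β y : ℝ) : ℂ :=
  let κ : ℝ := 2 * Real.pi * |a|
  let r : ℝ := y - (⌊y⌋ : ℝ)
  let z : ℂ := Complex.exp (2 * Real.pi * β * Complex.I)
  Complex.exp (2 * Real.pi * β * (⌊y⌋ : ℝ) * Complex.I) *
    ((-(((Real.exp (-(κ * r)) : ℂ) / (1 - (starRingEnd ℂ z) * (Real.exp (-κ) : ℂ)))
          + (Real.exp (κ * (r - 1)) : ℂ) * z / (1 - z * (Real.exp (-κ) : ℂ)))) / (2 * κ : ℂ))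

/-- Transport multiplier of an H slot of total strain `θ` on the streamwise mode `a`. -/
def transportPhase (a θ y : ℝ) : ℂ :=
  Complex.exp (-(2 * Real.pi * a * θ * triWave y : ℝ) * Complex.I)

/-- The 2 × 2 Kelvin–Helmholtz block of the kink-sheet pair. -/
def blockX (a β : ℝ) : Matrix (Fin 2) (Fin 2) ℂ :=
  ((2 * Real.pi * a : ℝ) * Complex.I : ℂ) •
    !![-(1 / 4 : ℂ) - 2 * lineKernel a β 0, -2 * lineKernel a β (1 / 2);
       2 * starRingEnd ℂ (lineKernel a β (1 / 2)), (1 / 4 : ℂ) + 2 * lineKernel a β 0]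

/-- `λ(a, β) = -a²·c²(a, β)`. -/
def khLam (a β : ℝ) : ℝ := -(a ^ 2 * sawC2 a β)

/-- `C(t)`: `cosh(√λ t)` / `cos(√(-λ) t)` / `1`. -/
def propC (a β t : ℝ) : ℝ :=
  if 0 < khLam a β then Real.cosh (Real.sqrt (khLam a β) * t)
  else if khLam a β < 0 then Real.cos (Real.sqrt (-(khLam a β)) * t) else 1

/-- `Sn(t)`: `sinh(√λ t)/√λ` / `sin(√(-λ) t)/√(-λ)` / `t`. -/
def propSn (a β t : ℝ) : ℝ :=
  if 0 < khLam a β then Real.sinh (Real.sqrt (khLam a β) * t) / Real.sqrt (khLam a β)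
  else if khLam a β < 0 then Real.sin (Real.sqrt (-(khLam a β)) * t) / Real.sqrt (-(khLam a β)) else t

/-- The explicit propagator `P(t) = C(t)·1 + Sn(t)·X`. -/
def propagator (a β t : ℝ) : Matrix (Fin 2) (Fin 2) ℂ :=
  ((propC a β t : ℝ) : ℂ) • (1 : Matrix (Fin 2) (Fin 2) ℂ) + ((propSn a β t : ℝ) : ℂ) • blockX a β

/-- S-4 state of ONE line family. -/
structure LamState where
  interior : ℝ → ℂ
  sheets : List (ℝ × ℂ)

/-- The pure interior mode `ζ₀ ≡ 1`. -/
def pureMode : LamState := ⟨fun _ => 1, []⟩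

/-- A bare sheet pair on the kink lines with amplitudes `(q₊, q₋)` and no interior content. -/
def sheetPair (qp qm : ℂ) : LamState := ⟨fun _ => 0, [((1 / 4 : ℝ), qp), (-(1 / 4 : ℝ), qm)]⟩

/-- Forcing of the block at slot-time `s`. -/
def forcing (a β : ℝ) (st : LamState) (s : ℝ) : Fin 2 → ℂ :=
  let src : ℝ → ℂ := fun y0 =>
    (∫ y in (-(1 / 2 : ℝ))..(1 / 2), lineKernel a β (y0 - y) * st.interior y * transportPhase a s y)
      + (st.sheets.map (fun p => lineKernel a β (y0 - p.1) * p.2 * transportPhase a s p.1)).sum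
  ![((2 * Real.pi * a : ℝ) * Complex.I : ℂ) * (-2) * src (1 / 4),
    ((2 * Real.pi * a : ℝ) * Complex.I : ℂ) * 2 * src (-(1 / 4))]

/-- Fresh sheet amplitudes after strain `θ` (Duhamel): `q(θ) = ∫₀^θ P(θ - s) f(s) ds`. -/
def sheetAmps (a β θ : ℝ) (st : LamState) : Fin 2 → ℂ :=
  ∫ s in (0 : ℝ)..θ, (propagator a β (θ - s)).mulVec (forcing a β st s)

/-- THE SLOT MAP on one line family (S-2). -/
def slotMap (a β θ : ℝ) (st : LamState) : LamState :=
  ⟨fun y => st.interior y * transportPhase a θ y,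
   (st.sheets.map (fun p => (p.1, p.2 * transportPhase a θ p.1)))
     ++ [((1 / 4 : ℝ), sheetAmps a β θ st 0), (-(1 / 4 : ℝ), sheetAmps a β θ st 1)]⟩

/-- Transverse Fourier coefficient at `β + n`. -/
def coeff (β : ℝ) (st : LamState) (n : ℤ) : ℂ :=
  (∫ y in (-(1 / 2 : ℝ))..(1 / 2), st.interior y * Complex.exp (-(2 * Real.pi * (β + n) * y : ℝ) * Complex.I))
    + (st.sheets.map (fun p => p.2 * Complex.exp (-(2 * Real.pi * (β + n) * p.1 : ℝ) * Complex.I))).sum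

/-- Kinetic energy of the state on the family `(a, β)`. -/
def energy (a β : ℝ) (st : LamState) : ℝ :=
  ∑' n : ℤ, ‖coeff β st n‖ ^ 2 / (4 * Real.pi ^ 2 * (a ^ 2 + (β + n) ^ 2))

/-- Lattice state of one Bloch class `(α, β)`. -/
abbrev CState : Type := ℤ → ℤ → ℂ

/-- The truncation window `[-K, K]`. -/
def win (K : ℕ) : Finset ℤ := Finset.Icc (-(K : ℤ)) K

/-- Kinetic energy at level `ℓ` of the truncated state. -/
def cEnergy (α β : ℝ) (ℓ K : ℕ) (ζ : CState) : ℝ :=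
  ∑ m ∈ win K, ∑ n ∈ win K, ‖ζ m n‖ ^ 2 / (4 * Real.pi ^ 2 * (4 : ℝ) ^ ℓ * ((α + m) ^ 2 + (β + n) ^ 2))

/-- The transverse profile `y ↦ Σ_{|n| ≤ K} c(n) e^{2πi(β+n)y}` of a truncated coefficient row. -/
def modeProfile (β : ℝ) (K : ℕ) (c : ℤ → ℂ) : ℝ → ℂ :=
  fun y => ∑ n ∈ win K, c n * Complex.exp ((2 * Real.pi * (β + n) * y : ℝ) * Complex.I)

/-- H slot (strain `θ`), TRANSPORTED part: row `m` is the family `(α + m, β)`; its profile is multiplied by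
`transportPhase` and re-expanded (`K2SlotMap.coeff`), truncated to the window. -/
def hTransport (α β θ : ℝ) (K : ℕ) (ζ : CState) : CState := fun m n' =>
  if m ∈ win K ∧ n' ∈ win K then
    coeff β ⟨fun y => modeProfile β K (ζ m) y * transportPhase (α + m) θ y, []⟩ n'
  else 0

/-- V slot (strain `θ`), TRANSPORTED part: column `n` is the family `(β + n, α)` (roles of the coordinates exchanged),
its profile over `x` read from the column. -/
def vTransport (α β θ : ℝ) (K : ℕ) (ζ : CState) : CState := fun m' n =>
  if m' ∈ win K ∧ n ∈ win K then
    coeff α ⟨fun x => modeProfile α K (fun m => ζ m n) x * transportPhase (β + n) θ x, []⟩ m'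
  else 0

/-- V slot, FRESH V-pair densities per column. -/
def vFresh (α β θ : ℝ) (K : ℕ) (ζ : CState) : ℤ → Fin 2 → ℂ := fun n =>
  if n ∈ win K then sheetAmps (β + n) α θ ⟨modeProfile α K (fun m => ζ m n), []⟩ else 0

/-- Lattice state of a V-sheet pair with densities `p`. -/
def vPairState (α : ℝ) (p : ℤ → Fin 2 → ℂ) : CState := fun m n =>
  p n 0 * Complex.exp (-(Real.pi * (α + m) / 2 : ℝ) * Complex.I)
    + p n 1 * Complex.exp ((Real.pi * (α + m) / 2 : ℝ) * Complex.I)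

/-- Lower edges of the shells. -/
def shellLo : ℕ → ℝ
  | 0 => 0
  | 1 => 16 / 25
  | (s + 2) => (2 : ℝ) ^ (s + 1)

/-- Upper edge of shell `s`. -/
def shellHi (s : ℕ) : ℝ := shellLo (s + 1)

/-- `x` lies in shell `s`. -/
def InShell (s : ℕ) (x : ℝ) : Prop := shellLo s ≤ |x| ∧ |x| < shellHi s


/-! ## Verbatim copies, continued (p4 `K2ConeSketch.lean` §1–§4: children, fresh H pairs, phase pieces, piece types, shells, `Transfer`) -/

/-- CHILDREN re-framing (one cascade level down, period halves): the modes of class `(α, β)` with parities `(pm, pn)`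
form the child class `((α + pm)/2, (β + pn)/2)` with `ζ_child(m, n) = ζ(2m + pm, 2n + pn)`. -/
def child (pm pn : ℤ) (ζ : CState) : CState := fun m n => ζ (2 * m + pm) (2 * n + pn)

/-- The child class of `(α, β)` with parities `(pm, pn)`. -/
def childClass (α β : ℝ) (pm pn : ℤ) : ℝ × ℝ := ((α + pm) / 2, (β + pn) / 2)

/-- The parity set `{0, 1}`. -/
def parities : Finset ℤ := {0, 1}

/-- H slot, FRESH H-pair densities per row (`K2SlotMap.sheetAmps` of the row's family): `q m = (q₊, q₋)` on
`y = 1/4`, `y = -1/4`, streamwise wavenumber `α + m`. -/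
def hFresh (α β θ : ℝ) (K : ℕ) (ζ : CState) : ℤ → Fin 2 → ℂ := fun m =>
  if m ∈ win K then sheetAmps (α + m) β θ ⟨modeProfile β K (ζ m), []⟩ else 0

/-- Lattice state of an H-sheet pair with densities `q` (engine `SH`): `Z(m,n) = q₊(m) e^{-iπ(β+n)/2} + q₋(m) e^{iπ(β+n)/2}`. -/
def hPairState (β : ℝ) (q : ℤ → Fin 2 → ℂ) : CState := fun m n =>
  q m 0 * Complex.exp (-(Real.pi * (β + n) / 2 : ℝ) * Complex.I)
    + q m 1 * Complex.exp ((Real.pi * (β + n) / 2 : ℝ) * Complex.I)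

/-! ## 3. Phase pieces (material bookkeeping of one phase = H slot then V slot at one level) -/

/-- The three pieces a phase produces from the state entering it. -/
structure PhasePieces where
  /-- densities of the fresh straight V-pair created in the V slot (type V). -/
  freshV : ℤ → Fin 2 → ℂ
  /-- densities of the fresh H-pair created in the H slot; at phase end its state is `vTransport (hPairState freshH)` (type H). -/
  freshH : ℤ → Fin 2 → ℂ
  /-- debris: the entering state transported by both slots. -/
  debris : CState

/-- The phase pieces of class `(α, β)` at truncation `K` (strain `θ` per slot): `T = hTransport ζ`, `hq = hFresh ζ`,
the V slot acts on `T + hPairState hq`; fresh V densities from the whole of it, debris = `vTransport T`. -/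
def phasePieces (α β θ : ℝ) (K : ℕ) (ζ : CState) : PhasePieces :=
  let T : CState := hTransport α β θ K ζ
  let hq : ℤ → Fin 2 → ℂ := hFresh α β θ K ζ
  let S : CState := fun m n => T m n + hPairState β hq m n
  ⟨vFresh α β θ K S, hq, vTransport α β θ K T⟩

/-- The total state at phase end: fresh V pair + V-transported fresh H pair + debris. -/
def phaseTotal (α β θ : ℝ) (K : ℕ) (ζ : CState) : CState := fun m n =>
  let pc := phasePieces α β θ K ζ
  vPairState α pc.freshV m n + vTransport α β θ K (hPairState β pc.freshH) m n + pc.debris m n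

/-- The two piece types carrying a shell profile: fresh straight V pairs and once-transported H pairs. -/
inductive PType
  | V
  | H
  deriving DecidableEq, Fintype

/-- Densities restricted to shell `s` (offset `c` = the class coordinate along the sheet). -/
def restrictShell (s : ℕ) (c : ℝ) (d : ℤ → Fin 2 → ℂ) : ℤ → Fin 2 → ℂ :=
  fun (k : ℤ) => if shellLo s ≤ |c + (k : ℝ)| ∧ |c + (k : ℝ)| < shellHi s then d k else 0

/-- "the densities `d` are supported in shell `s`". -/
def SupportedIn (s : ℕ) (c : ℝ) (d : ℤ → Fin 2 → ℂ) : Prop := ∀ k : ℤ, ¬ InShell s (c + (k : ℝ)) → d k = 0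

/-- v1.3: "the densities `d` are supported in shell `s` AND in the truncation window `|k| ≤ K`" (the engine's input basis). -/
def SupportedInW (s : ℕ) (c : ℝ) (K : ℕ) (d : ℤ → Fin 2 → ℂ) : Prop :=
  SupportedIn s c d ∧ ∀ k : ℤ, k ∉ win K → d k = 0

/-- v1.3: truncation of a class state to the window `|m|, |n| ≤ K` (the engine's `(2K+1)²` arrays). -/
def truncW (K : ℕ) (ζ : CState) : CState :=
  fun (m n : ℤ) => if m ∈ win K ∧ n ∈ win K then ζ m n else 0

/-- The lattice state, at phase ENTRY (class `(α, β)`, level 0), of an input piece of type `t` with densities `d`: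
a straight V pair (v1.3: window-truncated, as the engine's `SV` on the `(2K+1)²` lattice), resp. an H pair V-transported once
(created in the previous H slot of the same level; `vTransport` is windowed already). -/
def inputState (α β θ : ℝ) (K : ℕ) : PType → (ℤ → Fin 2 → ℂ) → CState
  | PType.V, p => truncW K (vPairState α p)
  | PType.H, q => vTransport α β θ K (hPairState β q)

/-- The class coordinate along the sheets of type `t`: `β` for V pairs (densities in `β + n`), `α` for H pairs. -/
def alongCoord (α β : ℝ) : PType → ℝ
  | PType.V => β
  | PType.H => α

/-- Level-`ℓ` energy of the output piece `(t', s')` among the phase pieces `pc` of a class `(α', β')` sitting at level `ℓ`. -/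
def outEnergyAt (α' β' θ : ℝ) (K ℓ : ℕ) (s' : ℕ) (pc : PhasePieces) : PType → ℝ
  | PType.V => cEnergy α' β' ℓ K (vPairState α' (restrictShell s' β' pc.freshV))
  | PType.H => cEnergy α' β' ℓ K (vTransport α' β' θ K (hPairState β' (restrictShell s' α' pc.freshH)))

/-- Level-1 energy of the output piece `(t', s')` among the phase pieces `pc` of the child class `(α', β')`. -/
def outEnergy (α' β' θ : ℝ) (K : ℕ) (s' : ℕ) (pc : PhasePieces) : PType → ℝ :=
  outEnergyAt α' β' θ K 1 s' pc

/-- SHELL-TRANSFER ENTRY `M[(t', s'), (t, s)] ≤ M` for the parent class `(α, β)` at truncation `K`: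
every input piece of type `t` with densities in shell `s` produces, summed over the four children and after their
phase, an output piece `(t', s')` of level-1 energy ≤ `M²` × its own level-0 energy.  (WO-p4-K2-4 computes the sup.) -/
def Transfer (α β θ : ℝ) (K : ℕ) (t : PType) (s : ℕ) (t' : PType) (s' : ℕ) (M : ℝ) : Prop :=
  ∀ d : ℤ → Fin 2 → ℂ, SupportedInW s (alongCoord α β t) K d →
    (∑ pm ∈ parities, ∑ pn ∈ parities,
        outEnergy ((α + pm) / 2) ((β + pn) / 2) θ K s'
          (phasePieces ((α + pm) / 2) ((β + pn) / 2) θ K (child pm pn (inputState α β θ K t d))) t')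
      ≤ M ^ 2 * cEnergy α β 0 K (inputState α β θ K t d)

/-- The lattice state of an `hz = true` comb with column coefficients `c`. -/
def combState (c : ℤ → ℂ) : CState := fun m n => if m = 0 then c n else 0

/-- **COMB-COLUMN CREATION ENTRY** `ι 0 (V, s) ≤ C` at strain `θ`, truncation `K`. -/
def CombColumnCreation (θ : ℝ) (K : ℕ) (s : ℕ) (C : ℝ) : Prop :=
  ∀ c : ℤ → ℂ, (∀ n : ℤ, ¬ InShell s ((n : ℤ) : ℝ) → c n = 0) →
    cEnergy 0 0 0 K (vPairState 0 (vFresh 0 0 θ K (combState c))) ≤ C ^ 2 * cEnergy 0 0 0 K (combState c)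

/-- **E5 — COMB-COLUMN LAW** (K-uniform). -/
def CombColumnLaw (θ : ℝ) (K₀ : ℕ) (C : ℝ) : Prop :=
  ∀ K : ℕ, K₀ ≤ K → ∀ s : ℕ, 1 ≤ s → CombColumnCreation θ K s (C * (Real.sqrt 2)⁻¹ ^ (s - 1))

/-! ## §1 The kernel of the crux copy in the tree's shape -/

/-- The tree's closed form of the kernel on one period. -/
def kernelK (a β : ℝ) : ℝ → ℂ := fun r : ℝ => (-((Real.exp (-(2 * Real.pi * a * r)) : ℂ) /
            (1 - starRingEnd ℂ (Complex.exp (2 * Real.pi * β * Complex.I)) * (Real.exp (-(2 * Real.pi * a)) : ℂ))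
          + (Real.exp (2 * Real.pi * a * (r - 1)) : ℂ) * Complex.exp (2 * Real.pi * β * Complex.I) /
            (1 - Complex.exp (2 * Real.pi * β * Complex.I) * (Real.exp (-(2 * Real.pi * a)) : ℂ))) /
        (2 * (2 * Real.pi * a) : ℂ))

/-- For `a > 0`, `lineKernel a β u = e^{2πiβ⌊u⌋} kernelK a β (u − ⌊u⌋)`. -/
theorem lineKernel_eq {a : ℝ} (ha : 0 < a) (β : ℝ) (u : ℝ) :
    lineKernel a β u = Complex.exp (2 * Real.pi * β * (⌊u⌋ : ℝ) * Complex.I) * kernelK a β (u - ⌊u⌋) := by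
  simp only [lineKernel, kernelK, abs_of_pos ha]
  push_cast
  ring_nf

/-- `2π · lineKernel a β 0 = Σ₀(a,β)` (tree `twoPi_lineKernel_zero`). -/
theorem twoPi_lineKernel_zero' {a : ℝ} (ha : 0 < a) (β : ℝ) :
    (2 * Real.pi : ℂ) * lineKernel a β 0 = ((sawSigma0 a β : ℝ) : ℂ) := by
  have h := twoPi_lineKernel_zero ha β
  have hz : Complex.exp (2 * Real.pi * β * Complex.I) = Complex.exp (((2 * Real.pi * β : ℝ) : ℂ) * Complex.I) := by push_cast; ring_nf
  simp only [lineKernel, Int.floor_zero, Int.cast_zero, Complex.ofReal_zero, sub_zero, mul_zero, zero_mul, neg_zero, Real.exp_zero,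
    Complex.ofReal_one, Complex.exp_zero, one_mul, zero_sub, mul_neg, mul_one, abs_of_pos ha, hz]
  convert h using 3
  push_cast
  ring

/-- `2π · conj (lineKernel a β ½) = S_β(a)` (tree `twoPi_conj_lineKernel_half`). -/
theorem twoPi_conj_lineKernel_half' {a : ℝ} (ha : 0 < a) (β : ℝ) :
    (2 * Real.pi : ℂ) * starRingEnd ℂ (lineKernel a β (1 / 2)) = sawS a β := by
  have h := twoPi_conj_lineKernel_half ha β
  have hz : Complex.exp (2 * Real.pi * β * Complex.I) = Complex.exp (((2 * Real.pi * β : ℝ) : ℂ) * Complex.I) := by push_cast; ring_nf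
  have hfl : ⌊(1 / 2 : ℝ)⌋ = 0 := by norm_num [Int.floor_eq_zero_iff]
  have he1 : Real.exp (-(2 * Real.pi * a * (1 / 2))) = Real.exp (-(a * Real.pi)) := by congr 1; ring
  have he2 : Real.exp (2 * Real.pi * a * (1 / 2 - 1)) = Real.exp (-(a * Real.pi)) := by congr 1; ring
  simp only [lineKernel, hfl, Int.cast_zero, Complex.ofReal_zero, sub_zero, mul_zero, zero_mul, Complex.exp_zero, one_mul,
    abs_of_pos ha, hz, he1, he2]
  convert h using 3
  push_cast
  ring

/-- The block entries spelled out. -/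
theorem blockX_apply (a β : ℝ) :
    blockX a β 0 0 = (((2 * Real.pi * a : ℝ) : ℂ) * Complex.I) * (-(1 / 4 : ℂ) - 2 * lineKernel a β 0) ∧
    blockX a β 0 1 = (((2 * Real.pi * a : ℝ) : ℂ) * Complex.I) * (-2 * lineKernel a β (1 / 2)) ∧
    blockX a β 1 0 = (((2 * Real.pi * a : ℝ) : ℂ) * Complex.I) * (2 * starRingEnd ℂ (lineKernel a β (1 / 2))) ∧
    blockX a β 1 1 = (((2 * Real.pi * a : ℝ) : ℂ) * Complex.I) * ((1 / 4 : ℂ) + 2 * lineKernel a β 0) := by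
  simp [blockX, Matrix.smul_apply, smul_eq_mul]

/-! ## §2 The stable branch (`|a| ≥ 1`) and the single source of the unit column -/

/-- `c²` is even in the streamwise wavenumber at Bloch phase `0` (tree `sawC2_zero_eq_sawC2zero`; `sawC2zero` is manifestly even). -/
theorem sawC2_neg_zero (k : ℝ) : sawC2 (-k) 0 = sawC2 k 0 := by
  rcases eq_or_ne k 0 with rfl | hk
  · simp
  rw [sawC2_zero_eq_sawC2zero hk, sawC2_zero_eq_sawC2zero (neg_ne_zero.2 hk)]
  simp only [sawC2zero, neg_mul, Real.cosh_neg, Real.sinh_neg, mul_neg, neg_neg]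

/-- `λ` is even in `a` at Bloch phase `0`. -/
theorem khLam_neg_zero (a : ℝ) : khLam (-a) 0 = khLam a 0 := by
  simp only [khLam, neg_sq, sawC2_neg_zero]

/-- For `a ≥ 1` the family is STABLE: `khLam a 0 < 0`. -/
theorem khLam_lt_zero {a : ℝ} (ha : 1 ≤ a) : khLam a 0 < 0 := by
  unfold khLam
  have h := sawC2_ge ha 0
  have : 0 < a ^ 2 * sawC2 a 0 := by positivity
  linarith

/-- The rotation rate `ω = √(−λ) = a·√(max 0 c²)` for `a ≥ 1`. -/
theorem sqrt_neg_khLam_eq {a : ℝ} (ha : 1 ≤ a) : Real.sqrt (-(khLam a 0)) = a * Real.sqrt (max 0 (sawC2 a 0)) := by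
  unfold khLam
  have hc : 0 ≤ sawC2 a 0 := by linarith [sawC2_ge ha 0]
  rw [neg_neg, max_eq_right hc, Real.sqrt_mul' _ hc, Real.sqrt_sq (by linarith)]

/-- The stable propagator entries: `propC = cos(ωt)`. -/
theorem propC_eq {a : ℝ} (ha : 1 ≤ a) (t : ℝ) : propC a 0 t = Real.cos (Real.sqrt (-(khLam a 0)) * t) := by
  have h := khLam_lt_zero ha
  simp only [propC, if_neg (not_lt.2 h.le), if_pos h]

/-- `propSn = sin(ωt)/ω` on the stable branch. -/
theorem propSn_eq {a : ℝ} (ha : 1 ≤ a) (t : ℝ) :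
    propSn a 0 t = Real.sin (Real.sqrt (-(khLam a 0)) * t) / Real.sqrt (-(khLam a 0)) := by
  have h := khLam_lt_zero ha
  simp only [propSn, if_neg (not_lt.2 h.le), if_pos h]

/-- The source of the UNIT column (interior `1`, Bloch phase `0`) on the kink line `y₀`, as a function of the strain time. -/
def src1 (a y₀ : ℝ) : ℝ → ℂ := fun s =>
  ∫ y in (-(1 / 2 : ℝ))..(1 / 2 : ℝ), lineKernel a 0 (y₀ - y) * Complex.exp (-((2 * Real.pi * a * s * triWave y : ℝ) : ℂ) * Complex.I)

/-- The forcing of the unit column: `f(s) = (2πia·(−2)·src1(¼,s), 2πia·2·src1(−¼,s))`. -/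
theorem forcing_pureMode (a s : ℝ) :
    forcing a 0 pureMode s = ![((2 * Real.pi * a : ℝ) * Complex.I : ℂ) * (-2) * src1 a (1 / 4) s,
      ((2 * Real.pi * a : ℝ) * Complex.I : ℂ) * 2 * src1 a (-(1 / 4)) s] := by
  simp only [forcing, pureMode, transportPhase, src1, List.map_nil, List.sum_nil, add_zero, mul_one]

/-- The unit-column source in the tree's shape (with the trivial mode factor `e^{2πi·0·y}`). -/
theorem src1_eq_tree (a y₀ s : ℝ) :
    src1 a y₀ s = ∫ y in (-(1 / 2 : ℝ))..(1 / 2 : ℝ), lineKernel a 0 (y₀ - y) * Complex.exp (((2 * Real.pi * (0 : ℝ) * y : ℝ) : ℂ) * Complex.I) *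
      Complex.exp (-((2 * Real.pi * a * s * triWave y : ℝ) : ℂ) * Complex.I) :=
  intervalIntegral.integral_congr fun y _ => by simp

/-- The unit-column sources are continuous in the strain time (`a > 0`). -/
theorem continuous_src1 {a : ℝ} (ha : 0 < a) {y₀ : ℝ} (hy₀ : y₀ = 1 / 4 ∨ y₀ = -(1 / 4)) : Continuous (src1 a y₀) := by
  have h := continuous_singleMode_src ha 0 0 (K := kernelK a 0) rfl (lineKernel_eq ha 0) hy₀
  have e : src1 a y₀ = fun s : ℝ => ∫ y in (-(1 / 2 : ℝ))..(1 / 2 : ℝ), lineKernel a 0 (y₀ - y) *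
      Complex.exp (((2 * Real.pi * (0 : ℝ) * y : ℝ) : ℂ) * Complex.I) * Complex.exp (-((2 * Real.pi * a * s * triWave y : ℝ) : ℂ) * Complex.I) :=
    funext fun s => src1_eq_tree a y₀ s
  rw [e]; exact h

/-- **Pointwise envelope of the unit-column sources** (tree `norm_src_quarter_mode0_le`, `norm_src_negQuarter_mode0_le`). -/
theorem norm_src1_le {a : ℝ} (ha : 0 < a) {y₀ : ℝ} (hy₀ : y₀ = 1 / 4 ∨ y₀ = -(1 / 4)) (s : ℝ) :
    ‖src1 a y₀ s‖ ≤ (2 + 2 * Real.exp (-(2 * Real.pi * a) / 4) + 4 * Real.exp (-(2 * Real.pi * a) / 4) ^ 2 + 2 * Real.exp (-(2 * Real.pi * a) / 4) ^ 3 +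
          2 * Real.exp (-(2 * Real.pi * a) / 4) ^ 4) /
        (((1 - Real.exp (-(2 * Real.pi * a))) * (2 * (2 * Real.pi * a))) * ((2 * Real.pi * a) * Real.sqrt (1 + s ^ 2))) := by
  rcases hy₀ with h | h <;> subst h
  · exact norm_src_quarter_mode0_le ha 0 s (K := kernelK a 0) (G := lineKernel a 0) rfl (lineKernel_eq ha 0)
  · exact norm_src_negQuarter_mode0_le ha 0 s (K := kernelK a 0) (G := lineKernel a 0) rfl (lineKernel_eq ha 0)

/-! ## §3 The created pair of the unit column IS the tree's Duhamel integral (`a ≥ 1`) -/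

/-- The Duhamel integrand of the unit column is continuous in the strain time (stable branch, sources continuous). -/
theorem continuous_duhamelIntegrand {a : ℝ} (ha : 1 ≤ a) (θ : ℝ) :
    Continuous fun s : ℝ => (propagator a 0 (θ - s)).mulVec (forcing a 0 pureMode s) := by
  have ha0 : 0 < a := by linarith
  have hs0 := continuous_src1 ha0 (y₀ := 1 / 4) (Or.inl rfl)
  have hs1 := continuous_src1 ha0 (y₀ := -(1 / 4)) (Or.inr rfl)
  apply continuous_pi
  intro j
  simp only [forcing_pureMode, propagator, propC_eq ha, propSn_eq ha, Matrix.add_mulVec, Matrix.smul_mulVec, Matrix.one_mulVec]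
  simp only [Pi.add_apply, Pi.smul_apply, smul_eq_mul, Matrix.mulVec, dotProduct, Fin.sum_univ_two]
  fin_cases j
  · simp only [Fin.zero_eta, Fin.isValue, Matrix.cons_val_zero, Matrix.cons_val_one]
    fun_prop
  · simp only [Fin.mk_one, Fin.isValue, Matrix.cons_val_zero, Matrix.cons_val_one]
    fun_prop

/-- **Reduction, component `0`:** `sheetAmps a 0 θ pureMode 0` is the tree's Duhamel integral (`a ≥ 1`). -/
theorem sheetAmps_pureMode_apply_0 {a : ℝ} (ha : 1 ≤ a) (θ : ℝ) :
    sheetAmps a 0 θ pureMode 0 = ∫ s in (0 : ℝ)..θ,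
      ((Real.cos (Real.sqrt (-(khLam a 0)) * (θ - s)) : ℂ) * ((((2 * Real.pi * a : ℝ) * Complex.I : ℂ) * (-2)) * src1 a (1 / 4) s) +
        ((Real.sin (Real.sqrt (-(khLam a 0)) * (θ - s)) / Real.sqrt (-(khLam a 0)) : ℝ) : ℂ) *
          (blockX a 0 0 0 * ((((2 * Real.pi * a : ℝ) * Complex.I : ℂ) * (-2)) * src1 a (1 / 4) s) +
            blockX a 0 0 1 * ((((2 * Real.pi * a : ℝ) * Complex.I : ℂ) * 2) * src1 a (-(1 / 4)) s))) := by
  have hint := (continuous_duhamelIntegrand ha θ).intervalIntegrable (μ := volume) 0 θ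
  have hcomp := ((ContinuousLinearMap.proj (R := ℂ) (φ := fun _ : Fin 2 => ℂ) (0 : Fin 2)).intervalIntegral_comp_comm hint).symm
  simp only [ContinuousLinearMap.proj_apply] at hcomp
  unfold sheetAmps
  rw [hcomp]
  refine intervalIntegral.integral_congr fun s _ => ?_
  simp only [forcing_pureMode, propagator, propC_eq ha, propSn_eq ha, Matrix.add_mulVec, Matrix.smul_mulVec, Matrix.one_mulVec]
  simp only [Pi.add_apply, Pi.smul_apply, smul_eq_mul, Matrix.mulVec, dotProduct, Fin.sum_univ_two, Fin.isValue, Matrix.cons_val_zero,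
    Matrix.cons_val_one]

/-- **Reduction, component `1`:** `sheetAmps a 0 θ pureMode 1` is the tree's Duhamel integral (`a ≥ 1`). -/
theorem sheetAmps_pureMode_apply_1 {a : ℝ} (ha : 1 ≤ a) (θ : ℝ) :
    sheetAmps a 0 θ pureMode 1 = ∫ s in (0 : ℝ)..θ,
      ((Real.cos (Real.sqrt (-(khLam a 0)) * (θ - s)) : ℂ) * ((((2 * Real.pi * a : ℝ) * Complex.I : ℂ) * 2) * src1 a (-(1 / 4)) s) +
        ((Real.sin (Real.sqrt (-(khLam a 0)) * (θ - s)) / Real.sqrt (-(khLam a 0)) : ℝ) : ℂ) *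
          (blockX a 0 1 0 * ((((2 * Real.pi * a : ℝ) * Complex.I : ℂ) * (-2)) * src1 a (1 / 4) s) +
            blockX a 0 1 1 * ((((2 * Real.pi * a : ℝ) * Complex.I : ℂ) * 2) * src1 a (-(1 / 4)) s))) := by
  have hint := (continuous_duhamelIntegrand ha θ).intervalIntegrable (μ := volume) 0 θ
  have hcomp := ((ContinuousLinearMap.proj (R := ℂ) (φ := fun _ : Fin 2 => ℂ) (1 : Fin 2)).intervalIntegral_comp_comm hint).symm
  simp only [ContinuousLinearMap.proj_apply] at hcomp
  unfold sheetAmps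
  rw [hcomp]
  refine intervalIntegral.integral_congr fun s _ => ?_
  simp only [forcing_pureMode, propagator, propC_eq ha, propSn_eq ha, Matrix.add_mulVec, Matrix.smul_mulVec, Matrix.one_mulVec]
  simp only [Pi.add_apply, Pi.smul_apply, smul_eq_mul, Matrix.mulVec, dotProduct, Fin.sum_univ_two, Fin.isValue, Matrix.cons_val_zero,
    Matrix.cons_val_one]

/-! ## §4 P2-S at Bloch phase `0`: `a ↦ −a` is complex conjugation -/

/-- The kernel depends on `|a|` only. -/
theorem lineKernel_neg (a β y : ℝ) : lineKernel (-a) β y = lineKernel a β y := by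
  simp only [lineKernel, abs_neg]

/-- At Bloch phase `0` the kernel is real. -/
theorem conj_lineKernel_zero (a y : ℝ) : starRingEnd ℂ (lineKernel a 0 y) = lineKernel a 0 y := by
  simp only [lineKernel, Complex.ofReal_zero, mul_zero, zero_mul, Complex.exp_zero, map_one, one_mul, map_mul, map_div₀, map_add,
    map_neg, map_sub, Complex.conj_ofReal, map_ofNat, mul_one]

/-- The transport phase at `−a` is the conjugate. -/
theorem transportPhase_neg (a θ y : ℝ) : transportPhase (-a) θ y = starRingEnd ℂ (transportPhase a θ y) := by
  simp only [transportPhase, ← Complex.exp_conj, map_mul, map_neg, Complex.conj_ofReal, Complex.conj_I]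
  congr 1
  push_cast
  ring

/-- The Kelvin–Helmholtz block at `−a` (Bloch `0`) is the entrywise conjugate. -/
theorem blockX_neg_zero (a : ℝ) (i j : Fin 2) : blockX (-a) 0 i j = starRingEnd ℂ (blockX a 0 i j) := by
  obtain ⟨e00, e01, e10, e11⟩ := blockX_apply (-a) 0
  obtain ⟨f00, f01, f10, f11⟩ := blockX_apply a 0
  have hG : starRingEnd ℂ (lineKernel a 0 0) = lineKernel a 0 0 := conj_lineKernel_zero a 0
  have hH : starRingEnd ℂ (lineKernel a 0 (1 / 2)) = lineKernel a 0 (1 / 2) := conj_lineKernel_zero a (1 / 2)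
  fin_cases i <;> fin_cases j
  · simp only [Fin.zero_eta, Fin.isValue, e00, f00, lineKernel_neg, map_mul, map_sub, map_neg, map_div₀, map_one, map_ofNat,
      Complex.conj_ofReal, Complex.conj_I, hG]
    push_cast; ring
  · simp only [Fin.zero_eta, Fin.mk_one, Fin.isValue, e01, f01, lineKernel_neg, map_mul, map_neg, map_ofNat, Complex.conj_ofReal,
      Complex.conj_I, hH]
    push_cast; ring
  · simp only [Fin.mk_one, Fin.zero_eta, Fin.isValue, e10, f10, lineKernel_neg, map_mul, map_ofNat, Complex.conj_ofReal, Complex.conj_I,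
      hH]
    push_cast; ring
  · simp only [Fin.mk_one, Fin.isValue, e11, f11, lineKernel_neg, map_mul, map_add, map_div₀, map_one, map_ofNat, Complex.conj_ofReal,
      Complex.conj_I, hG]
    push_cast; ring

/-- The propagator scalars are even in `a` (Bloch `0`). -/
theorem propC_neg_zero (a t : ℝ) : propC (-a) 0 t = propC a 0 t := by
  simp only [propC, khLam_neg_zero]

/-- The propagator scalars are even in `a` (Bloch `0`). -/
theorem propSn_neg_zero (a t : ℝ) : propSn (-a) 0 t = propSn a 0 t := by
  simp only [propSn, khLam_neg_zero]

/-- The propagator at `−a` (Bloch `0`) is the entrywise conjugate. -/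
theorem propagator_neg_zero (a t : ℝ) (i j : Fin 2) : propagator (-a) 0 t i j = starRingEnd ℂ (propagator a 0 t i j) := by
  simp only [propagator, Matrix.add_apply, Matrix.smul_apply, smul_eq_mul, propC_neg_zero, propSn_neg_zero, map_add, map_mul,
    Complex.conj_ofReal, blockX_neg_zero]
  congr 2
  fin_cases i <;> fin_cases j <;> simp

/-- The unit-column source at `−a` is the conjugate (the kernel is real, the transport phase conjugates). -/
theorem src1_neg (a y₀ s : ℝ) : src1 (-a) y₀ s = starRingEnd ℂ (src1 a y₀ s) := by
  simp only [src1, ← intervalIntegral.intervalIntegral_conj, map_mul, conj_lineKernel_zero, lineKernel_neg, ← Complex.exp_conj,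
    map_neg, Complex.conj_ofReal, Complex.conj_I]
  refine intervalIntegral.integral_congr fun y _ => ?_
  congr 2
  push_cast
  ring

/-- The unit-column forcing at `−a` is the componentwise conjugate. -/
theorem forcing_neg_pureMode (a s : ℝ) (j : Fin 2) : forcing (-a) 0 pureMode s j = starRingEnd ℂ (forcing a 0 pureMode s j) := by
  rw [forcing_pureMode, forcing_pureMode]
  fin_cases j
  · simp only [Fin.zero_eta, Fin.isValue, Matrix.cons_val_zero, map_mul, map_neg, map_ofNat, Complex.conj_ofReal, Complex.conj_I, src1_neg]
    push_cast; ring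
  · simp only [Fin.mk_one, Fin.isValue, Matrix.cons_val_one, Matrix.cons_val_zero, map_mul, map_ofNat, Complex.conj_ofReal,
      Complex.conj_I, src1_neg]
    push_cast; ring

/-- The Duhamel integrand at `−a` is the componentwise conjugate. -/
theorem duhamelIntegrand_neg (a θ s : ℝ) :
    (propagator (-a) 0 (θ - s)).mulVec (forcing (-a) 0 pureMode s) = star ((propagator a 0 (θ - s)).mulVec (forcing a 0 pureMode s)) := by
  funext i
  simp only [Matrix.mulVec, dotProduct, Fin.sum_univ_two, Pi.star_apply, propagator_neg_zero, forcing_neg_pureMode, star_add, star_mul',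
    Complex.star_def]

/-- **P2-S at Bloch phase `0`:** `sheetAmps (−a) 0 θ pureMode i = conj (sheetAmps a 0 θ pureMode i)` (`a ≥ 1`: the created pair of the column `−b` is
the conjugate of that of `b`). -/
theorem sheetAmps_neg_pureMode {a : ℝ} (ha : 1 ≤ a) (θ : ℝ) (i : Fin 2) :
    sheetAmps (-a) 0 θ pureMode i = starRingEnd ℂ (sheetAmps a 0 θ pureMode i) := by
  have hF := continuous_duhamelIntegrand ha θ
  have e : (fun s : ℝ => (propagator (-a) 0 (θ - s)).mulVec (forcing (-a) 0 pureMode s)) =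
      fun s : ℝ => star ((propagator a 0 (θ - s)).mulVec (forcing a 0 pureMode s)) := funext fun s => duhamelIntegrand_neg a θ s
  have hF' : Continuous fun s : ℝ => (propagator (-a) 0 (θ - s)).mulVec (forcing (-a) 0 pureMode s) := by
    rw [e]; exact continuous_star.comp hF
  have hint := hF.intervalIntegrable (μ := volume) 0 θ
  have hint' := hF'.intervalIntegrable (μ := volume) 0 θ
  have h1 := ((ContinuousLinearMap.proj (R := ℂ) (φ := fun _ : Fin 2 => ℂ) i).intervalIntegral_comp_comm hint).symm
  have h2 := ((ContinuousLinearMap.proj (R := ℂ) (φ := fun _ : Fin 2 => ℂ) i).intervalIntegral_comp_comm hint').symm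
  simp only [ContinuousLinearMap.proj_apply] at h1 h2
  unfold sheetAmps
  rw [h1, h2, ← intervalIntegral.intervalIntegral_conj]
  refine intervalIntegral.integral_congr fun s _ => ?_
  have := congrFun (duhamelIntegrand_neg a θ s) i
  simp only [Pi.star_apply, Complex.star_def] at this
  exact this

/-! ## §5 The created amplitude of the unit column BY NAME: `≤ 0.8865/|a|` for `|a| ≥ 4`, `0 ≤ θ ≤ 8` -/

/-- Positive columns `a ≥ 4`. -/
theorem norm_sheetAmps_pureMode_le_of_pos {a : ℝ} (ha : 4 ≤ a) {θ : ℝ} (hθ0 : 0 ≤ θ) (hθ : θ ≤ 8) (i : Fin 2) :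
    ‖sheetAmps a 0 θ pureMode i‖ ≤ 0.8865 / a := by
  have ha1 : 1 ≤ a := by linarith
  have ha0 : 0 < a := by linarith
  have h0 := twoPi_lineKernel_zero' ha0 0
  have hh := twoPi_conj_lineKernel_half' ha0 0
  have hE₀ := norm_src1_le ha0 (y₀ := 1 / 4) (Or.inl rfl)
  have hE₁ := norm_src1_le ha0 (y₀ := -(1 / 4)) (Or.inr rfl)
  obtain ⟨e00, e01, e10, e11⟩ := blockX_apply a 0
  fin_cases i
  · simp only [Fin.zero_eta, Fin.isValue]
    rw [sheetAmps_pureMode_apply_0 ha1, sqrt_neg_khLam_eq ha1, e00, e01]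
    exact comb_creation_num_le ha hθ0 hθ h0 hh hE₀ hE₁
  · simp only [Fin.mk_one, Fin.isValue]
    rw [sheetAmps_pureMode_apply_1 ha1, sqrt_neg_khLam_eq ha1, e10, e11]
    exact comb_creation_num_le' ha hθ0 hθ h0 hh hE₀ hE₁

/-- **All columns `|a| ≥ 4`:** `‖sheetAmps a 0 θ pureMode i‖ ≤ 0.8865/|a|` (`0 ≤ θ ≤ 8`). -/
theorem norm_sheetAmps_pureMode_le {a : ℝ} (ha : 4 ≤ |a|) {θ : ℝ} (hθ0 : 0 ≤ θ) (hθ : θ ≤ 8) (i : Fin 2) :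
    ‖sheetAmps a 0 θ pureMode i‖ ≤ 0.8865 / |a| := by
  rcases le_or_gt 0 a with h | h
  · rw [abs_of_nonneg h] at ha ⊢
    exact norm_sheetAmps_pureMode_le_of_pos ha hθ0 hθ i
  · rw [abs_of_neg h] at ha ⊢
    have e : a = -(-a) := by ring
    rw [e, sheetAmps_neg_pureMode (by linarith) θ i, Complex.norm_conj, neg_neg]
    exact norm_sheetAmps_pureMode_le_of_pos ha hθ0 hθ i

/-! ## §6 The comb: column states, linearity, energy bookkeeping -/

/-- **Linearity in a constant interior factor:** `sheetAmps a β θ ⟨c·f, []⟩ = c • sheetAmps a β θ ⟨f, []⟩`. -/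
theorem sheetAmps_const_interior (a β θ : ℝ) (c : ℂ) (f : ℝ → ℂ) :
    sheetAmps a β θ ⟨fun y => c * f y, []⟩ = c • sheetAmps a β θ ⟨f, []⟩ := by
  have hf : ∀ s, forcing a β ⟨fun y => c * f y, []⟩ s = c • forcing a β ⟨f, []⟩ s := by
    intro s
    have hi : ∀ y0 : ℝ, (∫ y in (-(1 / 2 : ℝ))..(1 / 2), lineKernel a β (y0 - y) * (c * f y) * transportPhase a s y) =
        c * ∫ y in (-(1 / 2 : ℝ))..(1 / 2), lineKernel a β (y0 - y) * f y * transportPhase a s y := by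
      intro y0
      rw [← intervalIntegral.integral_const_mul]
      exact intervalIntegral.integral_congr fun y _ => by ring
    simp only [forcing, List.map_nil, List.sum_nil, add_zero, hi]
    funext i
    fin_cases i <;> simp <;> ring
  unfold sheetAmps
  simp_rw [hf, Matrix.mulVec_smul, intervalIntegral.integral_smul]

/-- The V-family profile of comb column `n` is the constant `c n`. -/
theorem modeProfile_combState (K : ℕ) (c : ℤ → ℂ) (n : ℤ) : modeProfile 0 K (fun m => combState c m n) = fun _ => c n * 1 := by
  funext y
  simp only [modeProfile, combState]
  rw [Finset.sum_eq_single 0]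
  · simp
  · intro m _ hm
    simp [hm]
  · intro h
    exact absurd (by simp [win]) h

/-- The created V pair of comb column `n` (inside the window) is `c n •` the pair of the UNIT column `pureMode` on the line `a = n`. -/
theorem vFresh_combState (θ : ℝ) (K : ℕ) (c : ℤ → ℂ) {n : ℤ} (hn : n ∈ win K) :
    vFresh 0 0 θ K (combState c) n = c n • sheetAmps (n : ℝ) 0 θ pureMode := by
  simp only [vFresh, if_pos hn, zero_add, modeProfile_combState]
  exact sheetAmps_const_interior (n : ℝ) 0 θ (c n) (fun _ => 1)

/-- The comb's energy, column by column: `cEnergy 0 0 0 K (combState c) = Σ_{|n| ≤ K} ‖c n‖²/(4π²n²)`. -/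
theorem cEnergy_combState (K : ℕ) (c : ℤ → ℂ) :
    cEnergy 0 0 0 K (combState c) = ∑ n ∈ win K, ‖c n‖ ^ 2 / (4 * Real.pi ^ 2 * (n : ℝ) ^ 2) := by
  simp only [cEnergy]
  rw [Finset.sum_comm]
  refine Finset.sum_congr rfl fun n _ => ?_
  rw [Finset.sum_eq_single 0]
  · simp [combState]
  · intro m _ hm
    simp [combState, hm]
  · intro h
    exact absurd (by simp [win]) h

/-- The V pair state's energy, column by column. -/
theorem cEnergy_vPairState (K : ℕ) (p : ℤ → Fin 2 → ℂ) :
    cEnergy 0 0 0 K (vPairState 0 p) = ∑ n ∈ win K, ∑ m ∈ win K,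
      ‖p n 0 * Complex.exp (-(Real.pi * ((0 : ℝ) + m) / 2 : ℝ) * Complex.I) + p n 1 * Complex.exp ((Real.pi * ((0 : ℝ) + m) / 2 : ℝ) * Complex.I)‖ ^ 2 /
        (4 * Real.pi ^ 2 * ((m : ℝ) ^ 2 + (n : ℝ) ^ 2)) := by
  simp only [cEnergy, vPairState]
  rw [Finset.sum_comm]
  refine Finset.sum_congr rfl fun n _ => Finset.sum_congr rfl fun m _ => ?_
  simp

/-- **Energy of one column's created pair** (`|n| ≥ 4`, `0 ≤ θ ≤ 8`): the windowed lattice energy of the pair created by the UNIT column `n` is at most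
`(4.94/|n|)·(1/(4π²n²))` (tree `comb_pair_energy_num_le` at `a = |n|`, amplitudes from `norm_sheetAmps_pureMode_le`; window ≤ full lattice sum). -/
theorem column_energy_le {n : ℤ} (hn : 4 ≤ |(n : ℝ)|) {θ : ℝ} (hθ0 : 0 ≤ θ) (hθ : θ ≤ 8) (K : ℕ) :
    ∑ m ∈ win K, ‖sheetAmps (n : ℝ) 0 θ pureMode 0 * Complex.exp (-(Real.pi * ((0 : ℝ) + m) / 2 : ℝ) * Complex.I) +
        sheetAmps (n : ℝ) 0 θ pureMode 1 * Complex.exp ((Real.pi * ((0 : ℝ) + m) / 2 : ℝ) * Complex.I)‖ ^ 2 /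
        (4 * Real.pi ^ 2 * ((m : ℝ) ^ 2 + (n : ℝ) ^ 2)) ≤ 4.94 / |(n : ℝ)| * (1 / (4 * Real.pi ^ 2 * (n : ℝ) ^ 2)) := by
  set q₀ := sheetAmps (n : ℝ) 0 θ pureMode 0 with hq₀
  set q₁ := sheetAmps (n : ℝ) 0 θ pureMode 1 with hq₁
  have ha0 : 0 < |(n : ℝ)| := by linarith
  have h₀ : ‖q₀‖ ≤ 0.8865 / |(n : ℝ)| := norm_sheetAmps_pureMode_le hn hθ0 hθ 0
  have h₁ : ‖q₁‖ ≤ 0.8865 / |(n : ℝ)| := norm_sheetAmps_pureMode_le hn hθ0 hθ 1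
  have hT := comb_pair_energy_num_le hn 0 h₀ h₁
  have hS := (sheetPair_energy_hasSum' ha0 0 q₀ q₁).summable
  have e : ∀ m : ℤ, ‖q₀ * Complex.exp (-(2 * Real.pi * ((0 : ℝ) + m) * (1 / 4 : ℝ) : ℝ) * Complex.I) +
        q₁ * Complex.exp (-(2 * Real.pi * ((0 : ℝ) + m) * (-(1 / 4 : ℝ)) : ℝ) * Complex.I)‖ ^ 2 / (4 * Real.pi ^ 2 * (|(n : ℝ)| ^ 2 + ((0 : ℝ) + m) ^ 2)) =
      ‖q₀ * Complex.exp (-(Real.pi * ((0 : ℝ) + m) / 2 : ℝ) * Complex.I) + q₁ * Complex.exp ((Real.pi * ((0 : ℝ) + m) / 2 : ℝ) * Complex.I)‖ ^ 2 /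
        (4 * Real.pi ^ 2 * ((m : ℝ) ^ 2 + (n : ℝ) ^ 2)) := by
    intro m
    have b1 : (-((2 * Real.pi * ((0 : ℝ) + m) * (1 / 4 : ℝ) : ℝ) : ℂ) * Complex.I) = -((Real.pi * ((0 : ℝ) + m) / 2 : ℝ) : ℂ) * Complex.I := by
      push_cast; ring
    have b2 : (-((2 * Real.pi * ((0 : ℝ) + m) * (-(1 / 4 : ℝ)) : ℝ) : ℂ) * Complex.I) = ((Real.pi * ((0 : ℝ) + m) / 2 : ℝ) : ℂ) * Complex.I := by
      push_cast; ring
    rw [b1, b2, sq_abs]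
    congr 1; ring
  simp_rw [e] at hT hS
  refine le_trans (hS.sum_le_tsum (win K) fun m _ => by positivity) ?_
  simpa only [sq_abs] using hT

/-! ## §7 E5 BY NAME: the comb-column creation entry for every shell `s ≥ 3`, and the K-uniform law from the two head shells -/

/-- `cEnergy` is a sum of nonnegative terms. -/
theorem cEnergy_nonneg (α β : ℝ) (ℓ K : ℕ) (ζ : CState) : 0 ≤ cEnergy α β ℓ K ζ := by
  unfold cEnergy
  exact Finset.sum_nonneg fun m _ => Finset.sum_nonneg fun n _ => by positivity

/-- Monotonicity of the entry in the constant. -/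
theorem combColumnCreation_mono {θ : ℝ} {K s : ℕ} {C C' : ℝ} (h : CombColumnCreation θ K s C) (hC : 0 ≤ C) (hCC' : C ≤ C') :
    CombColumnCreation θ K s C' := by
  intro c hc
  refine (h c hc).trans ?_
  exact mul_le_mul_of_nonneg_right (pow_le_pow_left₀ hC hCC' 2) (cEnergy_nonneg _ _ _ _ _)

/-- `((√2)⁻¹)^j` squared is `(2^j)⁻¹`. -/
theorem sqrt_two_inv_pow_sq (j : ℕ) : ((Real.sqrt 2)⁻¹ ^ j) ^ 2 = ((2 : ℝ) ^ j)⁻¹ := by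
  rw [← pow_mul, mul_comm, pow_mul, inv_pow, Real.sq_sqrt (by norm_num : (0 : ℝ) ≤ 2), inv_pow]

/-- **E5 TAIL BY NAME.** For every truncation `K` and every shell `s ≥ 3` (columns `|b| ≥ 4`):
`CombColumnCreation 8 K s (2.23 · (√2)⁻¹ ^ (s − 1))`, i.e. p4's comb-column creation entry `ι 0 (V, s) ≤ 2.23 · 2^{−(s−1)/2}`, K-uniformly.
(The S4 line of record loads `63/50 · 2^{−(s−1)/2}`, measured; its budget tolerates `C ≤ 2.4` for the tail `s ≥ 7`, A26-12.) -/
theorem combColumnCreation_tail (K : ℕ) {s : ℕ} (hs : 3 ≤ s) : CombColumnCreation 8 K s (2.23 * (Real.sqrt 2)⁻¹ ^ (s - 1)) := by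
  obtain ⟨k, rfl⟩ : ∃ k, s = k + 2 := ⟨s - 2, by omega⟩
  have hk : 1 ≤ k := by omega
  rw [show k + 2 - 1 = k + 1 by omega]
  intro c hc
  rw [cEnergy_vPairState, cEnergy_combState, Finset.mul_sum]
  refine Finset.sum_le_sum fun n hn => ?_
  simp_rw [vFresh_combState 8 K c hn, Pi.smul_apply, smul_eq_mul]
  by_cases hin : InShell (k + 2) ((n : ℤ) : ℝ)
  · have hlo : (2 : ℝ) ^ (k + 1) ≤ |(n : ℝ)| := hin.1
    have h4 : (4 : ℝ) ≤ 2 ^ (k + 1) := by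
      calc (4 : ℝ) = 2 ^ (1 + 1) := by norm_num
        _ ≤ 2 ^ (k + 1) := pow_le_pow_right₀ (by norm_num) (by omega)
    have hn4 : 4 ≤ |(n : ℝ)| := h4.trans hlo
    have hcol := column_energy_le hn4 (θ := 8) (by norm_num) le_rfl K
    set q₀ := sheetAmps (n : ℝ) 0 8 pureMode 0
    set q₁ := sheetAmps (n : ℝ) 0 8 pureMode 1
    have factor : ∀ m : ℤ, ‖c n * q₀ * Complex.exp (-(Real.pi * ((0 : ℝ) + m) / 2 : ℝ) * Complex.I) +
          c n * q₁ * Complex.exp ((Real.pi * ((0 : ℝ) + m) / 2 : ℝ) * Complex.I)‖ ^ 2 / (4 * Real.pi ^ 2 * ((m : ℝ) ^ 2 + (n : ℝ) ^ 2)) =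
        ‖c n‖ ^ 2 * (‖q₀ * Complex.exp (-(Real.pi * ((0 : ℝ) + m) / 2 : ℝ) * Complex.I) +
          q₁ * Complex.exp ((Real.pi * ((0 : ℝ) + m) / 2 : ℝ) * Complex.I)‖ ^ 2 / (4 * Real.pi ^ 2 * ((m : ℝ) ^ 2 + (n : ℝ) ^ 2))) := by
      intro m
      rw [show c n * q₀ * Complex.exp (-(Real.pi * ((0 : ℝ) + m) / 2 : ℝ) * Complex.I) +
          c n * q₁ * Complex.exp ((Real.pi * ((0 : ℝ) + m) / 2 : ℝ) * Complex.I) =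
          c n * (q₀ * Complex.exp (-(Real.pi * ((0 : ℝ) + m) / 2 : ℝ) * Complex.I) +
            q₁ * Complex.exp ((Real.pi * ((0 : ℝ) + m) / 2 : ℝ) * Complex.I)) by ring, norm_mul, mul_pow]
      ring
    rw [Finset.sum_congr rfl fun m _ => factor m, ← Finset.mul_sum]
    have hA : 0 ≤ ‖c n‖ ^ 2 / (4 * Real.pi ^ 2 * (n : ℝ) ^ 2) := by positivity
    have hpos : (0 : ℝ) < 2 ^ (k + 1) := by positivity
    have hcmp : 4.94 / |(n : ℝ)| ≤ (2.23 * (Real.sqrt 2)⁻¹ ^ (k + 1)) ^ 2 := by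
      rw [mul_pow, sqrt_two_inv_pow_sq]
      calc 4.94 / |(n : ℝ)| ≤ 4.94 / 2 ^ (k + 1) := div_le_div_of_nonneg_left (by norm_num) hpos hlo
        _ ≤ (2.23 : ℝ) ^ 2 * (2 ^ (k + 1))⁻¹ := by rw [div_eq_mul_inv]; gcongr; norm_num
    calc ‖c n‖ ^ 2 * ∑ m ∈ win K, ‖q₀ * Complex.exp (-(Real.pi * ((0 : ℝ) + m) / 2 : ℝ) * Complex.I) +
            q₁ * Complex.exp ((Real.pi * ((0 : ℝ) + m) / 2 : ℝ) * Complex.I)‖ ^ 2 / (4 * Real.pi ^ 2 * ((m : ℝ) ^ 2 + (n : ℝ) ^ 2))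
        ≤ ‖c n‖ ^ 2 * (4.94 / |(n : ℝ)| * (1 / (4 * Real.pi ^ 2 * (n : ℝ) ^ 2))) := mul_le_mul_of_nonneg_left hcol (sq_nonneg _)
      _ = 4.94 / |(n : ℝ)| * (‖c n‖ ^ 2 / (4 * Real.pi ^ 2 * (n : ℝ) ^ 2)) := by ring
      _ ≤ (2.23 * (Real.sqrt 2)⁻¹ ^ (k + 1)) ^ 2 * (‖c n‖ ^ 2 / (4 * Real.pi ^ 2 * (n : ℝ) ^ 2)) :=
          mul_le_mul_of_nonneg_right hcmp hA
  · have hc0 : c n = 0 := hc n hin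
    simp [hc0]

/-- **The K-uniform law from the two head shells.** If the head shells `s = 1, 2` (columns `±1`, `±2`, `±3`) are certified at every `K ≥ K₀` with a constant
`C ≥ 2.23`, then `CombColumnLaw 8 K₀ C` (all shells, all `K ≥ K₀`). -/
theorem combColumnLaw_of_head {K₀ : ℕ} {C : ℝ} (hC : 2.23 ≤ C) (h1 : ∀ K : ℕ, K₀ ≤ K → CombColumnCreation 8 K 1 C)
    (h2 : ∀ K : ℕ, K₀ ≤ K → CombColumnCreation 8 K 2 (C * (Real.sqrt 2)⁻¹)) : CombColumnLaw 8 K₀ C := by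
  intro K hK s hs
  rcases Nat.lt_or_ge s 3 with h | h
  · interval_cases s
    · simpa using h1 K hK
    · simpa using h2 K hK
  · refine combColumnCreation_mono (combColumnCreation_tail K h) (by positivity) ?_
    exact mul_le_mul_of_nonneg_right hC (by positivity)

/-! ## §8 (v2) The SHARP single-mode law by name: `‖sheetAmps a β θ (singleMode ξ) i‖ ≤ 0.889/a` for every mode and Bloch phase -/

/-- The single interior mode `e^{2πiξy}` (no sheets) — p2 g10's `K2StableCreation.singleMode`, verbatim. -/
def singleMode (ξ : ℝ) : LamState := ⟨fun y => Complex.exp (((2 * Real.pi * ξ * y : ℝ) : ℂ) * Complex.I), []⟩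

/-- The single-mode source at the kink line `y₀` as a function of the strain time (any Bloch phase). -/
def src (a β ξ y₀ : ℝ) : ℝ → ℂ := fun s =>
  ∫ y in (-(1 / 2 : ℝ))..(1 / 2 : ℝ), lineKernel a β (y₀ - y) * Complex.exp (((2 * Real.pi * ξ * y : ℝ) : ℂ) * Complex.I) *
    Complex.exp (-((2 * Real.pi * a * s * triWave y : ℝ) : ℂ) * Complex.I)

/-- The forcing of the single mode: `f(s) = (2πia·(−2)·src(¼,s), 2πia·2·src(−¼,s))`. -/
theorem forcing_singleMode (a β ξ s : ℝ) :
    forcing a β (singleMode ξ) s = ![((2 * Real.pi * a : ℝ) * Complex.I : ℂ) * (-2) * src a β ξ (1 / 4) s,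
      ((2 * Real.pi * a : ℝ) * Complex.I : ℂ) * 2 * src a β ξ (-(1 / 4)) s] := by
  simp only [forcing, singleMode, transportPhase, src, List.map_nil, List.sum_nil, add_zero]

/-- Stability for every Bloch phase at `a ≥ 1`. -/
theorem khLam_lt_zero_beta {a : ℝ} (ha : 1 ≤ a) (β : ℝ) : khLam a β < 0 := by
  unfold khLam
  have h := sawC2_ge ha β
  have : 0 < a ^ 2 * sawC2 a β := by positivity
  linarith

/-- `√(−λ) = a√(max 0 c²)` for every Bloch phase. -/
theorem sqrt_neg_khLam_eq_beta {a : ℝ} (ha : 1 ≤ a) (β : ℝ) : Real.sqrt (-(khLam a β)) = a * Real.sqrt (max 0 (sawC2 a β)) := by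
  unfold khLam
  have hc : 0 ≤ sawC2 a β := by linarith [sawC2_ge ha β]
  rw [neg_neg, max_eq_right hc, Real.sqrt_mul' _ hc, Real.sqrt_sq (by linarith)]

/-- Stable propagator entries for every Bloch phase. -/
theorem propC_eq_beta {a : ℝ} (ha : 1 ≤ a) (β t : ℝ) : propC a β t = Real.cos (Real.sqrt (-(khLam a β)) * t) := by
  have h := khLam_lt_zero_beta ha β
  simp only [propC, if_neg (not_lt.2 h.le), if_pos h]

/-- Stable propagator entries for every Bloch phase. -/
theorem propSn_eq_beta {a : ℝ} (ha : 1 ≤ a) (β t : ℝ) :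
    propSn a β t = Real.sin (Real.sqrt (-(khLam a β)) * t) / Real.sqrt (-(khLam a β)) := by
  have h := khLam_lt_zero_beta ha β
  simp only [propSn, if_neg (not_lt.2 h.le), if_pos h]

/-- The single-mode sources are continuous in the strain time. -/
theorem continuous_src {a : ℝ} (ha : 0 < a) (β ξ : ℝ) {y₀ : ℝ} (hy₀ : y₀ = 1 / 4 ∨ y₀ = -(1 / 4)) : Continuous (src a β ξ y₀) :=
  continuous_singleMode_src ha β ξ (K := kernelK a β) rfl (lineKernel_eq ha β) hy₀

/-- **Two-envelope bounds of the single-mode sources** (tree `norm_src_quarter_mode_le`, `norm_src_negQuarter_mode_le`). -/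
theorem norm_src_le {a : ℝ} (ha : 0 < a) (β ξ : ℝ) {y₀ : ℝ} (hy₀ : y₀ = 1 / 4 ∨ y₀ = -(1 / 4)) (s : ℝ) :
    ‖src a β ξ y₀ s‖ ≤ (1 + 2 * Real.exp (-(2 * Real.pi * a) / 4) + 2 * Real.exp (-(2 * Real.pi * a) / 4) ^ 2 +
        2 * Real.exp (-(2 * Real.pi * a) / 4) ^ 3 + Real.exp (-(2 * Real.pi * a) / 4) ^ 4) /
          (((1 - Real.exp (-(2 * Real.pi * a))) * (2 * (2 * Real.pi * a))) * ((2 * Real.pi * a) * Real.sqrt (1 + (ξ / a + 1 * s) ^ 2))) +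
        (1 + 2 * Real.exp (-(2 * Real.pi * a) / 4) ^ 2 + Real.exp (-(2 * Real.pi * a) / 4) ^ 4) /
          (((1 - Real.exp (-(2 * Real.pi * a))) * (2 * (2 * Real.pi * a))) * ((2 * Real.pi * a) * Real.sqrt (1 + (ξ / a + (-1) * s) ^ 2))) := by
  rcases hy₀ with h | h <;> subst h
  · exact norm_src_quarter_mode_le ha β ξ s (K := kernelK a β) (G := lineKernel a β) rfl (lineKernel_eq ha β)
  · exact norm_src_negQuarter_mode_le ha β ξ s (K := kernelK a β) (G := lineKernel a β) rfl (lineKernel_eq ha β)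

/-- The Duhamel integrand of the single mode is continuous in the strain time. -/
theorem continuous_duhamelIntegrand_singleMode {a : ℝ} (ha : 1 ≤ a) (β ξ θ : ℝ) :
    Continuous fun s : ℝ => (propagator a β (θ - s)).mulVec (forcing a β (singleMode ξ) s) := by
  have ha0 : 0 < a := by linarith
  have hs0 := continuous_src ha0 β ξ (y₀ := 1 / 4) (Or.inl rfl)
  have hs1 := continuous_src ha0 β ξ (y₀ := -(1 / 4)) (Or.inr rfl)
  apply continuous_pi
  intro j
  simp only [forcing_singleMode, propagator, propC_eq_beta ha, propSn_eq_beta ha, Matrix.add_mulVec, Matrix.smul_mulVec, Matrix.one_mulVec]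
  simp only [Pi.add_apply, Pi.smul_apply, smul_eq_mul, Matrix.mulVec, dotProduct, Fin.sum_univ_two]
  fin_cases j
  · simp only [Fin.zero_eta, Fin.isValue, Matrix.cons_val_zero, Matrix.cons_val_one]
    fun_prop
  · simp only [Fin.mk_one, Fin.isValue, Matrix.cons_val_zero, Matrix.cons_val_one]
    fun_prop

/-- **Reduction, component `0`** (any Bloch phase, `a ≥ 1`). -/
theorem sheetAmps_singleMode_apply_0 {a : ℝ} (ha : 1 ≤ a) (β ξ θ : ℝ) :
    sheetAmps a β θ (singleMode ξ) 0 = ∫ s in (0 : ℝ)..θ,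
      ((Real.cos (Real.sqrt (-(khLam a β)) * (θ - s)) : ℂ) * ((((2 * Real.pi * a : ℝ) * Complex.I : ℂ) * (-2)) * src a β ξ (1 / 4) s) +
        ((Real.sin (Real.sqrt (-(khLam a β)) * (θ - s)) / Real.sqrt (-(khLam a β)) : ℝ) : ℂ) *
          (blockX a β 0 0 * ((((2 * Real.pi * a : ℝ) * Complex.I : ℂ) * (-2)) * src a β ξ (1 / 4) s) +
            blockX a β 0 1 * ((((2 * Real.pi * a : ℝ) * Complex.I : ℂ) * 2) * src a β ξ (-(1 / 4)) s))) := by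
  have hint := (continuous_duhamelIntegrand_singleMode ha β ξ θ).intervalIntegrable (μ := volume) 0 θ
  have hcomp := ((ContinuousLinearMap.proj (R := ℂ) (φ := fun _ : Fin 2 => ℂ) (0 : Fin 2)).intervalIntegral_comp_comm hint).symm
  simp only [ContinuousLinearMap.proj_apply] at hcomp
  unfold sheetAmps
  rw [hcomp]
  refine intervalIntegral.integral_congr fun s _ => ?_
  simp only [forcing_singleMode, propagator, propC_eq_beta ha, propSn_eq_beta ha, Matrix.add_mulVec, Matrix.smul_mulVec, Matrix.one_mulVec]
  simp only [Pi.add_apply, Pi.smul_apply, smul_eq_mul, Matrix.mulVec, dotProduct, Fin.sum_univ_two, Fin.isValue, Matrix.cons_val_zero,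
    Matrix.cons_val_one]

/-- **Reduction, component `1`** (any Bloch phase, `a ≥ 1`). -/
theorem sheetAmps_singleMode_apply_1 {a : ℝ} (ha : 1 ≤ a) (β ξ θ : ℝ) :
    sheetAmps a β θ (singleMode ξ) 1 = ∫ s in (0 : ℝ)..θ,
      ((Real.cos (Real.sqrt (-(khLam a β)) * (θ - s)) : ℂ) * ((((2 * Real.pi * a : ℝ) * Complex.I : ℂ) * 2) * src a β ξ (-(1 / 4)) s) +
        ((Real.sin (Real.sqrt (-(khLam a β)) * (θ - s)) / Real.sqrt (-(khLam a β)) : ℝ) : ℂ) *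
          (blockX a β 1 0 * ((((2 * Real.pi * a : ℝ) * Complex.I : ℂ) * (-2)) * src a β ξ (1 / 4) s) +
            blockX a β 1 1 * ((((2 * Real.pi * a : ℝ) * Complex.I : ℂ) * 2) * src a β ξ (-(1 / 4)) s))) := by
  have hint := (continuous_duhamelIntegrand_singleMode ha β ξ θ).intervalIntegrable (μ := volume) 0 θ
  have hcomp := ((ContinuousLinearMap.proj (R := ℂ) (φ := fun _ : Fin 2 => ℂ) (1 : Fin 2)).intervalIntegral_comp_comm hint).symm
  simp only [ContinuousLinearMap.proj_apply] at hcomp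
  unfold sheetAmps
  rw [hcomp]
  refine intervalIntegral.integral_congr fun s _ => ?_
  simp only [forcing_singleMode, propagator, propC_eq_beta ha, propSn_eq_beta ha, Matrix.add_mulVec, Matrix.smul_mulVec, Matrix.one_mulVec]
  simp only [Pi.add_apply, Pi.smul_apply, smul_eq_mul, Matrix.mulVec, dotProduct, Fin.sum_univ_two, Fin.isValue, Matrix.cons_val_zero,
    Matrix.cons_val_one]

/-- **THE SHARP SINGLE-MODE CREATION LAW BY NAME** (P2-E6 kernel): for `a ≥ 4`, `0 ≤ θ ≤ 8`, EVERY Bloch phase `β` and EVERY interior mode `ξ`,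
`‖sheetAmps a β θ (singleMode ξ) i‖ ≤ 0.889/a` (`i = 0, 1`) — the tree's `8.5/a` (`…KHSingleModeCreation`, p2 g10) divided by `9.5`. -/
theorem norm_sheetAmps_singleMode_le {a : ℝ} (ha : 4 ≤ a) (β ξ : ℝ) {θ : ℝ} (hθ0 : 0 ≤ θ) (hθ : θ ≤ 8) (i : Fin 2) :
    ‖sheetAmps a β θ (singleMode ξ) i‖ ≤ 0.889 / a := by
  have ha1 : 1 ≤ a := by linarith
  have ha0 : 0 < a := by linarith
  have h0 := twoPi_lineKernel_zero' ha0 β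
  have hh := twoPi_conj_lineKernel_half' ha0 β
  have hE₀ := norm_src_le ha0 β ξ (y₀ := 1 / 4) (Or.inl rfl)
  have hE₁ := norm_src_le ha0 β ξ (y₀ := -(1 / 4)) (Or.inr rfl)
  obtain ⟨e00, e01, e10, e11⟩ := blockX_apply a β
  fin_cases i
  · simp only [Fin.zero_eta, Fin.isValue]
    rw [sheetAmps_singleMode_apply_0 ha1, sqrt_neg_khLam_eq_beta ha1, e00, e01]
    exact mode_creation_num_le ha hθ0 hθ h0 hh hE₀ hE₁
  · simp only [Fin.mk_one, Fin.isValue]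
    rw [sheetAmps_singleMode_apply_1 ha1, sqrt_neg_khLam_eq_beta ha1, e10, e11]
    exact mode_creation_num_le' ha hθ0 hθ h0 hh hE₀ hE₁

/-- **The ξ-RESOLVED single-mode law by name** (`a ≥ 1`, `θ ≥ 0`, any `β`, `ξ`): `‖sheetAmps a β θ (singleMode ξ) i‖ ≤ W(a,β,ξ,θ)`,
`W = 4πa(a·p+2a‖S‖)/ω · (N₊I₊ + N₋I₋)/((1−q)2κ·κ)` (tree `mode_component_le`): the weight that decays like `a/ξ` for modes that never un-tilt. -/
theorem norm_sheetAmps_singleMode_resolved {a : ℝ} (ha : 1 ≤ a) (β ξ : ℝ) {θ : ℝ} (hθ0 : 0 ≤ θ) (i : Fin 2) :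
    ‖sheetAmps a β θ (singleMode ξ) i‖ ≤
      4 * Real.pi * a * (a * (Real.pi / 2 + 2 * sawSigma0 a β) + 2 * a * ‖sawS a β‖) / (a * Real.sqrt (max 0 (sawC2 a β))) *
        (((1 + 2 * Real.exp (-(2 * Real.pi * a) / 4) + 2 * Real.exp (-(2 * Real.pi * a) / 4) ^ 2 + 2 * Real.exp (-(2 * Real.pi * a) / 4) ^ 3 +
            Real.exp (-(2 * Real.pi * a) / 4) ^ 4) * (Real.arsinh (ξ / a + θ) - Real.arsinh (ξ / a)) +
          (1 + 2 * Real.exp (-(2 * Real.pi * a) / 4) ^ 2 + Real.exp (-(2 * Real.pi * a) / 4) ^ 4) * (Real.arsinh (ξ / a) - Real.arsinh (ξ / a - θ))) /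
          (((1 - Real.exp (-(2 * Real.pi * a))) * (2 * (2 * Real.pi * a))) * (2 * Real.pi * a))) := by
  have ha0 : 0 < a := by linarith
  have h0 := twoPi_lineKernel_zero' ha0 β
  have hh := twoPi_conj_lineKernel_half' ha0 β
  have hE₀ := norm_src_le ha0 β ξ (y₀ := 1 / 4) (Or.inl rfl)
  have hE₁ := norm_src_le ha0 β ξ (y₀ := -(1 / 4)) (Or.inr rfl)
  obtain ⟨e00, e01, e10, e11⟩ := blockX_apply a β
  fin_cases i
  · simp only [Fin.zero_eta, Fin.isValue]
    rw [sheetAmps_singleMode_apply_0 ha, sqrt_neg_khLam_eq_beta ha, e00, e01]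
    exact mode_component_le ha hθ0 h0 hh hE₀ hE₁
  · simp only [Fin.mk_one, Fin.isValue]
    rw [sheetAmps_singleMode_apply_1 ha, sqrt_neg_khLam_eq_beta ha, e10, e11]
    exact mode_component_le' ha hθ0 h0 hh hE₀ hE₁

/-! ## §9 (v2, E6-a) Finite mode profiles: linearity and the ξ-resolved COHERENT creation bound per line -/

/-- The forcing is linear in the interior content (tree `integral_forcing_finset_sum`). -/
theorem forcing_modeProfile {a : ℝ} (ha : 0 < a) (β s : ℝ) (K : ℕ) (c : ℤ → ℂ) :
    forcing a β ⟨modeProfile β K c, []⟩ s = ∑ n ∈ win K, c n • forcing a β (singleMode (β + n)) s := by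
  have h1 := integral_forcing_finset_sum ha β s (K := kernelK a β) rfl (lineKernel_eq ha β) (y₀ := 1 / 4) (Or.inl rfl) (win K) c
  have h2 := integral_forcing_finset_sum ha β s (K := kernelK a β) rfl (lineKernel_eq ha β) (y₀ := -(1 / 4)) (Or.inr rfl) (win K) c
  ext i
  rw [Finset.sum_apply]
  fin_cases i
  · simp only [forcing, modeProfile, singleMode, transportPhase, List.map_nil, List.sum_nil, add_zero, Fin.zero_eta, Fin.isValue,
      Matrix.cons_val_zero, Pi.smul_apply, smul_eq_mul]
    rw [h1, Finset.mul_sum]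
    exact Finset.sum_congr rfl fun n _ => by ring
  · simp only [forcing, modeProfile, singleMode, transportPhase, List.map_nil, List.sum_nil, add_zero, Fin.mk_one, Fin.isValue,
      Matrix.cons_val_one, Matrix.cons_val_zero, Pi.smul_apply, smul_eq_mul]
    rw [h2, Finset.mul_sum]
    exact Finset.sum_congr rfl fun n _ => by ring

/-- **Linearity of the created amplitudes** over a finite mode profile (`a ≥ 1`). -/
theorem sheetAmps_modeProfile {a : ℝ} (ha : 1 ≤ a) (β θ : ℝ) (K : ℕ) (c : ℤ → ℂ) :
    sheetAmps a β θ ⟨modeProfile β K c, []⟩ = ∑ n ∈ win K, c n • sheetAmps a β θ (singleMode (β + n)) := by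
  have ha0 : 0 < a := by linarith
  unfold sheetAmps
  simp_rw [forcing_modeProfile ha0, Matrix.mulVec_sum, Matrix.mulVec_smul]
  have hint : ∀ n ∈ win K, IntervalIntegrable (fun s => c n • (propagator a β (θ - s)).mulVec (forcing a β (singleMode (β + n)) s))
      volume 0 θ := fun n _ => ((continuous_duhamelIntegrand_singleMode ha β (β + n) θ).intervalIntegrable (μ := volume) _ _).smul (c n)
  rw [intervalIntegral.integral_finsetSum hint]
  refine Finset.sum_congr rfl fun n _ => ?_
  exact intervalIntegral.integral_smul _ _

/-- **E6-a: the COHERENT creation bound of one line, ξ-resolved.** The pair created on the line `a ≥ 1` (Bloch `β`, strain `θ ≥ 0`) by the profile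
`Σ_{|n|≤K} c n e^{2πi(β+n)y}` has amplitude `≤ Σ_n ‖c n‖ · W(a, β, β+n, θ)` with the ξ-resolved single-mode weight `W` of
`norm_sheetAmps_singleMode_resolved` (modes that never un-tilt inside the slot weigh `O(a/|β+n|)`). [triangle inequality over the modes; sharp for
adversarial coefficients on ONE line] -/
theorem norm_sheetAmps_modeProfile_resolved {a : ℝ} (ha : 1 ≤ a) (β : ℝ) {θ : ℝ} (hθ0 : 0 ≤ θ) (K : ℕ) (c : ℤ → ℂ) (i : Fin 2) :
    ‖sheetAmps a β θ ⟨modeProfile β K c, []⟩ i‖ ≤ ∑ n ∈ win K, ‖c n‖ *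
      (4 * Real.pi * a * (a * (Real.pi / 2 + 2 * sawSigma0 a β) + 2 * a * ‖sawS a β‖) / (a * Real.sqrt (max 0 (sawC2 a β))) *
        (((1 + 2 * Real.exp (-(2 * Real.pi * a) / 4) + 2 * Real.exp (-(2 * Real.pi * a) / 4) ^ 2 + 2 * Real.exp (-(2 * Real.pi * a) / 4) ^ 3 +
            Real.exp (-(2 * Real.pi * a) / 4) ^ 4) * (Real.arsinh ((β + n) / a + θ) - Real.arsinh ((β + n) / a)) +
          (1 + 2 * Real.exp (-(2 * Real.pi * a) / 4) ^ 2 + Real.exp (-(2 * Real.pi * a) / 4) ^ 4) *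
            (Real.arsinh ((β + n) / a) - Real.arsinh ((β + n) / a - θ))) /
          (((1 - Real.exp (-(2 * Real.pi * a))) * (2 * (2 * Real.pi * a))) * (2 * Real.pi * a)))) := by
  rw [sheetAmps_modeProfile ha, Finset.sum_apply]
  refine (norm_sum_le _ _).trans (Finset.sum_le_sum fun n _ => ?_)
  rw [Pi.smul_apply, norm_smul]
  exact mul_le_mul_of_nonneg_left (norm_sheetAmps_singleMode_resolved ha β (β + n) hθ0 i) (norm_nonneg _)

/-- **Uniform corollary** (`a ≥ 4`, `0 ≤ θ ≤ 8`): `‖sheetAmps a β θ ⟨modeProfile β K c, []⟩ i‖ ≤ (Σ_n ‖c n‖)·0.889/a`. -/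
theorem norm_sheetAmps_modeProfile_le {a : ℝ} (ha : 4 ≤ a) (β : ℝ) {θ : ℝ} (hθ0 : 0 ≤ θ) (hθ : θ ≤ 8) (K : ℕ) (c : ℤ → ℂ) (i : Fin 2) :
    ‖sheetAmps a β θ ⟨modeProfile β K c, []⟩ i‖ ≤ (∑ n ∈ win K, ‖c n‖) * (0.889 / a) := by
  have ha1 : 1 ≤ a := by linarith
  rw [sheetAmps_modeProfile ha1, Finset.sum_apply, Finset.sum_mul]
  refine (norm_sum_le _ _).trans (Finset.sum_le_sum fun n _ => ?_)
  rw [Pi.smul_apply, norm_smul]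
  exact mul_le_mul_of_nonneg_left (norm_sheetAmps_singleMode_le ha β (β + n) hθ0 hθ i) (norm_nonneg _)

/-! ## §10 (v3, E6-b) Transport cannot create energy beyond enstrophy/a² (Parseval, tree `…KHTransportParseval`) -/

/-- The triangle wave is continuous. -/
theorem continuous_triWave : Continuous triWave := by
  have h : triWave = (fun t : ℝ => 1 / 4 - |t - 1 / 2|) ∘ Int.fract ∘ (fun ξ : ℝ => ξ + 1 / 4) := by
    funext ξ; simp [triWave, Function.comp]
  rw [h]
  have hI : Continuous ((fun t : ℝ => 1 / 4 - |t - 1 / 2|) ∘ Int.fract) :=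
    ContinuousOn.comp_fract'' (Continuous.continuousOn (by fun_prop)) (by norm_num)
  exact hI.comp (continuous_id.add continuous_const)

/-- The transport phase is continuous in `y` and unimodular. -/
theorem continuous_transportPhase (a θ : ℝ) : Continuous (transportPhase a θ) := by
  unfold transportPhase
  have := continuous_triWave
  fun_prop

/-- `|transportPhase| = 1`. -/
theorem norm_transportPhase (a θ y : ℝ) : ‖transportPhase a θ y‖ = 1 := by
  unfold transportPhase
  rw [show -((2 * Real.pi * a * θ * triWave y : ℝ) : ℂ) * Complex.I = ((-(2 * Real.pi * a * θ * triWave y) : ℝ) : ℂ) * Complex.I by push_cast; ring]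
  exact Complex.norm_exp_ofReal_mul_I _

/-- **Energy ≤ 1/(4π²a²) for a sheet-free state with continuous unimodularly bounded interior** (`|g| ≤ 1`; Parseval). -/
theorem energy_nosheet_le {g : ℝ → ℂ} (hg : Continuous g) (hb : ∀ y, ‖g y‖ ≤ 1) {a : ℝ} (ha : a ≠ 0) (β : ℝ) :
    energy a β ⟨g, []⟩ ≤ 1 / (4 * Real.pi ^ 2 * a ^ 2) := by
  have h := energy_gain_le hg hb β ha
  simp only [energy, coeff, List.map_nil, List.sum_nil, add_zero]
  exact h

/-- **E6-b (single mode): the TRANSPORTED mode `e^{2πiξy}·e^{−2πiaθ·tri(y)}` has energy `≤ 1/(4π²a²)`** on the line `a ≠ 0` — at most `1 + (ξ/a)²` times the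
energy `1/(4π²(a²+ξ²))` of the bare lattice mode (the Orr bound; no creation involved). -/
theorem energy_transport_singleMode_le (a β θ ξ : ℝ) (ha : a ≠ 0) :
    energy a β ⟨fun y => (singleMode ξ).interior y * transportPhase a θ y, []⟩ ≤ 1 / (4 * Real.pi ^ 2 * a ^ 2) := by
  refine energy_nosheet_le ?_ ?_ ha β
  · exact Continuous.mul (by simp only [singleMode]; fun_prop) (continuous_transportPhase a θ)
  · intro y
    simp only [singleMode]
    rw [norm_mul, norm_transportPhase, mul_one, Complex.norm_exp_ofReal_mul_I]

/-- The interior of the slot image of a single mode is the transported mode (p4's `slotMap`). -/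
theorem slotMap_singleMode_interior (a β θ ξ : ℝ) :
    (slotMap a β θ (singleMode ξ)).interior = fun y => (singleMode ξ).interior y * transportPhase a θ y := rfl

/-! ## §11 (v4) P1″ at single-mode level BY NAME: `E_created ≤ 4.97(1+(ξ/a)²)/a · E_mode` (`a ≥ 4`; was `2900/a`, p2 g10) -/

/-- Orthogonality on one period (p2 g10's `integral_cexp_int_mul`, verbatim). -/
theorem integral_cexp_int_mul {k : ℤ} :
    ∫ y in (-(1 / 2 : ℝ))..(1 / 2), Complex.exp (((2 * Real.pi * k * y : ℝ) : ℂ) * Complex.I) = if k = 0 then 1 else 0 := by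
  split_ifs with hk
  · subst hk; simp; norm_num
  · have hc : (((2 * Real.pi * k : ℝ) : ℂ) * Complex.I) ≠ 0 := by
      apply mul_ne_zero _ Complex.I_ne_zero
      exact_mod_cast (mul_ne_zero (mul_ne_zero two_ne_zero Real.pi_ne_zero) (Int.cast_ne_zero.2 hk))
    have e : ∀ y : ℝ, Complex.exp (((2 * Real.pi * k * y : ℝ) : ℂ) * Complex.I) = Complex.exp ((((2 * Real.pi * k : ℝ) : ℂ) * Complex.I) * y) := by
      intro y; congr 1; push_cast; ring
    simp_rw [e]
    rw [integral_exp_mul_complex hc]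
    have h1 : Complex.exp ((((2 * Real.pi * k : ℝ) : ℂ) * Complex.I) * (1 / 2 : ℝ)) = Complex.exp ((Real.pi * k : ℝ) * Complex.I) := by
      congr 1; push_cast; ring
    have h2 : Complex.exp ((((2 * Real.pi * k : ℝ) : ℂ) * Complex.I) * (-(1 / 2) : ℝ)) = Complex.exp (-((Real.pi * k : ℝ) * Complex.I)) := by
      congr 1; push_cast; ring
    rw [h1, h2]
    have h3 : Complex.exp ((Real.pi * k : ℝ) * Complex.I) = Complex.exp (-((Real.pi * k : ℝ) * Complex.I)) := by
      rw [← mul_inv_eq_one₀ (Complex.exp_ne_zero _), ← Complex.exp_neg, ← Complex.exp_add, neg_neg,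
        show (Real.pi * k : ℝ) * Complex.I + (Real.pi * k : ℝ) * Complex.I = (k : ℂ) * (2 * Real.pi * Complex.I) by push_cast; ring]
      exact Complex.exp_int_mul_two_pi_mul_I k
    rw [h3, sub_self, zero_div]

/-- The coefficients of the single lattice mode `ξ = β + n₀`: `ζ̂(n) = δ_{n,n₀}`. -/
theorem coeff_singleMode (β : ℝ) (n₀ n : ℤ) : coeff β (singleMode (β + n₀)) n = if n = n₀ then 1 else 0 := by
  simp only [coeff, singleMode, List.map_nil, List.sum_nil, add_zero]
  have e : ∀ y : ℝ, Complex.exp (((2 * Real.pi * (β + n₀) * y : ℝ) : ℂ) * Complex.I) * Complex.exp (-((2 * Real.pi * (β + n) * y : ℝ) : ℂ) * Complex.I) =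
      Complex.exp (((2 * Real.pi * ((n₀ - n : ℤ)) * y : ℝ) : ℂ) * Complex.I) := by
    intro y; rw [← Complex.exp_add]; congr 1; push_cast; ring
  simp_rw [e, integral_cexp_int_mul]
  by_cases h : n = n₀
  · subst h; simp
  · rw [if_neg (sub_ne_zero.2 (Ne.symm h)), if_neg h]

/-- **Energy of the single lattice mode:** `energy a β (singleMode (β+n₀)) = 1/(4π²(a² + (β+n₀)²))`. -/
theorem energy_singleMode (a β : ℝ) (n₀ : ℤ) : energy a β (singleMode (β + n₀)) = 1 / (4 * Real.pi ^ 2 * (a ^ 2 + (β + n₀) ^ 2)) := by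
  unfold energy
  simp_rw [coeff_singleMode]
  rw [tsum_eq_single n₀ (fun n hn => by simp [hn])]
  simp

/-- **Energy of the created pair at `a ≥ 4` from amplitude bounds** (tree `comb_pair_energy_le`: Gram ≤ `1.00002/(2a)`). -/
theorem energy_sheetPair_le_of_amp {a : ℝ} (ha : 4 ≤ a) (β : ℝ) {qp qm : ℂ} {B : ℝ} (h₀ : ‖qp‖ ≤ B / a) (h₁ : ‖qm‖ ≤ B / a) :
    energy a β (sheetPair qp qm) ≤ 1.00002 * B ^ 2 / (2 * Real.pi * a ^ 3) := by
  unfold energy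
  have hc : ∀ n : ℤ, coeff β (sheetPair qp qm) n = qp * Complex.exp (-(2 * Real.pi * (β + n) * (1 / 4 : ℝ) : ℝ) * Complex.I) +
      qm * Complex.exp (-(2 * Real.pi * (β + n) * (-(1 / 4 : ℝ)) : ℝ) * Complex.I) := fun n => by simp [coeff, sheetPair]
  simp_rw [hc]
  exact comb_pair_energy_le ha β h₀ h₁

/-- **P1″ AT SINGLE-MODE LEVEL, SHARP:** for `a ≥ 4`, `0 ≤ θ ≤ 8`, any Bloch phase and any lattice mode `ξ = β + n₀`, the pair created over the slot has
energy `≤ 4.97·(1 + (ξ/a)²)/a` times the mode's energy (p2 g10: `2900/a` for cascade-type modes). -/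
theorem energy_created_singleMode_sharp {a : ℝ} (ha : 4 ≤ a) (β : ℝ) (n₀ : ℤ) {θ : ℝ} (hθ0 : 0 ≤ θ) (hθ : θ ≤ 8) :
    energy a β (sheetPair (sheetAmps a β θ (singleMode (β + n₀)) 0) (sheetAmps a β θ (singleMode (β + n₀)) 1)) ≤
      4.97 * (1 + ((β + n₀) / a) ^ 2) / a * energy a β (singleMode (β + n₀)) := by
  have ha0 : 0 < a := by linarith
  have h0 := norm_sheetAmps_singleMode_le ha β (β + n₀) hθ0 hθ 0
  have h1 := norm_sheetAmps_singleMode_le ha β (β + n₀) hθ0 hθ 1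
  refine (energy_sheetPair_le_of_amp ha β h0 h1).trans ?_
  rw [energy_singleMode]
  have hπ : Real.pi < 3.1416 := Real.pi_lt_d4
  have hπ0 : 0 < Real.pi := Real.pi_pos
  rw [show 4.97 * (1 + ((β + n₀) / a) ^ 2) / a * (1 / (4 * Real.pi ^ 2 * (a ^ 2 + (β + n₀) ^ 2))) = 4.97 / (4 * Real.pi ^ 2 * a ^ 3) by
    field_simp]
  rw [div_le_div_iff₀ (by positivity) (by positivity)]
  have ha3 : 0 < a ^ 3 := by positivity
  nlinarith [mul_pos ha3 hπ0]

/-- **Cascade-type corollary:** `|ξ| ≤ a/8 + 2`, `a ≥ 4` ⇒ `E_created ≤ 6.92/a · E_mode` (and `≤ 5.3/a` once `a ≥ 16`). -/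
theorem energy_created_singleMode_cascade {a : ℝ} (ha : 4 ≤ a) (β : ℝ) (n₀ : ℤ) (hξ : |β + n₀| ≤ a / 8 + 2) {θ : ℝ} (hθ0 : 0 ≤ θ) (hθ : θ ≤ 8) :
    energy a β (sheetPair (sheetAmps a β θ (singleMode (β + n₀)) 0) (sheetAmps a β θ (singleMode (β + n₀)) 1)) ≤
      6.92 / a * energy a β (singleMode (β + n₀)) := by
  have ha0 : 0 < a := by linarith
  refine (energy_created_singleMode_sharp ha β n₀ hθ0 hθ).trans ?_
  have hE : 0 ≤ energy a β (singleMode (β + n₀)) := by rw [energy_singleMode]; positivity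
  apply mul_le_mul_of_nonneg_right _ hE
  apply div_le_div_of_nonneg_right _ ha0.le
  have hu : ((β + n₀) / a) ^ 2 ≤ (1 / 8 + 2 / a) ^ 2 := by
    rw [← sq_abs ((β + n₀) / a), abs_div, abs_of_pos ha0]
    apply pow_le_pow_left₀ (by positivity)
    rw [div_le_iff₀ ha0]
    have : (1 / 8 + 2 / a) * a = a / 8 + 2 := by field_simp
    linarith
  have h2a : 2 / a ≤ 1 / 2 := by rw [div_le_iff₀ ha0]; linarith
  have h2a0 : 0 ≤ 2 / a := by positivity
  nlinarith

/-! ## §12 (v5) P1″ at PROFILE level, the TRUE shape: `E_created ≤ 10.5 · E_profile` for cascade-type profiles (`a ≥ 4`; NOT `C²/|a|`, F-p2g11-2) -/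

/-- The coefficients of a finite mode profile: `coeff β ⟨modeProfile β K c, []⟩ n = c n` on the window, `0` off it (orthogonality). -/
theorem coeff_modeProfile (β : ℝ) (K : ℕ) (c : ℤ → ℂ) (n : ℤ) :
    coeff β ⟨modeProfile β K c, []⟩ n = if n ∈ win K then c n else 0 := by
  simp only [coeff, modeProfile, List.map_nil, List.sum_nil, add_zero, Finset.sum_mul]
  have e : ∀ m : ℤ, ∀ y : ℝ, c m * Complex.exp (((2 * Real.pi * (β + m) * y : ℝ)) * Complex.I) *
      Complex.exp (-((2 * Real.pi * (β + n) * y : ℝ) : ℂ) * Complex.I) = c m * Complex.exp (((2 * Real.pi * ((m - n : ℤ)) * y : ℝ) : ℂ) * Complex.I) := by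
    intro m y; rw [mul_assoc, ← Complex.exp_add]; congr 2; push_cast; ring
  simp_rw [e]
  rw [intervalIntegral.integral_finsetSum (fun m _ => (by fun_prop : Continuous fun y : ℝ =>
    c m * Complex.exp (((2 * Real.pi * ((m - n : ℤ)) * y : ℝ) : ℂ) * Complex.I)).intervalIntegrable _ _)]
  simp_rw [intervalIntegral.integral_const_mul, integral_cexp_int_mul, sub_eq_zero, mul_ite, mul_one, mul_zero]
  rw [Finset.sum_ite_eq' (win K) n c]

/-- **Energy of a finite mode profile:** `Σ_{|n| ≤ K} ‖c n‖²/(4π²(a²+(β+n)²))`. -/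
theorem energy_modeProfile (a β : ℝ) (K : ℕ) (c : ℤ → ℂ) :
    energy a β ⟨modeProfile β K c, []⟩ = ∑ n ∈ win K, ‖c n‖ ^ 2 / (4 * Real.pi ^ 2 * (a ^ 2 + (β + n) ^ 2)) := by
  unfold energy
  simp_rw [coeff_modeProfile]
  rw [tsum_eq_sum (s := win K) (fun n hn => by simp [hn])]
  exact Finset.sum_congr rfl fun n hn => by simp [hn]

/-- Integers `n` with `|β + n| ≤ R` inside any finset number at most `2R + 1`. -/
theorem card_filter_abs_le (β : ℝ) {R : ℝ} (hR : 0 ≤ R) (S : Finset ℤ) :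
    (((S.filter fun n : ℤ => |β + n| ≤ R).card : ℕ) : ℝ) ≤ 2 * R + 1 := by
  set T := S.filter fun n : ℤ => |β + n| ≤ R with hT
  have hsub : T ⊆ Finset.Icc ⌈-β - R⌉ ⌊-β + R⌋ := by
    intro n hn
    rw [hT, Finset.mem_filter] at hn
    obtain ⟨h1, h2⟩ := abs_le.1 hn.2
    rw [Finset.mem_Icc]
    constructor
    · exact Int.ceil_le.2 (by linarith)
    · exact Int.le_floor.2 (by linarith)
  have hcard := Finset.card_le_card hsub
  rw [Int.card_Icc] at hcard
  have h1 : ((T.card : ℕ) : ℝ) ≤ (((⌊-β + R⌋ + 1 - ⌈-β - R⌉).toNat : ℕ) : ℝ) := by exact_mod_cast hcard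
  refine h1.trans ?_
  have h2 : ((⌊-β + R⌋ + 1 - ⌈-β - R⌉ : ℤ) : ℝ) ≤ 2 * R + 1 := by
    have hf : ((⌊-β + R⌋ : ℤ) : ℝ) ≤ -β + R := Int.floor_le _
    have hc : -β - R ≤ ((⌈-β - R⌉ : ℤ) : ℝ) := Int.le_ceil _
    push_cast; linarith
  rcases le_or_gt 0 (⌊-β + R⌋ + 1 - ⌈-β - R⌉) with h | h
  · rw [show (((⌊-β + R⌋ + 1 - ⌈-β - R⌉).toNat : ℕ) : ℝ) = ((⌊-β + R⌋ + 1 - ⌈-β - R⌉ : ℤ) : ℝ) by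
      rw [← Int.toNat_of_nonneg h]; push_cast; rw [Int.toNat_of_nonneg h]]
    exact h2
  · rw [Int.toNat_eq_zero.2 h.le]; push_cast; linarith

/-- **P1″ AT PROFILE LEVEL (true shape, F-p2g11-2):** for `a ≥ 4`, `0 ≤ θ ≤ 8`, any Bloch phase, any window `K` and any CASCADE-TYPE profile
(`c n = 0` unless `|β + n| ≤ a/8 + 2`), the created pair has energy `≤ 10.5 ×` the profile's energy — uniformly in `a` and `K` (the `≤ a/4 + 5` resonant modes may
add coherently, which is why the `C²/|a|` shape of `StableBlockCreation` fails for profiles; per mode the `1/a` law holds, `energy_created_singleMode_sharp`). -/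
theorem energy_created_modeProfile_le {a : ℝ} (ha : 4 ≤ a) (β : ℝ) {θ : ℝ} (hθ0 : 0 ≤ θ) (hθ : θ ≤ 8) (K : ℕ) (c : ℤ → ℂ)
    (hc : ∀ n : ℤ, a / 8 + 2 < |β + n| → c n = 0) :
    energy a β (sheetPair (sheetAmps a β θ ⟨modeProfile β K c, []⟩ 0) (sheetAmps a β θ ⟨modeProfile β K c, []⟩ 1)) ≤
      10.5 * energy a β ⟨modeProfile β K c, []⟩ := by
  have ha0 : 0 < a := by linarith
  set S₁ := ∑ n ∈ win K, ‖c n‖ with hS₁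
  have h0 := norm_sheetAmps_modeProfile_le ha β hθ0 hθ K c 0
  have h1 := norm_sheetAmps_modeProfile_le ha β hθ0 hθ K c 1
  rw [show (∑ n ∈ win K, ‖c n‖) * (0.889 / a) = 0.889 * S₁ / a by rw [hS₁]; ring] at h0 h1
  have hE := energy_sheetPair_le_of_amp ha β h0 h1
  refine hE.trans ?_
  rw [energy_modeProfile]
  -- the support set
  set T := (win K).filter fun n : ℤ => |β + n| ≤ a / 8 + 2 with hT
  have hcT : ∀ n ∈ win K, n ∉ T → c n = 0 := by
    intro n hn hnT
    apply hc
    by_contra h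
    exact hnT (Finset.mem_filter.2 ⟨hn, not_lt.1 h⟩)
  have hS₁T : S₁ = ∑ n ∈ T, ‖c n‖ := by
    rw [hS₁, ← Finset.sum_filter_add_sum_filter_not (win K) (fun n : ℤ => |β + n| ≤ a / 8 + 2)]
    have hz : ∑ n ∈ (win K).filter (fun n : ℤ => ¬ |β + (n : ℝ)| ≤ a / 8 + 2), ‖c n‖ = 0 :=
      Finset.sum_eq_zero fun n hn => by
        rw [Finset.mem_filter] at hn
        simp [hc n (not_le.1 hn.2)]
    rw [hz, add_zero]
  have hET : ∑ n ∈ win K, ‖c n‖ ^ 2 / (4 * Real.pi ^ 2 * (a ^ 2 + (β + n) ^ 2)) =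
      ∑ n ∈ T, ‖c n‖ ^ 2 / (4 * Real.pi ^ 2 * (a ^ 2 + (β + n) ^ 2)) := by
    rw [← Finset.sum_filter_add_sum_filter_not (win K) (fun n : ℤ => |β + n| ≤ a / 8 + 2)]
    have hz : ∑ n ∈ (win K).filter (fun n : ℤ => ¬ |β + (n : ℝ)| ≤ a / 8 + 2), ‖c n‖ ^ 2 / (4 * Real.pi ^ 2 * (a ^ 2 + (β + n) ^ 2)) = 0 :=
      Finset.sum_eq_zero fun n hn => by
        rw [Finset.mem_filter] at hn
        simp [hc n (not_le.1 hn.2)]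
    rw [hz, add_zero]
  rw [hET]
  -- Cauchy–Schwarz on T and the mode count
  have hCS : S₁ ^ 2 ≤ (T.card : ℝ) * ∑ n ∈ T, ‖c n‖ ^ 2 := by rw [hS₁T]; exact sq_sum_le_card_mul_sum_sq
  have hcard : (T.card : ℝ) ≤ 2 * (a / 8 + 2) + 1 := card_filter_abs_le β (by positivity) (win K)
  -- lower bound of the profile energy on T
  set R := a / 8 + 2 with hR
  have hden : ∀ n ∈ T, ‖c n‖ ^ 2 / (4 * Real.pi ^ 2 * (a ^ 2 + R ^ 2)) ≤ ‖c n‖ ^ 2 / (4 * Real.pi ^ 2 * (a ^ 2 + (β + n) ^ 2)) := by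
    intro n hn
    rw [hT, Finset.mem_filter] at hn
    apply div_le_div_of_nonneg_left (sq_nonneg _) (by positivity)
    have : (β + n) ^ 2 ≤ R ^ 2 := by rw [← sq_abs (β + n)]; exact pow_le_pow_left₀ (abs_nonneg _) hn.2 2
    nlinarith [Real.pi_pos]
  have hlow : (∑ n ∈ T, ‖c n‖ ^ 2) / (4 * Real.pi ^ 2 * (a ^ 2 + R ^ 2)) ≤ ∑ n ∈ T, ‖c n‖ ^ 2 / (4 * Real.pi ^ 2 * (a ^ 2 + (β + n) ^ 2)) := by
    rw [Finset.sum_div]; exact Finset.sum_le_sum hden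
  -- arithmetic
  have hsum0 : 0 ≤ ∑ n ∈ T, ‖c n‖ ^ 2 := Finset.sum_nonneg fun n _ => sq_nonneg _
  have hπ : (3.1415 : ℝ) < Real.pi := Real.pi_gt_d4
  have hπ' : Real.pi < 3.1416 := Real.pi_lt_d4
  have step : 1.00002 * (0.889 * S₁) ^ 2 / (2 * Real.pi * a ^ 3) ≤ 10.5 * ((∑ n ∈ T, ‖c n‖ ^ 2) / (4 * Real.pi ^ 2 * (a ^ 2 + R ^ 2))) := by
    rw [show 1.00002 * (0.889 * S₁) ^ 2 / (2 * Real.pi * a ^ 3) = (1.00002 * 0.889 ^ 2 / (2 * Real.pi * a ^ 3)) * S₁ ^ 2 by ring]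
    have hA : 0 ≤ 1.00002 * 0.889 ^ 2 / (2 * Real.pi * a ^ 3) := by positivity
    refine (mul_le_mul_of_nonneg_left (hCS.trans (mul_le_mul_of_nonneg_right hcard hsum0)) hA).trans ?_
    rw [show 10.5 * ((∑ n ∈ T, ‖c n‖ ^ 2) / (4 * Real.pi ^ 2 * (a ^ 2 + R ^ 2))) =
      (10.5 / (4 * Real.pi ^ 2 * (a ^ 2 + R ^ 2))) * ∑ n ∈ T, ‖c n‖ ^ 2 by ring, ← mul_assoc]
    apply mul_le_mul_of_nonneg_right _ hsum0
    rw [hR, div_mul_eq_mul_div, div_le_div_iff₀ (by positivity) (by positivity)]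
    have ha3 : 0 < a ^ 3 := by positivity
    have hπ2 : Real.pi ^ 2 ≤ 9.8697 := by nlinarith [Real.pi_pos]
    have hR0 : 0 ≤ 2 * (a / 8 + 2) + 1 := by positivity
    have haR : 0 ≤ a ^ 2 + (a / 8 + 2) ^ 2 := by positivity
    -- replace π² by its upper bound on the left, π by its lower bound on the right
    have key : 0.790338 * (2 * (a / 8 + 2) + 1) * (4 * 9.8697 * (a ^ 2 + (a / 8 + 2) ^ 2)) ≤ 10.5 * (2 * 3.1415 * a ^ 3) := by
      nlinarith [mul_nonneg (sub_nonneg.2 ha) (sq_nonneg a), mul_nonneg (sub_nonneg.2 ha) ha0.le, sub_nonneg.2 ha]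
    have l1 : 1.00002 * 0.889 ^ 2 * (2 * (a / 8 + 2) + 1) * (4 * Real.pi ^ 2 * (a ^ 2 + (a / 8 + 2) ^ 2)) ≤
        0.790338 * (2 * (a / 8 + 2) + 1) * (4 * 9.8697 * (a ^ 2 + (a / 8 + 2) ^ 2)) := by
      have h1 : 1.00002 * (0.889 : ℝ) ^ 2 ≤ 0.790338 := by norm_num
      have h2 : 4 * Real.pi ^ 2 * (a ^ 2 + (a / 8 + 2) ^ 2) ≤ 4 * 9.8697 * (a ^ 2 + (a / 8 + 2) ^ 2) := by nlinarith
      exact mul_le_mul (mul_le_mul_of_nonneg_right h1 hR0) h2 (by positivity) (by positivity)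
    have l2 : 10.5 * (2 * 3.1415 * a ^ 3) ≤ 10.5 * (2 * Real.pi * a ^ 3) := by nlinarith
    linarith
  exact step.trans (mul_le_mul_of_nonneg_left hlow (by norm_num))

/-! ## §13 (v6, E6-b locality) p4's `hTransport` entries in closed form: the transported profile's coefficients are `Σ_n c_n τ(a,θ; β+n → β+n′)`
with `|τ| ≤ min(1, 4/|Λ₊| + 2/|Λ₋|)`, `Λ± = 2π(n − n′ ± aθ)` (tree `…KHTransportCoeff`) -/

/-- The transverse coefficient of a transported finite profile is the profile-weighted sum of transport coefficients (linearity). -/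
theorem coeff_transport_modeProfile (a β θ : ℝ) (K : ℕ) (c : ℤ → ℂ) (n' : ℤ) :
    coeff β ⟨fun y => modeProfile β K c y * transportPhase a θ y, []⟩ n' =
      ∑ n ∈ win K, c n * ∫ y in (-(1 / 2 : ℝ))..(1 / 2 : ℝ), Complex.exp (((2 * Real.pi * (β + n) * y : ℝ) : ℂ) * Complex.I) *
        Complex.exp (-((2 * Real.pi * a * θ * triWave y : ℝ) : ℂ) * Complex.I) * Complex.exp (-((2 * Real.pi * (β + n') * y : ℝ) : ℂ) * Complex.I) := by
  simp only [coeff, modeProfile, transportPhase, List.map_nil, List.sum_nil, add_zero, Finset.sum_mul]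
  have hc : ∀ n : ℤ, Continuous fun y : ℝ => c n * Complex.exp (((2 * Real.pi * (β + n) * y : ℝ)) * Complex.I) *
      Complex.exp (-((2 * Real.pi * a * θ * triWave y : ℝ) : ℂ) * Complex.I) * Complex.exp (-((2 * Real.pi * (β + n') * y : ℝ) : ℂ) * Complex.I) := by
    intro n; have := continuous_triWave; fun_prop
  rw [intervalIntegral.integral_finsetSum (fun n _ => (hc n).intervalIntegrable _ _)]
  refine Finset.sum_congr rfl fun n _ => ?_
  rw [← intervalIntegral.integral_const_mul]
  refine intervalIntegral.integral_congr fun y _ => ?_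
  ring

/-- **Locality of p4's H-slot transport, by name:** every entry of `hTransport` is bounded by the profile-weighted sinc tails
`Σ_n ‖ζ m n‖·(4/|2π(n−n′+(α+m)θ)| + 2/|2π(n−n′−(α+m)θ)|)` (when no denominator vanishes). -/
theorem norm_hTransport_le (α β θ : ℝ) (K : ℕ) (ζ : CState) (m n' : ℤ)
    (hp : ∀ n ∈ win K, 2 * Real.pi * ((β + n) - (β + n') + (α + m) * θ) ≠ 0) (hm : ∀ n ∈ win K, 2 * Real.pi * ((β + n) - (β + n') - (α + m) * θ) ≠ 0) :
    ‖hTransport α β θ K ζ m n'‖ ≤ ∑ n ∈ win K, ‖ζ m n‖ *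
      (4 / |2 * Real.pi * ((β + n) - (β + n') + (α + m) * θ)| + 2 / |2 * Real.pi * ((β + n) - (β + n') - (α + m) * θ)|) := by
  unfold hTransport
  split_ifs with h
  · rw [coeff_transport_modeProfile]
    refine (norm_sum_le _ _).trans (Finset.sum_le_sum fun n hn => ?_)
    rw [norm_mul]
    exact mul_le_mul_of_nonneg_left (norm_transport_coeff_le (α + m) θ (β + n) (β + n') (hp n hn) (hm n hn)) (norm_nonneg _)
  · rw [norm_zero]; exact Finset.sum_nonneg fun n _ => by positivity

/-- The trivial companion: `‖hTransport … m n′‖ ≤ Σ_n ‖ζ m n‖` (each transport coefficient has modulus ≤ 1). -/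
theorem norm_hTransport_le_sum (α β θ : ℝ) (K : ℕ) (ζ : CState) (m n' : ℤ) :
    ‖hTransport α β θ K ζ m n'‖ ≤ ∑ n ∈ win K, ‖ζ m n‖ := by
  unfold hTransport
  split_ifs with h
  · rw [coeff_transport_modeProfile]
    refine (norm_sum_le _ _).trans (Finset.sum_le_sum fun n hn => ?_)
    rw [norm_mul]
    have := norm_transport_coeff_le_one (α + m) θ (β + n) (β + n')
    calc ‖ζ m n‖ * _ ≤ ‖ζ m n‖ * 1 := mul_le_mul_of_nonneg_left this (norm_nonneg _)
      _ = ‖ζ m n‖ := mul_one _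
  · rw [norm_zero]; exact Finset.sum_nonneg fun n _ => norm_nonneg _

/-- **Locality of p4's V-slot transport, by name** (roles of the coordinates exchanged): `‖vTransport … m′ n‖ ≤ Σ_m ‖ζ m n‖·(sinc tails)`. -/
theorem norm_vTransport_le (α β θ : ℝ) (K : ℕ) (ζ : CState) (m' n : ℤ)
    (hp : ∀ m ∈ win K, 2 * Real.pi * ((α + m) - (α + m') + (β + n) * θ) ≠ 0) (hm : ∀ m ∈ win K, 2 * Real.pi * ((α + m) - (α + m') - (β + n) * θ) ≠ 0) :
    ‖vTransport α β θ K ζ m' n‖ ≤ ∑ m ∈ win K, ‖ζ m n‖ *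
      (4 / |2 * Real.pi * ((α + m) - (α + m') + (β + n) * θ)| + 2 / |2 * Real.pi * ((α + m) - (α + m') - (β + n) * θ)|) := by
  unfold vTransport
  split_ifs with h
  · rw [coeff_transport_modeProfile]
    refine (norm_sum_le _ _).trans (Finset.sum_le_sum fun m hm' => ?_)
    rw [norm_mul]
    exact mul_le_mul_of_nonneg_left (norm_transport_coeff_le (β + n) θ (α + m) (α + m') (hp m hm') (hm m hm')) (norm_nonneg _)
  · rw [norm_zero]; exact Finset.sum_nonneg fun m _ => by positivity

/-- `‖vTransport … m′ n‖ ≤ Σ_m ‖ζ m n‖`. -/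
theorem norm_vTransport_le_sum (α β θ : ℝ) (K : ℕ) (ζ : CState) (m' n : ℤ) :
    ‖vTransport α β θ K ζ m' n‖ ≤ ∑ m ∈ win K, ‖ζ m n‖ := by
  unfold vTransport
  split_ifs with h
  · rw [coeff_transport_modeProfile]
    refine (norm_sum_le _ _).trans (Finset.sum_le_sum fun m hm' => ?_)
    rw [norm_mul]
    have := norm_transport_coeff_le_one (β + n) θ (α + m) (α + m')
    calc ‖ζ m n‖ * _ ≤ ‖ζ m n‖ * 1 := mul_le_mul_of_nonneg_left this (norm_nonneg _)
      _ = ‖ζ m n‖ := mul_one _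
  · rw [norm_zero]; exact Finset.sum_nonneg fun m _ => norm_nonneg _

/-! ## §14 (v7) L-i-c BY NAME: the windowed input energy of a V source in `Transfer` (tree `…KHStraightPairEnergy`, p707331) -/

/-- The level-0 windowed energy of the V-source input state, spelled out (the window truncation is invisible inside `cEnergy`'s window sums). -/
theorem cEnergy_inputState_V (α β θ : ℝ) (K : ℕ) (d : ℤ → Fin 2 → ℂ) :
    cEnergy α β 0 K (inputState α β θ K PType.V d) = ∑ m ∈ win K, ∑ n ∈ win K,
      ‖d n 0 * Complex.exp (-(Real.pi * (α + m) / 2 : ℝ) * Complex.I) + d n 1 * Complex.exp ((Real.pi * (α + m) / 2 : ℝ) * Complex.I)‖ ^ 2 /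
        (4 * Real.pi ^ 2 * ((α + m) ^ 2 + (β + n) ^ 2)) := by
  unfold cEnergy
  refine Finset.sum_congr rfl fun m hm => Finset.sum_congr rfl fun n hn => ?_
  simp only [inputState, truncW, vPairState, if_pos (And.intro hm hn), pow_zero, mul_one]

/-- **L-i-c BY NAME** (E6 far-row schema, piece (i), A27-7): for a class `(α, β)` with `α ∈ [0,1]`, every strain `θ`, truncation `K` and V-pair densities `d`,
`cEnergy α β 0 K (inputState α β θ K V d) ≥ (1/4π²)·Σ_{|n| ≤ K} (‖d n 0‖² + ‖d n 1‖²)·(π/|β+n| − 2/(K+1) − 4/(β+n)²)`: every source column in shell `s`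
(`|β+n| ≥ 2^{s−1}`) inside the window carries at least `1 − (2/π)2^{s−1}/(K+1) − 8/(π2^s)` of its full-lattice energy `(‖d n 0‖²+‖d n 1‖²)/(4π|β+n|)` —
the denominator of every far entry `M[(t′,s′) ← (V,s)]`. -/
theorem cEnergy_inputState_V_lower {α : ℝ} (hα0 : 0 ≤ α) (hα1 : α ≤ 1) (β θ : ℝ) (K : ℕ) (d : ℤ → Fin 2 → ℂ) :
    (∑ n ∈ win K, (‖d n 0‖ ^ 2 + ‖d n 1‖ ^ 2) * (Real.pi / |β + n| - 2 / (K + 1) - 4 / (β + n) ^ 2)) / (4 * Real.pi ^ 2) ≤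
      cEnergy α β 0 K (inputState α β θ K PType.V d) := by
  rw [cEnergy_inputState_V]
  exact vPair_window_energy_lower hα0 hα1 β K d

/-- **The input energy of a V source supported in shell `s ≥ 2` (uniform form):** if `d` vanishes off shell `s` (`|β+n| ∈ [2^{s−1}, 2^s)`), then
`cEnergy α β 0 K (inputState α β θ K V d) ≥ (1/4π²)·(π/2^s − 2/(K+1) − 4/4^{s−1})·Σ_{|n| ≤ K} (‖d n 0‖² + ‖d n 1‖²)`. -/
theorem cEnergy_inputState_V_shell_lower {α : ℝ} (hα0 : 0 ≤ α) (hα1 : α ≤ 1) (β θ : ℝ) (K : ℕ) {s : ℕ} (hs : 2 ≤ s) (d : ℤ → Fin 2 → ℂ)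
    (hd : SupportedIn s β d) :
    (Real.pi / 2 ^ s - 2 / (K + 1) - 4 / 4 ^ (s - 1)) * (∑ n ∈ win K, (‖d n 0‖ ^ 2 + ‖d n 1‖ ^ 2)) / (4 * Real.pi ^ 2) ≤
      cEnergy α β 0 K (inputState α β θ K PType.V d) := by
  refine le_trans ?_ (cEnergy_inputState_V_lower hα0 hα1 β θ K d)
  refine div_le_div_of_nonneg_right ?_ (by positivity)
  rw [Finset.mul_sum]
  refine Finset.sum_le_sum fun n _ => ?_
  by_cases hin : InShell s (β + (n : ℝ))
  · obtain ⟨k, rfl⟩ : ∃ k, s = k + 2 := ⟨s - 2, by omega⟩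
    have hlo : (2 : ℝ) ^ (k + 1) ≤ |β + n| := hin.1
    have hhi : |β + n| < (2 : ℝ) ^ (k + 2) := hin.2
    have hpos : (0 : ℝ) < 2 ^ (k + 1) := by positivity
    have hb0 : 0 < |β + n| := hpos.trans_le hlo
    rw [mul_comm]
    refine mul_le_mul_of_nonneg_left ?_ (by positivity)
    have e1 : Real.pi / 2 ^ (k + 2) ≤ Real.pi / |β + n| := div_le_div_of_nonneg_left Real.pi_pos.le hb0 hhi.le
    have e2 : 4 / (β + (n : ℝ)) ^ 2 ≤ 4 / 4 ^ (k + 2 - 1) := by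
      rw [show k + 2 - 1 = k + 1 by omega, ← sq_abs]
      refine div_le_div_of_nonneg_left (by norm_num) (by positivity) ?_
      calc (4 : ℝ) ^ (k + 1) = (2 ^ (k + 1)) ^ 2 := by rw [← pow_mul, show (4 : ℝ) = 2 ^ 2 by norm_num, ← pow_mul]; ring_nf
        _ ≤ |β + n| ^ 2 := pow_le_pow_left₀ hpos.le hlo 2
    linarith
  · have h0 : d n = 0 := hd n hin
    simp [h0]

/-! ## §15 (v8) L-i-b IN FULL, BY NAME: the slots' transport amplifies windowed level energy by at most `θ² + 2` (tree `…KHTransportDuality`, p709500) -/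

/-- One column of `vTransport`, inside the window, is the transport coefficient of the column profile. -/
theorem vTransport_apply_of_mem (α β θ : ℝ) (K : ℕ) (ζ : CState) {m' n : ℤ} (hm' : m' ∈ win K) (hn : n ∈ win K) :
    vTransport α β θ K ζ m' n = ∫ x in (-(1 / 2 : ℝ))..(1 / 2),
      ((∑ m ∈ win K, ζ m n * Complex.exp ((2 * Real.pi * (α + m) * x : ℝ) * Complex.I)) *
        Complex.exp (-((2 * Real.pi * (β + n) * θ * triWave x : ℝ) : ℂ) * Complex.I)) * Complex.exp (-(2 * Real.pi * (α + m') * x : ℝ) * Complex.I) := by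
  simp only [vTransport, if_pos (And.intro hm' hn), coeff, modeProfile, transportPhase, List.map_nil, List.sum_nil, add_zero]

/-- One row of `hTransport`, inside the window, is the transport coefficient of the row profile. -/
theorem hTransport_apply_of_mem (α β θ : ℝ) (K : ℕ) (ζ : CState) {m n' : ℤ} (hm : m ∈ win K) (hn' : n' ∈ win K) :
    hTransport α β θ K ζ m n' = ∫ y in (-(1 / 2 : ℝ))..(1 / 2),
      ((∑ n ∈ win K, ζ m n * Complex.exp ((2 * Real.pi * (β + n) * y : ℝ) * Complex.I)) *
        Complex.exp (-((2 * Real.pi * (α + m) * θ * triWave y : ℝ) : ℂ) * Complex.I)) * Complex.exp (-(2 * Real.pi * (β + n') * y : ℝ) * Complex.I) := by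
  simp only [hTransport, if_pos (And.intro hm hn'), coeff, modeProfile, transportPhase, List.map_nil, List.sum_nil, add_zero]

/-- The energy-form transport bound for ONE column of `vTransport` (line `β + n`, any value incl. `0`). -/
theorem vTransport_column_energy_le (α β θ : ℝ) (ℓ K : ℕ) (ζ : CState) {n : ℤ} (hn : n ∈ win K) :
    ∑ m' ∈ win K, ‖vTransport α β θ K ζ m' n‖ ^ 2 / (4 * Real.pi ^ 2 * (4 : ℝ) ^ ℓ * ((α + m') ^ 2 + (β + n) ^ 2)) ≤
      (θ ^ 2 + 2) * ∑ m ∈ win K, ‖ζ m n‖ ^ 2 / (4 * Real.pi ^ 2 * (4 : ℝ) ^ ℓ * ((α + m) ^ 2 + (β + n) ^ 2)) := by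
  have hc : (0 : ℝ) < 4 * Real.pi ^ 2 * (4 : ℝ) ^ ℓ := by positivity
  have e : ∀ (v : ℂ) (m : ℤ), ‖v‖ ^ 2 / (4 * Real.pi ^ 2 * (4 : ℝ) ^ ℓ * ((α + m) ^ 2 + (β + n) ^ 2)) =
      (1 / (4 * Real.pi ^ 2 * (4 : ℝ) ^ ℓ)) * (‖v‖ ^ 2 / ((α + m) ^ 2 + (β + n) ^ 2)) := by
    intro v m
    rw [mul_comm (4 * Real.pi ^ 2 * (4 : ℝ) ^ ℓ) ((α + (m : ℝ)) ^ 2 + (β + n) ^ 2), ← div_div, div_eq_mul_one_div, mul_comm]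
  simp_rw [e, ← Finset.mul_sum]
  rw [mul_left_comm]
  refine mul_le_mul_of_nonneg_left ?_ (by positivity)
  rcases eq_or_ne (β + (n : ℝ)) 0 with hb | hb
  · -- the untransported column `β + n = 0`
    have hid : ∀ m' ∈ win K, vTransport α β θ K ζ m' n = ζ m' n := by
      intro m' hm'
      rw [vTransport_apply_of_mem α β θ K ζ hm' hn]
      have h1 : ∀ x : ℝ, Complex.exp (-((2 * Real.pi * (β + n) * θ * triWave x : ℝ) : ℂ) * Complex.I) = 1 := by
        intro x; rw [hb]; simp
      simp_rw [h1, mul_one]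
      rw [integral_blochPoly_mul_conjExp, if_pos hm']
    rw [Finset.sum_congr rfl fun m' hm' => by rw [hid m' hm']]
    have h0 : 0 ≤ ∑ m ∈ win K, ‖ζ m n‖ ^ 2 / ((α + m) ^ 2 + (β + n) ^ 2) := Finset.sum_nonneg fun _ _ => by positivity
    nlinarith [sq_nonneg θ]
  · rw [Finset.sum_congr rfl fun m' hm' => by rw [vTransport_apply_of_mem α β θ K ζ hm' hn]]
    exact transport_energy_duality α θ hb (win K) (win K) (fun m => ζ m n)

/-- **L-i-b BY NAME (V slot).** For every class `(α, β)`, strain `θ`, level `ℓ`, window `K` and lattice state `ζ`: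
`cEnergy α β ℓ K (vTransport α β θ K ζ) ≤ (θ² + 2)·cEnergy α β ℓ K ζ`. -/
theorem cEnergy_vTransport_le (α β θ : ℝ) (ℓ K : ℕ) (ζ : CState) :
    cEnergy α β ℓ K (vTransport α β θ K ζ) ≤ (θ ^ 2 + 2) * cEnergy α β ℓ K ζ := by
  unfold cEnergy
  rw [Finset.sum_comm]
  conv_rhs => rw [Finset.sum_comm]
  rw [Finset.mul_sum]
  exact Finset.sum_le_sum fun n hn => vTransport_column_energy_le α β θ ℓ K ζ hn

/-- The energy-form transport bound for ONE row of `hTransport` (line `α + m`, any value incl. `0`). -/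
theorem hTransport_row_energy_le (α β θ : ℝ) (ℓ K : ℕ) (ζ : CState) {m : ℤ} (hm : m ∈ win K) :
    ∑ n' ∈ win K, ‖hTransport α β θ K ζ m n'‖ ^ 2 / (4 * Real.pi ^ 2 * (4 : ℝ) ^ ℓ * ((α + m) ^ 2 + (β + n') ^ 2)) ≤
      (θ ^ 2 + 2) * ∑ n ∈ win K, ‖ζ m n‖ ^ 2 / (4 * Real.pi ^ 2 * (4 : ℝ) ^ ℓ * ((α + m) ^ 2 + (β + n) ^ 2)) := by
  have hc : (0 : ℝ) < 4 * Real.pi ^ 2 * (4 : ℝ) ^ ℓ := by positivity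
  have e : ∀ (v : ℂ) (n : ℤ), ‖v‖ ^ 2 / (4 * Real.pi ^ 2 * (4 : ℝ) ^ ℓ * ((α + m) ^ 2 + (β + n) ^ 2)) =
      (1 / (4 * Real.pi ^ 2 * (4 : ℝ) ^ ℓ)) * (‖v‖ ^ 2 / ((β + n) ^ 2 + (α + m) ^ 2)) := by
    intro v n
    rw [add_comm ((α + (m : ℝ)) ^ 2), mul_comm (4 * Real.pi ^ 2 * (4 : ℝ) ^ ℓ) ((β + (n : ℝ)) ^ 2 + (α + m) ^ 2), ← div_div,
      div_eq_mul_one_div, mul_comm]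
  simp_rw [e, ← Finset.mul_sum]
  rw [mul_left_comm]
  refine mul_le_mul_of_nonneg_left ?_ (by positivity)
  rcases eq_or_ne (α + (m : ℝ)) 0 with hb | hb
  · have hid : ∀ n' ∈ win K, hTransport α β θ K ζ m n' = ζ m n' := by
      intro n' hn'
      rw [hTransport_apply_of_mem α β θ K ζ hm hn']
      have h1 : ∀ y : ℝ, Complex.exp (-((2 * Real.pi * (α + m) * θ * triWave y : ℝ) : ℂ) * Complex.I) = 1 := by
        intro y; rw [hb]; simp
      simp_rw [h1, mul_one]
      rw [integral_blochPoly_mul_conjExp, if_pos hn']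
    rw [Finset.sum_congr rfl fun n' hn' => by rw [hid n' hn']]
    have h0 : 0 ≤ ∑ n ∈ win K, ‖ζ m n‖ ^ 2 / ((β + n) ^ 2 + (α + m) ^ 2) := Finset.sum_nonneg fun _ _ => by positivity
    nlinarith [sq_nonneg θ]
  · rw [Finset.sum_congr rfl fun n' hn' => by rw [hTransport_apply_of_mem α β θ K ζ hm hn']]
    exact transport_energy_duality β θ hb (win K) (win K) (fun n => ζ m n)

/-- **L-i-b BY NAME (H slot).** `cEnergy α β ℓ K (hTransport α β θ K ζ) ≤ (θ² + 2)·cEnergy α β ℓ K ζ`. -/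
theorem cEnergy_hTransport_le (α β θ : ℝ) (ℓ K : ℕ) (ζ : CState) :
    cEnergy α β ℓ K (hTransport α β θ K ζ) ≤ (θ ^ 2 + 2) * cEnergy α β ℓ K ζ := by
  unfold cEnergy
  rw [Finset.mul_sum]
  exact Finset.sum_le_sum fun m hm => hTransport_row_energy_le α β θ ℓ K ζ hm

/-- **The output H piece of a phase, by name:** the level-`ℓ` energy of the V-transported fresh H pair of shell `s′` is at most `θ² + 2` times the energy
of the STRAIGHT H pair `hPairState (restrictShell s′ α′ freshH)` (whose column sums are elementary, `…KHStraightPairEnergy`). -/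
theorem outEnergyAt_H_le (α' β' θ : ℝ) (K ℓ s' : ℕ) (pc : PhasePieces) :
    outEnergyAt α' β' θ K ℓ s' pc PType.H ≤ (θ ^ 2 + 2) * cEnergy α' β' ℓ K (hPairState β' (restrictShell s' α' pc.freshH)) := by
  simp only [outEnergyAt]
  exact cEnergy_vTransport_le α' β' θ ℓ K _

/-! ## §16 (v9) Towards the by-name far entry: straight H-pair energy, Bloch-evenness of the block, fresh H densities of positive rows -/

/-- **Straight H-pair energy BY NAME (upper).** For a class `(α, β)` with `β ∈ [0,1]` and H-pair densities `q` vanishing on the zero line `α + m = 0`: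
`cEnergy α β ℓ K (hPairState β q) ≤ (1/(4π²4^ℓ))·Σ_{|m| ≤ K} (‖q m 0‖² + ‖q m 1‖²)·(π/|α+m| + 4/(α+m)²)` (tree `vPair_column_energy_upper`, rows ↔ columns). -/
theorem cEnergy_hPairState_le {β : ℝ} (hβ0 : 0 ≤ β) (hβ1 : β ≤ 1) (α : ℝ) (ℓ K : ℕ) (q : ℤ → Fin 2 → ℂ)
    (hq : ∀ m ∈ win K, α + (m : ℝ) = 0 → q m = 0) :
    cEnergy α β ℓ K (hPairState β q) ≤
      (1 / (4 * Real.pi ^ 2 * (4 : ℝ) ^ ℓ)) * ∑ m ∈ win K, (‖q m 0‖ ^ 2 + ‖q m 1‖ ^ 2) * (Real.pi / |α + m| + 4 / (α + m) ^ 2) := by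
  unfold cEnergy
  rw [Finset.mul_sum]
  refine Finset.sum_le_sum fun m hm => ?_
  have e : ∀ (v : ℂ) (n : ℤ), ‖v‖ ^ 2 / (4 * Real.pi ^ 2 * (4 : ℝ) ^ ℓ * ((α + m) ^ 2 + (β + n) ^ 2)) =
      (1 / (4 * Real.pi ^ 2 * (4 : ℝ) ^ ℓ)) * (‖v‖ ^ 2 / ((β + n) ^ 2 + (α + m) ^ 2)) := by
    intro v n
    rw [add_comm ((α + (m : ℝ)) ^ 2), mul_comm (4 * Real.pi ^ 2 * (4 : ℝ) ^ ℓ) ((β + (n : ℝ)) ^ 2 + (α + m) ^ 2), ← div_div,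
      div_eq_mul_one_div, mul_comm]
  simp only [hPairState]
  simp_rw [e, ← Finset.mul_sum]
  refine mul_le_mul_of_nonneg_left ?_ (by positivity)
  rcases eq_or_ne (α + (m : ℝ)) 0 with hb | hb
  · have h0 : q m = 0 := hq m hm hb
    simp [h0]
  · exact vPair_column_energy_upper hβ0 hβ1 hb K (q m 0) (q m 1)

/-- `c²` is even in the Bloch phase (tree `sawSigma0_neg_bloch`, `sawS_neg_bloch`). -/
theorem sawC2_neg_bloch (a β : ℝ) : sawC2 a (-β) = sawC2 a β := by
  unfold sawC2
  rw [sawSigma0_neg_bloch, sawS_neg_bloch, Complex.normSq_conj]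

/-- `λ` is even in the Bloch phase. -/
theorem khLam_neg_bloch (a β : ℝ) : khLam a (-β) = khLam a β := by
  unfold khLam
  rw [sawC2_neg_bloch]

/-- The propagator scalars are even in the Bloch phase. -/
theorem propC_neg_bloch (a β t : ℝ) : propC a (-β) t = propC a β t := by
  simp only [propC, khLam_neg_bloch]

/-- The propagator scalars are even in the Bloch phase. -/
theorem propSn_neg_bloch (a β t : ℝ) : propSn a (-β) t = propSn a β t := by
  simp only [propSn, khLam_neg_bloch]

/-- The line kernel is even in the streamwise wavenumber, so the block at `−a` is MINUS the block at `a`. -/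
theorem blockX_neg (a β : ℝ) : blockX (-a) β = -blockX a β := by
  simp only [blockX, lineKernel_neg]
  rw [← neg_smul]
  congr 1
  push_cast
  ring

/-- **Fresh H densities of a positive row BY NAME:** for a row `m` of the window with `α + m ≥ 4` and `0 ≤ θ ≤ 8`,
`‖hFresh α β θ K ζ m i‖ ≤ (Σ_{|n| ≤ K} ‖ζ m n‖)·0.889/(α+m)` (crux §9 `norm_sheetAmps_modeProfile_le`). -/
theorem norm_hFresh_le_of_pos (α β : ℝ) {θ : ℝ} (hθ0 : 0 ≤ θ) (hθ : θ ≤ 8) (K : ℕ) (ζ : CState) {m : ℤ} (hm : m ∈ win K)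
    (ha : 4 ≤ α + (m : ℝ)) (i : Fin 2) :
    ‖hFresh α β θ K ζ m i‖ ≤ (∑ n ∈ win K, ‖ζ m n‖) * (0.889 / (α + m)) := by
  simp only [hFresh, if_pos hm]
  exact norm_sheetAmps_modeProfile_le ha β hθ0 hθ K (ζ m) i

/-! ## §17 (v10) P2-S at general Bloch phase: `(a, β, ξ) ↦ (−a, −β, −ξ)` is complex conjugation — the creation law for NEGATIVE lines -/

/-- `conj (lineKernel a β y) = lineKernel a (−β) y`. -/
theorem conj_lineKernel (a β y : ℝ) : starRingEnd ℂ (lineKernel a β y) = lineKernel a (-β) y := by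
  have hz : starRingEnd ℂ (Complex.exp (2 * Real.pi * β * Complex.I)) = Complex.exp (2 * Real.pi * (((-β : ℝ)) : ℂ) * Complex.I) := by
    rw [← Complex.exp_conj]; congr 1
    simp only [map_mul, map_ofNat, Complex.conj_ofReal, Complex.conj_I]; push_cast; ring
  have hz' : starRingEnd ℂ (Complex.exp (2 * Real.pi * β * (⌊y⌋ : ℝ) * Complex.I)) = Complex.exp (2 * Real.pi * (((-β : ℝ)) : ℂ) * (⌊y⌋ : ℝ) * Complex.I) := by
    rw [← Complex.exp_conj]; congr 1
    simp only [map_mul, map_ofNat, Complex.conj_ofReal, Complex.conj_I]; push_cast; ring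
  simp only [lineKernel, map_mul, map_div₀, map_add, map_neg, map_sub, map_one, map_ofNat, Complex.conj_ofReal, hz, hz']

/-- `sawQ (−k) = (sawQ k)⁻¹`. -/
theorem sawQ_neg (k : ℝ) : sawQ (-k) = (sawQ k)⁻¹ := by
  simp only [sawQ, mul_neg, neg_neg, ← Real.exp_neg]

/-- `Σ₀` is even in the streamwise wavenumber (`k ≠ 0`). -/
theorem sawSigma0_neg_arg {k : ℝ} (hk : k ≠ 0) (β : ℝ) : sawSigma0 (-k) β = sawSigma0 k β := by
  have hq : 0 < sawQ k := Real.exp_pos _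
  have hq1 : sawQ k ≠ 1 := by
    simp only [sawQ]; rw [Ne, Real.exp_eq_one_iff]; intro h; apply hk; nlinarith [Real.pi_pos]
  have hc : Real.cos (2 * Real.pi * β) ≤ 1 := Real.cos_le_one _
  have hc' : -1 ≤ Real.cos (2 * Real.pi * β) := Real.neg_one_le_cos _
  have hden : 1 - 2 * sawQ k * Real.cos (2 * Real.pi * β) + sawQ k ^ 2 ≠ 0 := by
    intro h
    have h1 : (1 - sawQ k) ^ 2 ≤ 1 - 2 * sawQ k * Real.cos (2 * Real.pi * β) + sawQ k ^ 2 := by nlinarith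
    have h2 : (1 - sawQ k) ^ 2 = 0 := le_antisymm (by rw [← h]; exact h1) (sq_nonneg _)
    exact hq1 (by nlinarith [pow_eq_zero_iff (n := 2) (two_ne_zero) |>.1 h2])
  unfold sawSigma0
  rw [sawQ_neg]
  field_simp
  ring

/-- `S` is even in the streamwise wavenumber (`k ≠ 0`). -/
theorem sawS_neg_arg {k : ℝ} (hk : k ≠ 0) (β : ℝ) : sawS (-k) β = sawS k β := by
  have hq : 0 < sawQ k := Real.exp_pos _
  have hq1 : sawQ k ≠ 1 := by
    simp only [sawQ]; rw [Ne, Real.exp_eq_one_iff]; intro h; apply hk; nlinarith [Real.pi_pos]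
  set z : ℂ := Complex.exp (((2 * Real.pi * β : ℝ) : ℂ) * Complex.I) with hz
  set Q : ℂ := ((sawQ k : ℝ) : ℂ) with hQ
  have hzn : ‖z‖ = 1 := by rw [hz, Complex.norm_exp_ofReal_mul_I]
  have hz0 : z ≠ 0 := by intro h; rw [h, norm_zero] at hzn; exact zero_ne_one hzn
  have hzz : z * starRingEnd ℂ z = 1 := by
    rw [Complex.mul_conj, Complex.normSq_eq_norm_sq, hzn]; norm_num
  have hzbar : starRingEnd ℂ z = z⁻¹ := by
    have := congrArg (fun w => z⁻¹ * w) hzz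
    simp only [← mul_assoc, inv_mul_cancel₀ hz0, one_mul, mul_one] at this
    exact this
  have hQ0 : Q ≠ 0 := by rw [hQ]; exact_mod_cast hq.ne'
  have hQn : ‖Q‖ = sawQ k := by rw [hQ, Complex.norm_real, Real.norm_eq_abs, abs_of_pos hq]
  -- the two non-resonance facts `z ≠ Q`, `zQ ≠ 1`
  have F2 : Q - z ≠ 0 := by
    intro h
    have : ‖Q‖ = ‖z‖ := by rw [sub_eq_zero.1 h]
    rw [hQn, hzn] at this
    exact hq1 this
  have F1 : 1 - z * Q ≠ 0 := by
    intro h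
    have : ‖z * Q‖ = 1 := by rw [← sub_eq_zero.1 h]; exact norm_one
    rw [norm_mul, hzn, hQn, one_mul] at this
    exact hq1 this
  have F3 : Q - z⁻¹ ≠ 0 := by
    intro h
    have h' : z * Q = 1 := by
      have := congrArg (fun w => z * w) (sub_eq_zero.1 h)
      simpa [mul_inv_cancel₀ hz0] using this
    exact F1 (by rw [h']; ring)
  have F4 : z - Q ≠ 0 := by intro h; exact F2 (by rw [← neg_sub, h, neg_zero])
  have F1' : 1 - Q * z ≠ 0 := by rwa [mul_comm] at F1
  have F1'' : -1 + Q * z ≠ 0 := by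
    intro h; apply F1'; linear_combination -h
  have F5 : Q * z - 1 ≠ 0 := by
    intro h; apply F1'; linear_combination -h
  have hk' : (k : ℂ) ≠ 0 := by exact_mod_cast hk
  -- rewrite everything in terms of `z`, `z⁻¹`, `Q`, `Q⁻¹`
  have hexp : ((Real.exp (-(-k * Real.pi)) / (2 * -k) : ℝ) : ℂ) = -(((Real.exp (-(k * Real.pi)) / (2 * k) : ℝ) : ℂ) * Q⁻¹ * Q⁻¹ * Q) := by
    have e1 : Real.exp (-(-k * Real.pi)) = Real.exp (-(k * Real.pi)) * ((sawQ k)⁻¹) := by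
      rw [sawQ, ← Real.exp_neg, ← Real.exp_add]; congr 1; ring
    rw [e1, hQ]; push_cast; field_simp
  simp only [sawS, sawQ_neg]
  rw [← hz, hzbar, hexp]
  push_cast
  rw [← hQ]
  field_simp
  ring


/-- `c²` is even in the streamwise wavenumber (`a ≠ 0`). -/
theorem sawC2_neg_arg {a : ℝ} (ha : a ≠ 0) (β : ℝ) : sawC2 (-a) β = sawC2 a β := by
  unfold sawC2
  rw [sawSigma0_neg_arg ha, sawS_neg_arg ha]

/-- `λ(−a, −β) = λ(a, β)` (`a ≠ 0`). -/
theorem khLam_neg_neg {a : ℝ} (ha : a ≠ 0) (β : ℝ) : khLam (-a) (-β) = khLam a β := by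
  unfold khLam
  rw [sawC2_neg_bloch, sawC2_neg_arg ha, neg_sq]

/-- The propagator scalars at `(−a, −β)`. -/
theorem propC_neg_neg {a : ℝ} (ha : a ≠ 0) (β t : ℝ) : propC (-a) (-β) t = propC a β t := by
  simp only [propC, khLam_neg_neg ha]

/-- The propagator scalars at `(−a, −β)`. -/
theorem propSn_neg_neg {a : ℝ} (ha : a ≠ 0) (β t : ℝ) : propSn (-a) (-β) t = propSn a β t := by
  simp only [propSn, khLam_neg_neg ha]

/-- The block at `(−a, −β)` is the entrywise conjugate of the block at `(a, β)`. -/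
theorem blockX_neg_neg (a β : ℝ) (i j : Fin 2) : blockX (-a) (-β) i j = starRingEnd ℂ (blockX a β i j) := by
  obtain ⟨e00, e01, e10, e11⟩ := blockX_apply (-a) (-β)
  obtain ⟨f00, f01, f10, f11⟩ := blockX_apply a β
  have hG : lineKernel a (-β) 0 = starRingEnd ℂ (lineKernel a β 0) := (conj_lineKernel a β 0).symm
  have hH : lineKernel a (-β) (1 / 2) = starRingEnd ℂ (lineKernel a β (1 / 2)) := (conj_lineKernel a β (1 / 2)).symm
  fin_cases i <;> fin_cases j
  · simp only [Fin.zero_eta, Fin.isValue, e00, f00, lineKernel_neg, hG, map_mul, map_sub, map_neg, map_div₀, map_one, map_ofNat,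
      Complex.conj_ofReal, Complex.conj_I]
    push_cast; ring
  · simp only [Fin.zero_eta, Fin.mk_one, Fin.isValue, e01, f01, lineKernel_neg, hH, map_mul, map_neg, map_ofNat, Complex.conj_ofReal,
      Complex.conj_I]
    push_cast; ring
  · simp only [Fin.zero_eta, Fin.mk_one, Fin.isValue, e10, f10, lineKernel_neg, hH, map_mul, map_ofNat, Complex.conj_ofReal, Complex.conj_I,
      Complex.conj_conj]
    push_cast; ring
  · simp only [Fin.mk_one, Fin.isValue, e11, f11, lineKernel_neg, hG, map_mul, map_add, map_div₀, map_one, map_ofNat, Complex.conj_ofReal,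
      Complex.conj_I]
    push_cast; ring

/-- The propagator at `(−a, −β)` is the entrywise conjugate (`a ≠ 0`). -/
theorem propagator_neg_neg {a : ℝ} (ha : a ≠ 0) (β t : ℝ) (i j : Fin 2) :
    propagator (-a) (-β) t i j = starRingEnd ℂ (propagator a β t i j) := by
  simp only [propagator, Matrix.add_apply, Matrix.smul_apply, smul_eq_mul, propC_neg_neg ha, propSn_neg_neg ha, map_add, map_mul,
    Complex.conj_ofReal, blockX_neg_neg]
  congr 2
  fin_cases i <;> fin_cases j <;> simp

/-- The transport phase at `−a` is the conjugate (any strain time). -/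
theorem transportPhase_neg' (a s y : ℝ) : transportPhase (-a) s y = starRingEnd ℂ (transportPhase a s y) := transportPhase_neg a s y

/-- **The forcing of a CONJUGATED interior at `(−a, −β)` is the conjugate of the forcing** (no sheets). -/
theorem forcing_neg_neg_nosheet (a β : ℝ) (g : ℝ → ℂ) (s : ℝ) (j : Fin 2) :
    forcing (-a) (-β) ⟨fun y => starRingEnd ℂ (g y), []⟩ s j = starRingEnd ℂ (forcing a β ⟨g, []⟩ s j) := by
  have hsrc : ∀ y₀ : ℝ, (∫ y in (-(1 / 2 : ℝ))..(1 / 2), lineKernel (-a) (-β) (y₀ - y) * starRingEnd ℂ (g y) * transportPhase (-a) s y) =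
      starRingEnd ℂ (∫ y in (-(1 / 2 : ℝ))..(1 / 2), lineKernel a β (y₀ - y) * g y * transportPhase a s y) := by
    intro y₀
    rw [← intervalIntegral.intervalIntegral_conj]
    refine intervalIntegral.integral_congr fun y _ => ?_
    simp only [map_mul, conj_lineKernel, lineKernel_neg, transportPhase_neg']
  fin_cases j
  · simp only [forcing, List.map_nil, List.sum_nil, add_zero, Fin.zero_eta, Fin.isValue, Matrix.cons_val_zero, hsrc, map_mul, map_neg,
      map_ofNat, Complex.conj_ofReal, Complex.conj_I]
    push_cast; ring
  · simp only [forcing, List.map_nil, List.sum_nil, add_zero, Fin.mk_one, Fin.isValue, Matrix.cons_val_one, Matrix.cons_val_zero, hsrc, map_mul,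
      map_ofNat, Complex.conj_ofReal, Complex.conj_I]
    push_cast; ring

/-- The Duhamel integrand at `(−a, −β)` with conjugated interior is the componentwise conjugate (`a ≠ 0`). -/
theorem duhamelIntegrand_neg_neg_nosheet {a : ℝ} (ha : a ≠ 0) (β θ s : ℝ) (g : ℝ → ℂ) :
    (propagator (-a) (-β) (θ - s)).mulVec (forcing (-a) (-β) ⟨fun y => starRingEnd ℂ (g y), []⟩ s) =
      star ((propagator a β (θ - s)).mulVec (forcing a β ⟨g, []⟩ s)) := by
  funext i
  simp only [Matrix.mulVec, dotProduct, Fin.sum_univ_two, Pi.star_apply, propagator_neg_neg ha, forcing_neg_neg_nosheet, star_add, star_mul',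
    Complex.star_def]

/-- The conjugate of a mode profile is the mode profile of the reflected class with reflected, conjugated coefficients. -/
theorem conj_modeProfile (β : ℝ) (K : ℕ) (c : ℤ → ℂ) (y : ℝ) :
    starRingEnd ℂ (modeProfile β K c y) = modeProfile (-β) K (fun n => starRingEnd ℂ (c (-n))) y := by
  simp only [modeProfile, map_sum, map_mul]
  refine Finset.sum_nbij' (fun n => -n) (fun n => -n) (fun n hn => by simp only [win, Finset.mem_Icc] at hn ⊢; omega) (fun n hn => by simp only [win, Finset.mem_Icc] at hn ⊢; omega)
    (fun n _ => neg_neg n) (fun n _ => neg_neg n) (fun n _ => ?_)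
  rw [neg_neg, ← Complex.exp_conj, map_mul, Complex.conj_ofReal, Complex.conj_I]
  congr 1
  push_cast
  ring

/-- **P2-S for profile states (any Bloch phase):** `sheetAmps (−a) (−β) θ ⟨modeProfile (−β) K c̃, []⟩ i = conj (sheetAmps a β θ ⟨modeProfile β K c, []⟩ i)`
with `c̃ n = conj (c (−n))` (`a ≥ 1`). -/
theorem sheetAmps_neg_neg_modeProfile {a : ℝ} (ha : 1 ≤ a) (β θ : ℝ) (K : ℕ) (c : ℤ → ℂ) (i : Fin 2) :
    sheetAmps (-a) (-β) θ ⟨modeProfile (-β) K (fun n => starRingEnd ℂ (c (-n))), []⟩ i =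
      starRingEnd ℂ (sheetAmps a β θ ⟨modeProfile β K c, []⟩ i) := by
  have ha0 : a ≠ 0 := by linarith
  -- the integrand at `(a, β)` is a finite sum of single-mode integrands, hence continuous
  have hF : Continuous fun s : ℝ => (propagator a β (θ - s)).mulVec (forcing a β ⟨modeProfile β K c, []⟩ s) := by
    have e : (fun s : ℝ => (propagator a β (θ - s)).mulVec (forcing a β ⟨modeProfile β K c, []⟩ s)) =
        fun s : ℝ => ∑ n ∈ win K, c n • (propagator a β (θ - s)).mulVec (forcing a β (singleMode (β + n)) s) := by
      funext s
      rw [forcing_modeProfile (by linarith : (0 : ℝ) < a) β s K c, Matrix.mulVec_sum]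
      refine Finset.sum_congr rfl fun n _ => ?_
      rw [Matrix.mulVec_smul]
    rw [e]
    exact continuous_finsetSum _ fun n _ => (continuous_duhamelIntegrand_singleMode ha β (β + n) θ).const_smul (c n)
  -- the interior at `(−a, −β)` is the conjugated interior
  have hint_eq : (⟨modeProfile (-β) K (fun n => starRingEnd ℂ (c (-n))), []⟩ : LamState) = ⟨fun y => starRingEnd ℂ (modeProfile β K c y), []⟩ := by
    congr 1
    funext y
    rw [conj_modeProfile]
  rw [hint_eq]
  have e : (fun s : ℝ => (propagator (-a) (-β) (θ - s)).mulVec (forcing (-a) (-β) ⟨fun y => starRingEnd ℂ (modeProfile β K c y), []⟩ s)) =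
      fun s : ℝ => star ((propagator a β (θ - s)).mulVec (forcing a β ⟨modeProfile β K c, []⟩ s)) :=
    funext fun s => duhamelIntegrand_neg_neg_nosheet ha0 β θ s (modeProfile β K c)
  have hF' : Continuous fun s : ℝ => (propagator (-a) (-β) (θ - s)).mulVec (forcing (-a) (-β) ⟨fun y => starRingEnd ℂ (modeProfile β K c y), []⟩ s) := by
    rw [e]; exact continuous_star.comp hF
  have hint := hF.intervalIntegrable (μ := volume) 0 θ
  have hint' := hF'.intervalIntegrable (μ := volume) 0 θ
  have h1 := ((ContinuousLinearMap.proj (R := ℂ) (φ := fun _ : Fin 2 => ℂ) i).intervalIntegral_comp_comm hint).symm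
  have h2 := ((ContinuousLinearMap.proj (R := ℂ) (φ := fun _ : Fin 2 => ℂ) i).intervalIntegral_comp_comm hint').symm
  simp only [ContinuousLinearMap.proj_apply] at h1 h2
  unfold sheetAmps
  rw [h1, h2, ← intervalIntegral.intervalIntegral_conj]
  refine intervalIntegral.integral_congr fun s _ => ?_
  have := congrFun (duhamelIntegrand_neg_neg_nosheet ha0 β θ s (modeProfile β K c)) i
  simp only [Pi.star_apply, Complex.star_def] at this
  exact this

/-- **The profile creation law on NEGATIVE lines BY NAME:** for `a ≤ −4`, `0 ≤ θ ≤ 8`, any `β`, `K`, `c`: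
`‖sheetAmps a β θ ⟨modeProfile β K c, []⟩ i‖ ≤ (Σ_{|n| ≤ K} ‖c n‖)·0.889/|a|`. -/
theorem norm_sheetAmps_modeProfile_le_of_neg {a : ℝ} (ha : a ≤ -4) (β : ℝ) {θ : ℝ} (hθ0 : 0 ≤ θ) (hθ : θ ≤ 8) (K : ℕ) (c : ℤ → ℂ) (i : Fin 2) :
    ‖sheetAmps a β θ ⟨modeProfile β K c, []⟩ i‖ ≤ (∑ n ∈ win K, ‖c n‖) * (0.889 / |a|) := by
  have ha' : 4 ≤ -a := by linarith
  have ha1 : 1 ≤ -a := by linarith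
  -- write `(a, β, c)` as the reflection of `(−a, −β, c̃)`
  have hc : (fun n : ℤ => starRingEnd ℂ ((fun n : ℤ => starRingEnd ℂ (c (-n))) (-n))) = c := by
    funext n; simp
  have h := sheetAmps_neg_neg_modeProfile ha1 (-β) θ K (fun n => starRingEnd ℂ (c (-n))) i
  rw [neg_neg, neg_neg, hc] at h
  rw [h, Complex.norm_conj, abs_of_neg (by linarith)]
  refine (norm_sheetAmps_modeProfile_le ha' (-β) hθ0 hθ K (fun n => starRingEnd ℂ (c (-n))) i).trans (le_of_eq ?_)
  congr 1
  refine Finset.sum_nbij' (fun n => -n) (fun n => -n) (fun n hn => by simp only [win, Finset.mem_Icc] at hn ⊢; omega) (fun n hn => by simp only [win, Finset.mem_Icc] at hn ⊢; omega)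
    (fun n _ => neg_neg n) (fun n _ => neg_neg n) (fun n _ => ?_)
  rw [Complex.norm_conj]

/-- **Fresh H densities of a NEGATIVE row BY NAME** (`α + m ≤ −4`, `0 ≤ θ ≤ 8`). -/
theorem norm_hFresh_le_of_neg (α β : ℝ) {θ : ℝ} (hθ0 : 0 ≤ θ) (hθ : θ ≤ 8) (K : ℕ) (ζ : CState) {m : ℤ} (hm : m ∈ win K)
    (ha : α + (m : ℝ) ≤ -4) (i : Fin 2) :
    ‖hFresh α β θ K ζ m i‖ ≤ (∑ n ∈ win K, ‖ζ m n‖) * (0.889 / |α + m|) := by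
  simp only [hFresh, if_pos hm]
  exact norm_sheetAmps_modeProfile_le_of_neg ha β hθ0 hθ K (ζ m) i

/-- **Fresh H densities of every far row BY NAME** (`|α + m| ≥ 4`, `0 ≤ θ ≤ 8`): `‖hFresh α β θ K ζ m i‖ ≤ (Σ_n ‖ζ m n‖)·0.889/|α+m|`. -/
theorem norm_hFresh_le (α β : ℝ) {θ : ℝ} (hθ0 : 0 ≤ θ) (hθ : θ ≤ 8) (K : ℕ) (ζ : CState) {m : ℤ} (hm : m ∈ win K)
    (ha : 4 ≤ |α + (m : ℝ)|) (i : Fin 2) :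
    ‖hFresh α β θ K ζ m i‖ ≤ (∑ n ∈ win K, ‖ζ m n‖) * (0.889 / |α + m|) := by
  rcases le_or_gt 0 (α + (m : ℝ)) with h | h
  · rw [abs_of_nonneg h] at ha ⊢
    exact norm_hFresh_le_of_pos α β hθ0 hθ K ζ hm ha i
  · have : α + (m : ℝ) ≤ -4 := by rw [abs_of_neg h] at ha; linarith
    exact norm_hFresh_le_of_neg α β hθ0 hθ K ζ hm this i

/-! ## §18 (v11) THE FIRST FAR ENTRY BY NAME: `Transfer α β 8 K V s H s′ M` with `M² = C·4^s/4^{s′}` — K-uniform (K + 1 ≥ 2^{s+2}), flat along every diagonal -/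

/-- The child of the V-source input state, entrywise. -/
theorem norm_child_inputState_V_le (α β θ : ℝ) (K : ℕ) (d : ℤ → Fin 2 → ℂ) (pm pn m n : ℤ) :
    ‖child pm pn (inputState α β θ K PType.V d) m n‖ ≤ ‖d (2 * n + pn) 0‖ + ‖d (2 * n + pn) 1‖ := by
  simp only [child, inputState, truncW, vPairState]
  split_ifs with h
  · refine (norm_add_le _ _).trans (le_of_eq ?_)
    rw [norm_mul, norm_mul, Complex.norm_exp_ofReal_mul_I, mul_one,
      show -((Real.pi * (α + ((2 * m + pm : ℤ) : ℝ)) / 2 : ℝ) : ℂ) * Complex.I = ((-(Real.pi * (α + ((2 * m + pm : ℤ) : ℝ)) / 2) : ℝ) : ℂ) * Complex.I by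
        push_cast; ring, Complex.norm_exp_ofReal_mul_I, mul_one]
  · simp only [norm_zero]; positivity

/-- The `ℓ¹` size of one row of the child is at most the `ℓ¹` size of the source densities (which vanish off the window). -/
theorem sum_norm_child_inputState_V_le (α β θ : ℝ) (K : ℕ) (d : ℤ → Fin 2 → ℂ) (hdW : ∀ k : ℤ, k ∉ win K → d k = 0) (pm pn m : ℤ) :
    ∑ n ∈ win K, ‖child pm pn (inputState α β θ K PType.V d) m n‖ ≤ ∑ k ∈ win K, (‖d k 0‖ + ‖d k 1‖) := by
  refine (Finset.sum_le_sum fun n _ => norm_child_inputState_V_le α β θ K d pm pn m n).trans ?_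
  -- reindex `k = 2n + pn` over the `n` with `2n + pn ∈ win K`; the other terms vanish
  have hz : ∀ n ∈ win K, 2 * n + pn ∉ win K → ‖d (2 * n + pn) 0‖ + ‖d (2 * n + pn) 1‖ = 0 := by
    intro n _ hn; simp [hdW _ hn]
  rw [← Finset.sum_filter_add_sum_filter_not (win K) (fun n : ℤ => 2 * n + pn ∈ win K)]
  rw [Finset.sum_eq_zero (s := (win K).filter fun n : ℤ => ¬ 2 * n + pn ∈ win K) (fun n hn => hz n (Finset.mem_filter.1 hn).1 (Finset.mem_filter.1 hn).2),
    add_zero]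
  rw [← Finset.sum_image (s := (win K).filter fun n : ℤ => 2 * n + pn ∈ win K) (g := fun n : ℤ => 2 * n + pn)
    (f := fun k : ℤ => ‖d k 0‖ + ‖d k 1‖) (fun x _ y _ h => by simpa using h)]
  refine Finset.sum_le_sum_of_subset_of_nonneg ?_ (fun k _ _ => by positivity)
  intro k hk
  obtain ⟨n, hn, rfl⟩ := Finset.mem_image.1 hk
  exact (Finset.mem_filter.1 hn).2

/-- Counting the rows of a shell inside any finite set: at most `2·2^{s} + 1`. -/
theorem card_filter_inShell_le (c : ℝ) (s : ℕ) (hs : 2 ≤ s) (S : Finset ℤ) :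
    (((S.filter fun m : ℤ => shellLo s ≤ |c + (m : ℝ)| ∧ |c + (m : ℝ)| < shellHi s).card : ℕ) : ℝ) ≤ 2 * 2 ^ s + 1 := by
  have hsub : (S.filter fun m : ℤ => shellLo s ≤ |c + (m : ℝ)| ∧ |c + (m : ℝ)| < shellHi s) ⊆ S.filter fun m : ℤ => |c + m| ≤ (2 : ℝ) ^ s := by
    intro m hm
    rw [Finset.mem_filter] at hm ⊢
    refine ⟨hm.1, ?_⟩
    have h2 := hm.2.2
    obtain ⟨k, rfl⟩ : ∃ k, s = k + 2 := ⟨s - 2, by omega⟩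
    simp only [shellHi, shellLo] at h2
    rw [show k + 2 = (k + 1) + 1 by ring]
    exact h2.le
  calc (((S.filter fun m : ℤ => shellLo s ≤ |c + (m : ℝ)| ∧ |c + (m : ℝ)| < shellHi s).card : ℕ) : ℝ)
      ≤ (((S.filter fun m : ℤ => |c + m| ≤ (2 : ℝ) ^ s).card : ℕ) : ℝ) := by exact_mod_cast Finset.card_le_card hsub
    _ ≤ 2 * 2 ^ s + 1 := card_filter_abs_le c (by positivity) S

/-- **Output side of the far entry, one child:** for a child class `(α′, β′)` with `β′ ∈ [0,1]`, a target shell `s′ ≥ 3`, any window and any state `ζ`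
whose rows have `ℓ¹` size at most `L`: the level-1 energy of the V-transported fresh H pair of shell `s′` is at most
`66·(2·2^{s′}+1)·1.6·(π+1)·L²/(16π²·2^{3(s′−1)})`. -/
theorem outEnergy_H_child_le {β' : ℝ} (hβ0 : 0 ≤ β') (hβ1 : β' ≤ 1) (α' : ℝ) (K : ℕ) {s' : ℕ} (hs' : 3 ≤ s') (ζ : CState) {L : ℝ}
    (hL : ∀ m ∈ win K, ∑ n ∈ win K, ‖ζ m n‖ ≤ L) :
    outEnergy α' β' 8 K s' (phasePieces α' β' 8 K ζ) PType.H ≤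
      66 * ((1 / (4 * Real.pi ^ 2 * (4 : ℝ) ^ (1 : ℕ))) * ((2 * 2 ^ s' + 1) * (1.6 * (Real.pi + 1) * L ^ 2 / (2 : ℝ) ^ (3 * (s' - 1))))) := by
  have h1 : outEnergy α' β' 8 K s' (phasePieces α' β' 8 K ζ) PType.H ≤
      ((8 : ℝ) ^ 2 + 2) * cEnergy α' β' 1 K (hPairState β' (restrictShell s' α' (phasePieces α' β' 8 K ζ).freshH)) :=
    outEnergyAt_H_le α' β' 8 K 1 s' _
  rw [show ((8 : ℝ) ^ 2 + 2) = 66 by norm_num] at h1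
  refine h1.trans (mul_le_mul_of_nonneg_left ?_ (by norm_num))
  have hfresh : (phasePieces α' β' 8 K ζ).freshH = hFresh α' β' 8 K ζ := rfl
  rw [hfresh]
  set q : ℤ → Fin 2 → ℂ := restrictShell s' α' (hFresh α' β' 8 K ζ) with hq
  -- rows off the shell (in particular the zero line) carry nothing
  obtain ⟨k, rfl⟩ : ∃ k, s' = k + 3 := ⟨s' - 3, by omega⟩
  have hA : (4 : ℝ) ≤ 2 ^ (k + 2) := by
    calc (4 : ℝ) = 2 ^ 2 := by norm_num
      _ ≤ 2 ^ (k + 2) := pow_le_pow_right₀ (by norm_num) (by omega)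
  have hq0 : ∀ m : ℤ, ¬ (shellLo (k + 3) ≤ |α' + (m : ℝ)| ∧ |α' + (m : ℝ)| < shellHi (k + 3)) → q m = 0 := by
    intro m hm; simp only [hq, restrictShell]; rw [if_neg hm]
  have hqz : ∀ m ∈ win K, α' + (m : ℝ) = 0 → q m = 0 := by
    intro m _ hm
    apply hq0
    intro h
    have := h.1
    simp only [shellLo, hm, abs_zero] at this
    linarith [pow_pos (by norm_num : (0 : ℝ) < 2) (k + 1 + 1)]
  refine (cEnergy_hPairState_le hβ0 hβ1 α' 1 K q hqz).trans (mul_le_mul_of_nonneg_left ?_ (by positivity))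
  -- per-row bound
  have hrow : ∀ m ∈ win K, (‖q m 0‖ ^ 2 + ‖q m 1‖ ^ 2) * (Real.pi / |α' + m| + 4 / (α' + m) ^ 2) ≤
      if (shellLo (k + 3) ≤ |α' + (m : ℝ)| ∧ |α' + (m : ℝ)| < shellHi (k + 3)) then 1.6 * (Real.pi + 1) * L ^ 2 / (2 : ℝ) ^ (3 * (k + 3 - 1)) else 0 := by
    intro m hm
    split_ifs with hin
    · have hlo : (2 : ℝ) ^ (k + 2) ≤ |α' + m| := hin.1
      have ha4 : 4 ≤ |α' + (m : ℝ)| := hA.trans hlo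
      have hapos : 0 < |α' + (m : ℝ)| := by linarith
      have hqm : ∀ i : Fin 2, ‖q m i‖ ≤ L * (0.889 / |α' + m|) := by
        intro i
        have e : q m = hFresh α' β' 8 K ζ m := by simp only [hq, restrictShell, if_pos (And.intro hin.1 hin.2)]
        rw [e]
        refine (norm_hFresh_le α' β' (by norm_num) le_rfl K ζ hm ha4 i).trans ?_
        exact mul_le_mul_of_nonneg_right (hL m hm) (by positivity)
      have hsq : ‖q m 0‖ ^ 2 + ‖q m 1‖ ^ 2 ≤ 2 * (L * (0.889 / |α' + m|)) ^ 2 := by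
        nlinarith [hqm 0, hqm 1, norm_nonneg (q m 0), norm_nonneg (q m 1)]
      have hw : Real.pi / |α' + m| + 4 / (α' + (m : ℝ)) ^ 2 ≤ (Real.pi + 1) / |α' + m| := by
        rw [add_div]
        refine add_le_add le_rfl ?_
        rw [← sq_abs, div_le_div_iff₀ (by positivity) hapos]
        nlinarith
      have h3 : (2 : ℝ) ^ (3 * (k + 3 - 1)) = (2 ^ (k + 2)) ^ 3 := by
        rw [← pow_mul]; congr 1; omega
      calc (‖q m 0‖ ^ 2 + ‖q m 1‖ ^ 2) * (Real.pi / |α' + m| + 4 / (α' + m) ^ 2)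
          ≤ (2 * (L * (0.889 / |α' + m|)) ^ 2) * ((Real.pi + 1) / |α' + m|) :=
            mul_le_mul hsq hw (by positivity) (by positivity)
        _ = 2 * 0.889 ^ 2 * (Real.pi + 1) * L ^ 2 / |α' + m| ^ 3 := by
            field_simp
        _ ≤ 1.6 * (Real.pi + 1) * L ^ 2 / |α' + m| ^ 3 := by
            refine div_le_div_of_nonneg_right ?_ (by positivity)
            nlinarith [sq_nonneg L, Real.pi_pos]
        _ ≤ 1.6 * (Real.pi + 1) * L ^ 2 / (2 : ℝ) ^ (3 * (k + 3 - 1)) := by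
            rw [h3]
            exact div_le_div_of_nonneg_left (by positivity) (by positivity) (pow_le_pow_left₀ (by positivity) hlo 3)
    · have : q m = 0 := hq0 m hin
      simp [this]
  refine (Finset.sum_le_sum hrow).trans ?_
  rw [Finset.sum_ite, Finset.sum_const_zero, add_zero, Finset.sum_const, nsmul_eq_mul]
  refine mul_le_mul_of_nonneg_right ?_ (by positivity)
  have := card_filter_inShell_le α' (k + 3) (by omega) (win K)
  exact this

/-- `ℓ¹ ≤ √(support)·ℓ²` for the source densities of a shell: `(Σ_k (‖d k 0‖+‖d k 1‖))² ≤ (2·2^s+1)·2·Σ_k (‖d k 0‖²+‖d k 1‖²)`. -/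
theorem l1_sq_le_of_supportedIn (β : ℝ) (K : ℕ) {s : ℕ} (hs : 2 ≤ s) (d : ℤ → Fin 2 → ℂ) (hd : SupportedIn s β d) :
    (∑ k ∈ win K, (‖d k 0‖ + ‖d k 1‖)) ^ 2 ≤ (2 * 2 ^ s + 1) * (2 * ∑ k ∈ win K, (‖d k 0‖ ^ 2 + ‖d k 1‖ ^ 2)) := by
  set T := (win K).filter fun k : ℤ => shellLo s ≤ |β + (k : ℝ)| ∧ |β + (k : ℝ)| < shellHi s with hT
  have hz : ∀ k ∈ win K, k ∉ T → d k = 0 := by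
    intro k hk hkT
    apply hd k
    intro h
    exact hkT (Finset.mem_filter.2 ⟨hk, h.1, h.2⟩)
  have e1 : ∑ k ∈ win K, (‖d k 0‖ + ‖d k 1‖) = ∑ k ∈ T, (‖d k 0‖ + ‖d k 1‖) := by
    rw [hT, Finset.sum_filter]
    refine Finset.sum_congr rfl fun k hk => ?_
    split_ifs with h
    · rfl
    · have : d k = 0 := hz k hk (by rw [hT, Finset.mem_filter]; exact fun h' => h h'.2)
      simp [this]
  have e2 : ∑ k ∈ T, (‖d k 0‖ + ‖d k 1‖) ^ 2 ≤ 2 * ∑ k ∈ win K, (‖d k 0‖ ^ 2 + ‖d k 1‖ ^ 2) := by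
    rw [Finset.mul_sum]
    refine (Finset.sum_le_sum_of_subset_of_nonneg (Finset.filter_subset _ _) fun k _ _ => by positivity).trans ?_
    refine Finset.sum_le_sum fun k _ => ?_
    nlinarith [sq_nonneg (‖d k 0‖ - ‖d k 1‖)]
  have hcs := Finset.sum_mul_sq_le_sq_mul_sq T (fun _ => (1 : ℝ)) (fun k => ‖d k 0‖ + ‖d k 1‖)
  simp only [one_mul, one_pow, Finset.sum_const, nsmul_eq_mul, mul_one] at hcs
  have hcard : ((T.card : ℕ) : ℝ) ≤ 2 * 2 ^ s + 1 := card_filter_inShell_le β s hs (win K)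
  rw [e1]
  refine hcs.trans ?_
  have h0 : 0 ≤ ∑ k ∈ T, (‖d k 0‖ + ‖d k 1‖) ^ 2 := Finset.sum_nonneg fun _ _ => by positivity
  calc (T.card : ℝ) * ∑ k ∈ T, (‖d k 0‖ + ‖d k 1‖) ^ 2 ≤ (2 * 2 ^ s + 1) * ∑ k ∈ T, (‖d k 0‖ + ‖d k 1‖) ^ 2 :=
        mul_le_mul_of_nonneg_right hcard h0
    _ ≤ (2 * 2 ^ s + 1) * (2 * ∑ k ∈ win K, (‖d k 0‖ ^ 2 + ‖d k 1‖ ^ 2)) := mul_le_mul_of_nonneg_left e2 (by positivity)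

/-- Numerical heart of the far entry: `422.4(π+1)(2Y+1)(2X+1)/(π²Y³) ≤ 16000X/(π²Y²)` for `X ≥ 32`, `Y ≥ 8`. -/
theorem far_entry_numeric {X Y : ℝ} (hX : 32 ≤ X) (hY : 8 ≤ Y) :
    422.4 * (Real.pi + 1) * (2 * Y + 1) * (2 * X + 1) / (Real.pi ^ 2 * Y ^ 3) ≤ 16000 * X / (Real.pi ^ 2 * Y ^ 2) := by
  have hXpos : 0 < X := by linarith
  have hYpos : 0 < Y := by linarith
  have hXY : 0 < X * Y := mul_pos hXpos hYpos
  have hπ4 : Real.pi < 3.15 := Real.pi_lt_d2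
  have hP : (2 * Y + 1) * (2 * X + 1) ≤ 9 / 2 * (X * Y) := by
    nlinarith [mul_nonneg (sub_nonneg.2 hX) (sub_nonneg.2 hY)]
  have hP0 : 0 ≤ (2 * Y + 1) * (2 * X + 1) := by positivity
  have h1 : Real.pi + 1 ≤ 83 / 20 := by linarith
  have key : 422.4 * (Real.pi + 1) * (2 * Y + 1) * (2 * X + 1) ≤ 16000 * X * Y := by
    have h2 : (Real.pi + 1) * ((2 * Y + 1) * (2 * X + 1)) ≤ (83 / 20) * (9 / 2 * (X * Y)) :=
      mul_le_mul h1 hP hP0 (by norm_num)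
    have h3 : 422.4 * ((Real.pi + 1) * ((2 * Y + 1) * (2 * X + 1))) ≤ 422.4 * ((83 / 20) * (9 / 2 * (X * Y))) :=
      mul_le_mul_of_nonneg_left h2 (by norm_num)
    have h4 : 422.4 * ((83 / 20) * (9 / 2 * (X * Y))) ≤ 16000 * (X * Y) := by
      rw [show 422.4 * ((83 / 20) * (9 / 2 * (X * Y))) = (422.4 * (83 / 20) * (9 / 2)) * (X * Y) by ring]
      exact mul_le_mul_of_nonneg_right (by norm_num) hXY.le
    calc 422.4 * (Real.pi + 1) * (2 * Y + 1) * (2 * X + 1) = 422.4 * ((Real.pi + 1) * ((2 * Y + 1) * (2 * X + 1))) := by ring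
      _ ≤ 16000 * (X * Y) := h3.trans h4
      _ = 16000 * X * Y := by ring
  rw [div_le_div_iff₀ (by positivity) (by positivity)]
  calc 422.4 * (Real.pi + 1) * (2 * Y + 1) * (2 * X + 1) * (Real.pi ^ 2 * Y ^ 2)
      ≤ 16000 * X * Y * (Real.pi ^ 2 * Y ^ 2) := mul_le_mul_of_nonneg_right key (by positivity)
    _ = 16000 * X * (Real.pi ^ 2 * Y ^ 3) := by ring

/-- The input-energy coefficient in the far regime: `2/2^s ≤ π/2^s − 2/(K+1) − 4/4^{s−1}` for `s ≥ 5`, `K + 1 ≥ 2^{s+2}`. -/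
theorem input_coef_lower {s : ℕ} (hs : 5 ≤ s) {K : ℕ} (hK : (2 : ℝ) ^ (s + 2) ≤ K + 1) :
    2 / (2 : ℝ) ^ s ≤ Real.pi / 2 ^ s - 2 / ((K : ℝ) + 1) - 4 / 4 ^ (s - 1) := by
  set X : ℝ := (2 : ℝ) ^ s with hX
  have hX32 : 32 ≤ X := by
    rw [hX]; calc (32 : ℝ) = 2 ^ 5 := by norm_num
      _ ≤ 2 ^ s := pow_le_pow_right₀ (by norm_num) hs
  have hXpos : 0 < X := by linarith
  have h4 : (4 : ℝ) / 4 ^ (s - 1) = 16 / X ^ 2 := by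
    obtain ⟨j, rfl⟩ : ∃ j, s = j + 1 := ⟨s - 1, by omega⟩
    rw [show j + 1 - 1 = j by omega]
    have h' : (4 : ℝ) ^ j * 4 = X ^ 2 := by
      rw [hX, ← pow_succ, ← pow_mul, show (4 : ℝ) = 2 ^ 2 by norm_num, ← pow_mul]; ring_nf
    rw [← h']
    field_simp
    ring
  have hK' : 2 / ((K : ℝ) + 1) ≤ 1 / (2 * X) := by
    rw [div_le_div_iff₀ (by positivity) (by positivity)]
    have : (2 : ℝ) ^ (s + 2) = 4 * X := by rw [hX, pow_add]; ring
    nlinarith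
  have hx16 : 16 / X ^ 2 ≤ 1 / (2 * X) := by
    rw [div_le_div_iff₀ (by positivity) (by positivity)]
    nlinarith
  have hpi : 0 ≤ Real.pi / X - 1 / (2 * X) - 1 / (2 * X) - 2 / X := by
    rw [show Real.pi / X - 1 / (2 * X) - 1 / (2 * X) - 2 / X = (Real.pi - 3) / X by ring]
    exact div_nonneg (by linarith [Real.pi_gt_three]) hXpos.le
  rw [h4]
  linarith

/-- **THE FIRST FAR ENTRY BY NAME (E6, A27-7/A27-9 (1)(ii): the V→H creation block is K-UNIFORM and FLAT along every diagonal).** For every parent class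
`(α, β) ∈ [0,1)²`, every source shell `s ≥ 5`, every target shell `s′ ≥ 3` and every truncation with `K + 1 ≥ 2^{s+2}`:
`Transfer α β 8 K V s H s′ √(32000·4^s/4^{s′})`, i.e. every V pair of shell `s` produces, summed over the four children and after their phase, an output
H piece `(H, s′)` of level-1 energy `≤ 32000·4^{s−s′}` × its own level-0 energy — a bound that depends on `(s, s′)` ONLY THROUGH THE LAG `s − s′` and not
on `K` (the constant is lossy: transport ×66 by duality where 2.6 is measured, Cauchy–Schwarz over the source columns; the cone's numbers are the
certified engine's, A27-9). Ingredients, all by name above: §14 (input energy ≥), §15 (transport ≤ 66×), §16 (straight H-pair energy), §8/§17 (creation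
law `0.889/|a|` on every line `|a| ≥ 4`, both signs), §18 (children bookkeeping). -/
theorem transfer_V_H_far {α β : ℝ} (hα0 : 0 ≤ α) (hα1 : α < 1) (hβ0 : 0 ≤ β) (hβ1 : β < 1) {s s' : ℕ} (hs : 5 ≤ s) (hs' : 3 ≤ s')
    (K : ℕ) (hK : (2 : ℝ) ^ (s + 2) ≤ K + 1) :
    Transfer α β 8 K PType.V s PType.H s' (Real.sqrt (32000 * 4 ^ s / 4 ^ s')) := by
  intro d hd
  have hdS : SupportedIn s β d := hd.1
  have hdW : ∀ k : ℤ, k ∉ win K → d k = 0 := hd.2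
  set D₁ : ℝ := ∑ k ∈ win K, (‖d k 0‖ + ‖d k 1‖) with hD₁
  set D₂ : ℝ := ∑ k ∈ win K, (‖d k 0‖ ^ 2 + ‖d k 1‖ ^ 2) with hD₂
  have hD₂0 : 0 ≤ D₂ := Finset.sum_nonneg fun _ _ => by positivity
  set X : ℝ := (2 : ℝ) ^ s with hX
  set Y : ℝ := (2 : ℝ) ^ s' with hY
  have hX32 : 32 ≤ X := by
    rw [hX]; calc (32 : ℝ) = 2 ^ 5 := by norm_num
      _ ≤ 2 ^ s := pow_le_pow_right₀ (by norm_num) hs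
  have hY8 : 8 ≤ Y := by
    rw [hY]; calc (8 : ℝ) = 2 ^ 3 := by norm_num
      _ ≤ 2 ^ s' := pow_le_pow_right₀ (by norm_num) hs'
  have h4s : (4 : ℝ) ^ s = X ^ 2 := by rw [hX, ← pow_mul, show (4 : ℝ) = 2 ^ 2 by norm_num, ← pow_mul]; ring_nf
  have h4s' : (4 : ℝ) ^ s' = Y ^ 2 := by rw [hY, ← pow_mul, show (4 : ℝ) = 2 ^ 2 by norm_num, ← pow_mul]; ring_nf
  have hY3 : (2 : ℝ) ^ (3 * (s' - 1)) * 8 = Y ^ 3 := by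
    rw [hY, ← pow_mul, show (8 : ℝ) = 2 ^ 3 by norm_num, ← pow_add]; congr 1; omega
  -- (1) the four children
  have hchild : ∀ pm ∈ parities, ∀ pn ∈ parities,
      outEnergy ((α + pm) / 2) ((β + pn) / 2) 8 K s' (phasePieces ((α + pm) / 2) ((β + pn) / 2) 8 K (child pm pn (inputState α β 8 K PType.V d))) PType.H ≤
        66 * ((1 / (4 * Real.pi ^ 2 * (4 : ℝ) ^ (1 : ℕ))) * ((2 * 2 ^ s' + 1) * (1.6 * (Real.pi + 1) * D₁ ^ 2 / (2 : ℝ) ^ (3 * (s' - 1))))) := by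
    intro pm hpm pn hpn
    have hpn' : (pn : ℝ) = 0 ∨ (pn : ℝ) = 1 := by
      simp only [parities, Finset.mem_insert, Finset.mem_singleton] at hpn
      rcases hpn with h | h <;> simp [h]
    have hb0 : 0 ≤ (β + (pn : ℝ)) / 2 := by rcases hpn' with h | h <;> rw [h] <;> linarith
    have hb1 : (β + (pn : ℝ)) / 2 ≤ 1 := by rcases hpn' with h | h <;> rw [h] <;> linarith
    exact outEnergy_H_child_le hb0 hb1 ((α + pm) / 2) K hs' _ (fun m _ => sum_norm_child_inputState_V_le α β 8 K d hdW pm pn m)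
  have hsum : (∑ pm ∈ parities, ∑ pn ∈ parities,
      outEnergy ((α + pm) / 2) ((β + pn) / 2) 8 K s' (phasePieces ((α + pm) / 2) ((β + pn) / 2) 8 K (child pm pn (inputState α β 8 K PType.V d))) PType.H) ≤
        4 * (66 * ((1 / (4 * Real.pi ^ 2 * (4 : ℝ) ^ (1 : ℕ))) * ((2 * 2 ^ s' + 1) * (1.6 * (Real.pi + 1) * D₁ ^ 2 / (2 : ℝ) ^ (3 * (s' - 1)))))) := by
    refine (Finset.sum_le_sum fun pm hpm => Finset.sum_le_sum fun pn hpn => hchild pm hpm pn hpn).trans (le_of_eq ?_)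
    rw [show parities = ({0, 1} : Finset ℤ) from rfl, Finset.sum_pair (by norm_num), Finset.sum_pair (by norm_num)]
    ring
  -- (2) the input energy
  have hden := cEnergy_inputState_V_shell_lower hα0 hα1.le β 8 K (by omega : 2 ≤ s) d hdS
  have hcoef : 2 / X ≤ Real.pi / 2 ^ s - 2 / ((K : ℝ) + 1) - 4 / 4 ^ (s - 1) := by
    rw [hX]; exact input_coef_lower hs hK
  have hden' : (2 / X) * D₂ / (4 * Real.pi ^ 2) ≤ cEnergy α β 0 K (inputState α β 8 K PType.V d) := by
    refine le_trans ?_ hden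
    refine div_le_div_of_nonneg_right (mul_le_mul_of_nonneg_right hcoef hD₂0) (by positivity)
  -- (3) Cauchy–Schwarz over the source columns
  have hD1 : D₁ ^ 2 ≤ (2 * X + 1) * (2 * D₂) := by rw [hX]; exact l1_sq_le_of_supportedIn β K (by omega) d hdS
  -- (4) assemble
  refine hsum.trans ?_
  rw [Real.sq_sqrt (by positivity), h4s, h4s']
  have hπ3 := Real.pi_gt_three
  have hπ4 : Real.pi < 3.15 := Real.pi_lt_d2
  have hXpos : 0 < X := by linarith
  have hYpos : 0 < Y := by linarith
  -- rewrite both sides as (coefficient) · D₂ and compare coefficients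
  have e3 : 4 * (66 * ((1 / (4 * Real.pi ^ 2 * (4 : ℝ) ^ (1 : ℕ))) * ((2 * 2 ^ s' + 1) * (1.6 * (Real.pi + 1) * D₁ ^ 2 / (2 : ℝ) ^ (3 * (s' - 1)))))) =
      (422.4 * (Real.pi + 1) * (2 * Y + 1) / (16 * Real.pi ^ 2 * Y ^ 3)) * (8 * D₁ ^ 2) := by
    rw [← hY, show (2 : ℝ) ^ (3 * (s' - 1)) = Y ^ 3 / 8 by rw [← hY3]; ring]
    field_simp
    ring
  rw [e3]
  have hc : 0 ≤ 422.4 * (Real.pi + 1) * (2 * Y + 1) / (16 * Real.pi ^ 2 * Y ^ 3) := by positivity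
  have step : (422.4 * (Real.pi + 1) * (2 * Y + 1) / (16 * Real.pi ^ 2 * Y ^ 3)) * (8 * D₁ ^ 2) ≤
      (422.4 * (Real.pi + 1) * (2 * Y + 1) / (16 * Real.pi ^ 2 * Y ^ 3)) * (8 * ((2 * X + 1) * (2 * D₂))) :=
    mul_le_mul_of_nonneg_left (by linarith [hD1]) hc
  refine step.trans ?_
  refine le_trans ?_ (mul_le_mul_of_nonneg_left hden' (by positivity))
  have eL : (422.4 * (Real.pi + 1) * (2 * Y + 1) / (16 * Real.pi ^ 2 * Y ^ 3)) * (8 * ((2 * X + 1) * (2 * D₂))) =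
      (422.4 * (Real.pi + 1) * (2 * Y + 1) * (2 * X + 1) / (Real.pi ^ 2 * Y ^ 3)) * D₂ := by
    field_simp
    ring
  have eR : 32000 * X ^ 2 / Y ^ 2 * (2 / X * D₂ / (4 * Real.pi ^ 2)) = (16000 * X / (Real.pi ^ 2 * Y ^ 2)) * D₂ := by
    field_simp
    ring
  rw [eL, eR]
  refine mul_le_mul_of_nonneg_right ?_ hD₂0
  exact far_entry_numeric hX32 hY8


/-! ## §18¾ FARM-LAG SHIM (v12′): primed verbatim copies of the FIVE lemmas of tree `…KHModeTail` (p704708 + APPEND p710951) — this file does not import `…KHModeTail` until the farm has rebuilt it; delete the shim and re-import then -/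


open Set MeasureTheory intervalIntegral Literature.Analysis.FluidPDE.SawtoothCascade

/-- **The far window bound:** for `0 ≤ θ ≤ u`, `arsinh(u+θ) − arsinh(u−θ) ≤ 2θ/√(1+(u−θ)²)` (the window sits to the right of `0`, where `arsinh` is
concave with slope `≤ 1/√(1+(u−θ)²)`). [folklore]
(FARM-LAG SHIM: primed verbatim copy of the tree lemma of the same unprimed name in `…KHModeTail` (p704708 + p710951, commit 3e55381f77ff); the crux file does not import that module while the farm's olean of it is stale.) -/
theorem arsinh_window_le_far' {θ u : ℝ} (hθ : 0 ≤ θ) (hu : θ ≤ u) :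
    Real.arsinh (u + θ) - Real.arsinh (u - θ) ≤ 2 * θ / Real.sqrt (1 + (u - θ) ^ 2) := by
  have hx0 : 0 ≤ u - θ := by linarith
  have hbound : ∀ x ∈ interior (Set.Ici (u - θ)), deriv Real.arsinh x ≤ (Real.sqrt (1 + (u - θ) ^ 2))⁻¹ := by
    intro x hx
    rw [interior_Ici] at hx
    rw [(Real.hasDerivAt_arsinh x).deriv]
    have hx' : u - θ < x := hx
    have hle : Real.sqrt (1 + (u - θ) ^ 2) ≤ Real.sqrt (1 + x ^ 2) := Real.sqrt_le_sqrt (by nlinarith)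
    exact inv_anti₀ (Real.sqrt_pos.2 (by positivity)) hle
  have h := (convex_Ici (u - θ)).image_sub_le_mul_sub_of_deriv_le Real.continuous_arsinh.continuousOn
    (Real.differentiable_arsinh.differentiableOn) hbound (u - θ) (Set.mem_Ici.2 le_rfl) (u + θ) (Set.mem_Ici.2 (by linarith)) (by linarith)
  rw [show u + θ - (u - θ) = 2 * θ by ring] at h
  rw [div_eq_mul_inv, mul_comm]
  linarith

/-- **Non-resonant tail of the mode factor:** for `a ≥ 4`, `0 ≤ θ ≤ 8`, `u = ξ/a ≥ θ`:
`4πa(a·p+2a‖S‖)/ω · (N₊I₊ + N₋I₋)/((1−q)2κ·κ) ≤ 2.57/(a·√(1+(ξ/a−θ)²))`. [folklore]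
(FARM-LAG SHIM: primed verbatim copy of the tree lemma of the same unprimed name in `…KHModeTail` (p704708 + p710951, commit 3e55381f77ff); the crux file does not import that module while the farm's olean of it is stale.) -/
theorem mode_factor_far_le' {a : ℝ} (ha : 4 ≤ a) (β ξ : ℝ) {θ : ℝ} (hθ0 : 0 ≤ θ) (hθ : θ ≤ 8) (hu : θ ≤ ξ / a) :
    4 * Real.pi * a * (a * (Real.pi / 2 + 2 * sawSigma0 a β) + 2 * a * ‖sawS a β‖) / (a * Real.sqrt (max 0 (sawC2 a β))) *
        (((1 + 2 * Real.exp (-(2 * Real.pi * a) / 4) + 2 * Real.exp (-(2 * Real.pi * a) / 4) ^ 2 + 2 * Real.exp (-(2 * Real.pi * a) / 4) ^ 3 +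
            Real.exp (-(2 * Real.pi * a) / 4) ^ 4) * (Real.arsinh (ξ / a + θ) - Real.arsinh (ξ / a)) +
          (1 + 2 * Real.exp (-(2 * Real.pi * a) / 4) ^ 2 + Real.exp (-(2 * Real.pi * a) / 4) ^ 4) * (Real.arsinh (ξ / a) - Real.arsinh (ξ / a - θ))) /
          (((1 - Real.exp (-(2 * Real.pi * a))) * (2 * (2 * Real.pi * a))) * (2 * Real.pi * a))) ≤
      2.57 / (a * Real.sqrt (1 + (ξ / a - θ) ^ 2)) := by
  have ha1 : 1 ≤ a := by linarith
  have ha0 : 0 < a := by linarith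
  have hπ : (3.1415 : ℝ) < Real.pi := Real.pi_gt_d4
  have hR : (a * (Real.pi / 2 + 2 * sawSigma0 a β) + 2 * a * ‖sawS a β‖) / (a * Real.sqrt (max 0 (sawC2 a β))) ≤ 1.00002 :=
    (comb_ratio_le ha1 β).trans (by linarith [comb_ratio_defect_le ha β])
  have hR0 : 0 ≤ (a * (Real.pi / 2 + 2 * sawSigma0 a β) + 2 * a * ‖sawS a β‖) / (a * Real.sqrt (max 0 (sawC2 a β))) := by
    have := kh_p_ge ha1 β; positivity
  have hx := exp_neg_quarter_kappa_le ha
  have hx0 : 0 ≤ Real.exp (-(2 * Real.pi * a) / 4) := (Real.exp_pos _).le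
  have hq : Real.exp (-(2 * Real.pi * a)) ≤ (1 / 400) ^ 4 := exp_neg_kappa_le_pow ha
  have hq0 : 0 < Real.exp (-(2 * Real.pi * a)) := Real.exp_pos _
  set x := Real.exp (-(2 * Real.pi * a) / 4) with hxdef
  set q := Real.exp (-(2 * Real.pi * a)) with hqdef
  set u := ξ / a with hudef
  set R := (a * (Real.pi / 2 + 2 * sawSigma0 a β) + 2 * a * ‖sawS a β‖) / (a * Real.sqrt (max 0 (sawC2 a β))) with hR_def
  set W := Real.sqrt (1 + (u - θ) ^ 2) with hW
  have hW0 : 0 < W := Real.sqrt_pos.2 (by positivity)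
  -- the envelope factor: `N₋ ≤ N₊`, `I₊, I₋ ≥ 0`, `I₊ + I₋ ≤ 2θ/W`
  have hIp : 0 ≤ Real.arsinh (u + θ) - Real.arsinh u := by
    have := Real.arsinh_le_arsinh.2 (show u ≤ u + θ by linarith); linarith
  have hIm : 0 ≤ Real.arsinh u - Real.arsinh (u - θ) := by
    have := Real.arsinh_le_arsinh.2 (show u - θ ≤ u by linarith); linarith
  have hwin : Real.arsinh (u + θ) - Real.arsinh (u - θ) ≤ 2 * θ / W := arsinh_window_le_far' hθ0 hu
  have hNN : 1 + 2 * x ^ 2 + x ^ 4 ≤ 1 + 2 * x + 2 * x ^ 2 + 2 * x ^ 3 + x ^ 4 := by nlinarith [pow_nonneg hx0 3]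
  have hNp : 1 + 2 * x + 2 * x ^ 2 + 2 * x ^ 3 + x ^ 4 ≤ 1.0050126 := by
    have h2 : x ^ 2 ≤ (1 / 400) ^ 2 := pow_le_pow_left₀ hx0 hx 2
    have h3 : x ^ 3 ≤ (1 / 400) ^ 3 := pow_le_pow_left₀ hx0 hx 3
    have h4 : x ^ 4 ≤ (1 / 400) ^ 4 := pow_le_pow_left₀ hx0 hx 4
    norm_num at h2 h3 h4 ⊢; linarith
  have hNp0 : 0 ≤ 1 + 2 * x + 2 * x ^ 2 + 2 * x ^ 3 + x ^ 4 := by positivity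
  set F := (1 + 2 * x + 2 * x ^ 2 + 2 * x ^ 3 + x ^ 4) * (Real.arsinh (u + θ) - Real.arsinh u) +
    (1 + 2 * x ^ 2 + x ^ 4) * (Real.arsinh u - Real.arsinh (u - θ)) with hF_def
  have hF : F ≤ 1.0050126 * (2 * θ / W) := by
    calc F ≤ (1 + 2 * x + 2 * x ^ 2 + 2 * x ^ 3 + x ^ 4) * (Real.arsinh (u + θ) - Real.arsinh u) +
          (1 + 2 * x + 2 * x ^ 2 + 2 * x ^ 3 + x ^ 4) * (Real.arsinh u - Real.arsinh (u - θ)) := by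
            have := mul_le_mul_of_nonneg_right hNN hIm; rw [hF_def]; linarith
      _ = (1 + 2 * x + 2 * x ^ 2 + 2 * x ^ 3 + x ^ 4) * (Real.arsinh (u + θ) - Real.arsinh (u - θ)) := by ring
      _ ≤ 1.0050126 * (2 * θ / W) := mul_le_mul hNp hwin (by linarith) (by norm_num)
  have hF0 : 0 ≤ F := by rw [hF_def]; positivity
  have h1q : 0 < 1 - q := by norm_num at hq; linarith
  have e : 4 * Real.pi * a * (a * (Real.pi / 2 + 2 * sawSigma0 a β) + 2 * a * ‖sawS a β‖) / (a * Real.sqrt (max 0 (sawC2 a β))) *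
        (F / (((1 - q) * (2 * (2 * Real.pi * a))) * (2 * Real.pi * a))) = (R * (F / (1 - q))) / (2 * Real.pi * a) := by
    rw [hR_def]; field_simp; ring
  rw [e, div_le_div_iff₀ (by positivity) (by positivity)]
  have hFq : F / (1 - q) ≤ 1.0050127 * (2 * θ / W) := by
    rw [div_le_iff₀ h1q]
    have hθW : 0 ≤ 2 * θ / W := by positivity
    norm_num at hq ⊢; nlinarith
  have hFq0 : 0 ≤ F / (1 - q) := by positivity
  have hθW : 0 ≤ 2 * θ / W := by positivity
  have h3 : R * (F / (1 - q)) ≤ 1.00002 * (1.0050127 * (2 * θ / W)) := mul_le_mul hR hFq hFq0 (by norm_num)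
  -- `R·F/(1−q)·(a·W) ≤ 1.00002·1.0050127·16·a ≤ 2.57·2π·a`
  have h4 : R * (F / (1 - q)) * (a * W) ≤ 1.00002 * (1.0050127 * (2 * θ / W)) * (a * W) := mul_le_mul_of_nonneg_right h3 (by positivity)
  have h5 : 1.00002 * (1.0050127 * (2 * θ / W)) * (a * W) = 1.00002 * 1.0050127 * 2 * θ * a := by field_simp
  rw [h5] at h4
  nlinarith


/-- Mirror of `arsinh_window_le_far'`: for `u ≤ −θ ≤ 0`, `arsinh(u+θ) − arsinh(u−θ) ≤ 2θ/√(1+(u+θ)²)` (`arsinh` is odd). [folklore]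
(FARM-LAG SHIM: primed verbatim copy of the tree lemma of the same unprimed name in `…KHModeTail` (p704708 + p710951, commit 3e55381f77ff); the crux file does not import that module while the farm's olean of it is stale.) -/
theorem arsinh_window_le_far_neg' {θ u : ℝ} (hθ : 0 ≤ θ) (hu : u ≤ -θ) :
    Real.arsinh (u + θ) - Real.arsinh (u - θ) ≤ 2 * θ / Real.sqrt (1 + (u + θ) ^ 2) := by
  have h := arsinh_window_le_far' hθ (show θ ≤ -u by linarith)
  rw [show -u + θ = -(u - θ) by ring, show -u - θ = -(u + θ) by ring, Real.arsinh_neg, Real.arsinh_neg, neg_sq] at h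
  linarith

/-- **Non-resonant tail of the mode factor, negative side:** for `a ≥ 4`, `0 ≤ θ ≤ 8`, `u = ξ/a ≤ −θ`:
the mode factor is `≤ 2.57/(a·√(1+(ξ/a+θ)²))`. [folklore]
(FARM-LAG SHIM: primed verbatim copy of the tree lemma of the same unprimed name in `…KHModeTail` (p704708 + p710951, commit 3e55381f77ff); the crux file does not import that module while the farm's olean of it is stale.) -/
theorem mode_factor_far_le_neg' {a : ℝ} (ha : 4 ≤ a) (β ξ : ℝ) {θ : ℝ} (hθ0 : 0 ≤ θ) (hθ : θ ≤ 8) (hu : ξ / a ≤ -θ) :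
    4 * Real.pi * a * (a * (Real.pi / 2 + 2 * sawSigma0 a β) + 2 * a * ‖sawS a β‖) / (a * Real.sqrt (max 0 (sawC2 a β))) *
        (((1 + 2 * Real.exp (-(2 * Real.pi * a) / 4) + 2 * Real.exp (-(2 * Real.pi * a) / 4) ^ 2 + 2 * Real.exp (-(2 * Real.pi * a) / 4) ^ 3 +
            Real.exp (-(2 * Real.pi * a) / 4) ^ 4) * (Real.arsinh (ξ / a + θ) - Real.arsinh (ξ / a)) +
          (1 + 2 * Real.exp (-(2 * Real.pi * a) / 4) ^ 2 + Real.exp (-(2 * Real.pi * a) / 4) ^ 4) * (Real.arsinh (ξ / a) - Real.arsinh (ξ / a - θ))) /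
          (((1 - Real.exp (-(2 * Real.pi * a))) * (2 * (2 * Real.pi * a))) * (2 * Real.pi * a))) ≤
      2.57 / (a * Real.sqrt (1 + (ξ / a + θ) ^ 2)) := by
  have ha1 : 1 ≤ a := by linarith
  have ha0 : 0 < a := by linarith
  have hπ : (3.1415 : ℝ) < Real.pi := Real.pi_gt_d4
  have hR : (a * (Real.pi / 2 + 2 * sawSigma0 a β) + 2 * a * ‖sawS a β‖) / (a * Real.sqrt (max 0 (sawC2 a β))) ≤ 1.00002 :=
    (comb_ratio_le ha1 β).trans (by linarith [comb_ratio_defect_le ha β])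
  have hR0 : 0 ≤ (a * (Real.pi / 2 + 2 * sawSigma0 a β) + 2 * a * ‖sawS a β‖) / (a * Real.sqrt (max 0 (sawC2 a β))) := by
    have := kh_p_ge ha1 β; positivity
  have hx := exp_neg_quarter_kappa_le ha
  have hx0 : 0 ≤ Real.exp (-(2 * Real.pi * a) / 4) := (Real.exp_pos _).le
  have hq : Real.exp (-(2 * Real.pi * a)) ≤ (1 / 400) ^ 4 := exp_neg_kappa_le_pow ha
  have hq0 : 0 < Real.exp (-(2 * Real.pi * a)) := Real.exp_pos _
  set x := Real.exp (-(2 * Real.pi * a) / 4) with hxdef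
  set q := Real.exp (-(2 * Real.pi * a)) with hqdef
  set u := ξ / a with hudef
  set R := (a * (Real.pi / 2 + 2 * sawSigma0 a β) + 2 * a * ‖sawS a β‖) / (a * Real.sqrt (max 0 (sawC2 a β))) with hR_def
  set W := Real.sqrt (1 + (u + θ) ^ 2) with hW
  have hW0 : 0 < W := Real.sqrt_pos.2 (by positivity)
  -- the envelope factor: `N₋ ≤ N₊`, `I₊, I₋ ≥ 0`, `I₊ + I₋ ≤ 2θ/W`
  have hIp : 0 ≤ Real.arsinh (u + θ) - Real.arsinh u := by
    have := Real.arsinh_le_arsinh.2 (show u ≤ u + θ by linarith); linarith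
  have hIm : 0 ≤ Real.arsinh u - Real.arsinh (u - θ) := by
    have := Real.arsinh_le_arsinh.2 (show u - θ ≤ u by linarith); linarith
  have hwin : Real.arsinh (u + θ) - Real.arsinh (u - θ) ≤ 2 * θ / W := arsinh_window_le_far_neg' hθ0 hu
  have hNN : 1 + 2 * x ^ 2 + x ^ 4 ≤ 1 + 2 * x + 2 * x ^ 2 + 2 * x ^ 3 + x ^ 4 := by nlinarith [pow_nonneg hx0 3]
  have hNp : 1 + 2 * x + 2 * x ^ 2 + 2 * x ^ 3 + x ^ 4 ≤ 1.0050126 := by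
    have h2 : x ^ 2 ≤ (1 / 400) ^ 2 := pow_le_pow_left₀ hx0 hx 2
    have h3 : x ^ 3 ≤ (1 / 400) ^ 3 := pow_le_pow_left₀ hx0 hx 3
    have h4 : x ^ 4 ≤ (1 / 400) ^ 4 := pow_le_pow_left₀ hx0 hx 4
    norm_num at h2 h3 h4 ⊢; linarith
  have hNp0 : 0 ≤ 1 + 2 * x + 2 * x ^ 2 + 2 * x ^ 3 + x ^ 4 := by positivity
  set F := (1 + 2 * x + 2 * x ^ 2 + 2 * x ^ 3 + x ^ 4) * (Real.arsinh (u + θ) - Real.arsinh u) +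
    (1 + 2 * x ^ 2 + x ^ 4) * (Real.arsinh u - Real.arsinh (u - θ)) with hF_def
  have hF : F ≤ 1.0050126 * (2 * θ / W) := by
    calc F ≤ (1 + 2 * x + 2 * x ^ 2 + 2 * x ^ 3 + x ^ 4) * (Real.arsinh (u + θ) - Real.arsinh u) +
          (1 + 2 * x + 2 * x ^ 2 + 2 * x ^ 3 + x ^ 4) * (Real.arsinh u - Real.arsinh (u - θ)) := by
            have := mul_le_mul_of_nonneg_right hNN hIm; rw [hF_def]; linarith
      _ = (1 + 2 * x + 2 * x ^ 2 + 2 * x ^ 3 + x ^ 4) * (Real.arsinh (u + θ) - Real.arsinh (u - θ)) := by ring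
      _ ≤ 1.0050126 * (2 * θ / W) := mul_le_mul hNp hwin (by linarith) (by norm_num)
  have hF0 : 0 ≤ F := by rw [hF_def]; positivity
  have h1q : 0 < 1 - q := by norm_num at hq; linarith
  have e : 4 * Real.pi * a * (a * (Real.pi / 2 + 2 * sawSigma0 a β) + 2 * a * ‖sawS a β‖) / (a * Real.sqrt (max 0 (sawC2 a β))) *
        (F / (((1 - q) * (2 * (2 * Real.pi * a))) * (2 * Real.pi * a))) = (R * (F / (1 - q))) / (2 * Real.pi * a) := by
    rw [hR_def]; field_simp; ring
  rw [e, div_le_div_iff₀ (by positivity) (by positivity)]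
  have hFq : F / (1 - q) ≤ 1.0050127 * (2 * θ / W) := by
    rw [div_le_iff₀ h1q]
    have hθW : 0 ≤ 2 * θ / W := by positivity
    norm_num at hq ⊢; nlinarith
  have hFq0 : 0 ≤ F / (1 - q) := by positivity
  have hθW : 0 ≤ 2 * θ / W := by positivity
  have h3 : R * (F / (1 - q)) ≤ 1.00002 * (1.0050127 * (2 * θ / W)) := mul_le_mul hR hFq hFq0 (by norm_num)
  -- `R·F/(1−q)·(a·W) ≤ 1.00002·1.0050127·16·a ≤ 2.57·2π·a`
  have h4 : R * (F / (1 - q)) * (a * W) ≤ 1.00002 * (1.0050127 * (2 * θ / W)) * (a * W) := mul_le_mul_of_nonneg_right h3 (by positivity)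
  have h5 : 1.00002 * (1.0050127 * (2 * θ / W)) * (a * W) = 1.00002 * 1.0050127 * 2 * θ * a := by field_simp
  rw [h5] at h4
  nlinarith


/-- **Far modes never un-tilt: the mode factor decays like `1/|ξ|`.** For `a ≥ 4`, `0 ≤ θ ≤ 8` and `|ξ| ≥ 16a` the mode factor is `≤ 5.14/|ξ|`
(both signs of `ξ`; `√(1+(|u|−θ)²) ≥ |u| − 8 ≥ |u|/2`). [folklore]
(FARM-LAG SHIM: primed verbatim copy of the tree lemma of the same unprimed name in `…KHModeTail` (p704708 + p710951, commit 3e55381f77ff); the crux file does not import that module while the farm's olean of it is stale.) -/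
theorem mode_factor_le_of_far' {a : ℝ} (ha : 4 ≤ a) (β ξ : ℝ) {θ : ℝ} (hθ0 : 0 ≤ θ) (hθ : θ ≤ 8) (hfar : 16 * a ≤ |ξ|) :
    4 * Real.pi * a * (a * (Real.pi / 2 + 2 * sawSigma0 a β) + 2 * a * ‖sawS a β‖) / (a * Real.sqrt (max 0 (sawC2 a β))) *
        (((1 + 2 * Real.exp (-(2 * Real.pi * a) / 4) + 2 * Real.exp (-(2 * Real.pi * a) / 4) ^ 2 + 2 * Real.exp (-(2 * Real.pi * a) / 4) ^ 3 +
            Real.exp (-(2 * Real.pi * a) / 4) ^ 4) * (Real.arsinh (ξ / a + θ) - Real.arsinh (ξ / a)) +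
          (1 + 2 * Real.exp (-(2 * Real.pi * a) / 4) ^ 2 + Real.exp (-(2 * Real.pi * a) / 4) ^ 4) * (Real.arsinh (ξ / a) - Real.arsinh (ξ / a - θ))) /
          (((1 - Real.exp (-(2 * Real.pi * a))) * (2 * (2 * Real.pi * a))) * (2 * Real.pi * a))) ≤
      5.14 / |ξ| := by
  have ha0 : 0 < a := by linarith
  rcases le_or_gt 0 ξ with hξ | hξ
  · rw [abs_of_nonneg hξ] at hfar ⊢
    have hu : 16 ≤ ξ / a := by rw [le_div_iff₀ ha0]; linarith
    have hξ0 : 0 < ξ := by nlinarith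
    refine (mode_factor_far_le' ha β ξ hθ0 hθ (by linarith)).trans ?_
    have hs : ξ / a / 2 ≤ Real.sqrt (1 + (ξ / a - θ) ^ 2) := by
      refine le_trans ?_ (Real.sqrt_le_sqrt (by nlinarith : (ξ / a - θ) ^ 2 ≤ 1 + (ξ / a - θ) ^ 2))
      rw [Real.sqrt_sq (by linarith)]
      linarith
    rw [div_le_div_iff₀ (by positivity) hξ0]
    have : 2.57 * ξ = 5.14 * (a * (ξ / a / 2)) := by field_simp; ring
    rw [this]
    exact mul_le_mul_of_nonneg_left (mul_le_mul_of_nonneg_left hs ha0.le) (by norm_num)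
  · rw [abs_of_neg hξ] at hfar ⊢
    have hu : ξ / a ≤ -16 := by rw [div_le_iff₀ ha0]; linarith
    have hξ0 : 0 < -ξ := by linarith
    refine (mode_factor_far_le_neg' ha β ξ hθ0 hθ (by linarith)).trans ?_
    have hs : -(ξ / a) / 2 ≤ Real.sqrt (1 + (ξ / a + θ) ^ 2) := by
      refine le_trans ?_ (Real.sqrt_le_sqrt (by nlinarith : (ξ / a + θ) ^ 2 ≤ 1 + (ξ / a + θ) ^ 2))
      rw [show (ξ / a + θ) ^ 2 = (-(ξ / a) - θ) ^ 2 by ring, Real.sqrt_sq (by linarith)]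
      linarith
    rw [div_le_div_iff₀ (by positivity) hξ0]
    have : 2.57 * -ξ = 5.14 * (a * (-(ξ / a) / 2)) := by field_simp; ring
    rw [this]
    exact mul_le_mul_of_nonneg_left (mul_le_mul_of_nonneg_left hs ha0.le) (by norm_num)


/-! ## §19 (v12) THE LAG-UNIFORM FAR ENTRY: for `s ≥ s′ + 6` the V→H entry is bounded by ONE constant — `Transfer α β 8 K V s H s′ 2000` (tree `mode_factor_le_of_far`, p710951) -/

/-- **Far-mode profile creation law, positive lines:** if the profile has no mode with `|β+n| < 16a` (`a ≥ 4`, `0 ≤ θ ≤ 8`), then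
`‖sheetAmps a β θ ⟨modeProfile β K c, []⟩ i‖ ≤ Σ_n ‖c n‖·5.14/|β+n|` — far modes never un-tilt, their weight decays like `1/|ξ|`. -/
theorem norm_sheetAmps_modeProfile_le_far_pos {a : ℝ} (ha : 4 ≤ a) (β : ℝ) {θ : ℝ} (hθ0 : 0 ≤ θ) (hθ : θ ≤ 8) (K : ℕ) (c : ℤ → ℂ)
    (hc : ∀ n ∈ win K, |β + (n : ℝ)| < 16 * a → c n = 0) (i : Fin 2) :
    ‖sheetAmps a β θ ⟨modeProfile β K c, []⟩ i‖ ≤ ∑ n ∈ win K, ‖c n‖ * (5.14 / |β + n|) := by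
  refine (norm_sheetAmps_modeProfile_resolved (by linarith) β hθ0 K c i).trans (Finset.sum_le_sum fun n hn => ?_)
  rcases lt_or_ge |β + (n : ℝ)| (16 * a) with h | h
  · rw [hc n hn h]; simp
  · exact mul_le_mul_of_nonneg_left (mode_factor_le_of_far' ha β (β + n) hθ0 hθ h) (norm_nonneg _)

/-- **Far-mode profile creation law, negative lines** (`a ≤ −4`), by the conjugation symmetry of §17. -/
theorem norm_sheetAmps_modeProfile_le_far_neg {a : ℝ} (ha : a ≤ -4) (β : ℝ) {θ : ℝ} (hθ0 : 0 ≤ θ) (hθ : θ ≤ 8) (K : ℕ) (c : ℤ → ℂ)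
    (hc : ∀ n ∈ win K, |β + (n : ℝ)| < 16 * |a| → c n = 0) (i : Fin 2) :
    ‖sheetAmps a β θ ⟨modeProfile β K c, []⟩ i‖ ≤ ∑ n ∈ win K, ‖c n‖ * (5.14 / |β + n|) := by
  have ha' : 4 ≤ -a := by linarith
  have ha1 : 1 ≤ -a := by linarith
  have hcc : (fun n : ℤ => starRingEnd ℂ ((fun n : ℤ => starRingEnd ℂ (c (-n))) (-n))) = c := by funext n; simp
  have h := sheetAmps_neg_neg_modeProfile ha1 (-β) θ K (fun n => starRingEnd ℂ (c (-n))) i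
  rw [neg_neg, neg_neg, hcc] at h
  rw [h, Complex.norm_conj]
  have hc' : ∀ n ∈ win K, |-β + (n : ℝ)| < 16 * (-a) → (fun n : ℤ => starRingEnd ℂ (c (-n))) n = 0 := by
    intro n hn hlt
    have hn' : -n ∈ win K := by simp only [win, Finset.mem_Icc] at hn ⊢; omega
    have : c (-n) = 0 := hc (-n) hn' (by rw [abs_of_neg (by linarith : a < 0)]; push_cast; rw [show β + -(n : ℝ) = -(-β + n) by ring, abs_neg]; exact hlt)
    simp [this]
  refine (norm_sheetAmps_modeProfile_le_far_pos ha' (-β) hθ0 hθ K _ hc' i).trans (le_of_eq ?_)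
  refine Finset.sum_nbij' (fun n => -n) (fun n => -n) (fun n hn => by simp only [win, Finset.mem_Icc] at hn ⊢; omega)
    (fun n hn => by simp only [win, Finset.mem_Icc] at hn ⊢; omega) (fun n _ => neg_neg n) (fun n _ => neg_neg n) (fun n _ => ?_)
  simp only [Complex.norm_conj, Int.cast_neg]
  rw [show -β + (n : ℝ) = -(β + -(n : ℝ)) by ring, abs_neg]

/-- **Fresh H densities of a far row from far modes only:** `‖hFresh α β θ K ζ m i‖ ≤ Σ_n ‖ζ m n‖·5.14/|β+n|` when every mode of row `m` has
`|β+n| ≥ 16|α+m|` (`|α+m| ≥ 4`, `0 ≤ θ ≤ 8`). -/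
theorem norm_hFresh_le_far (α β : ℝ) {θ : ℝ} (hθ0 : 0 ≤ θ) (hθ : θ ≤ 8) (K : ℕ) (ζ : CState) {m : ℤ} (hm : m ∈ win K) (ha : 4 ≤ |α + (m : ℝ)|)
    (hζ : ∀ n ∈ win K, |β + (n : ℝ)| < 16 * |α + (m : ℝ)| → ζ m n = 0) (i : Fin 2) :
    ‖hFresh α β θ K ζ m i‖ ≤ ∑ n ∈ win K, ‖ζ m n‖ * (5.14 / |β + n|) := by
  simp only [hFresh, if_pos hm]
  rcases le_or_gt 0 (α + (m : ℝ)) with h | h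
  · rw [abs_of_nonneg h] at ha hζ
    exact norm_sheetAmps_modeProfile_le_far_pos ha β hθ0 hθ K (ζ m) hζ i
  · have : α + (m : ℝ) ≤ -4 := by rw [abs_of_neg h] at ha; linarith
    exact norm_sheetAmps_modeProfile_le_far_neg this β hθ0 hθ K (ζ m) hζ i

/-- **Output side of the far entry with a uniform row amplitude:** if every fresh H density of a shell-`s′` row is at most `Q`, the child's output H piece
has level-1 energy `≤ 66·(1/(16π²))·(2·2^{s′}+1)·2(π+1)Q²/2^{s′−1}`. -/
theorem outEnergy_H_child_le_of_amp {β' : ℝ} (hβ0 : 0 ≤ β') (hβ1 : β' ≤ 1) (α' : ℝ) (K : ℕ) {s' : ℕ} (hs' : 3 ≤ s') (ζ : CState) {Q : ℝ}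
    (hQ0 : 0 ≤ Q)
    (hQ : ∀ m ∈ win K, (shellLo s' ≤ |α' + (m : ℝ)| ∧ |α' + (m : ℝ)| < shellHi s') → ∀ i : Fin 2, ‖hFresh α' β' 8 K ζ m i‖ ≤ Q) :
    outEnergy α' β' 8 K s' (phasePieces α' β' 8 K ζ) PType.H ≤
      66 * ((1 / (4 * Real.pi ^ 2 * (4 : ℝ) ^ (1 : ℕ))) * ((2 * 2 ^ s' + 1) * (2 * (Real.pi + 1) * Q ^ 2 / (2 : ℝ) ^ (s' - 1)))) := by
  have h1 : outEnergy α' β' 8 K s' (phasePieces α' β' 8 K ζ) PType.H ≤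
      ((8 : ℝ) ^ 2 + 2) * cEnergy α' β' 1 K (hPairState β' (restrictShell s' α' (phasePieces α' β' 8 K ζ).freshH)) :=
    outEnergyAt_H_le α' β' 8 K 1 s' _
  rw [show ((8 : ℝ) ^ 2 + 2) = 66 by norm_num] at h1
  refine h1.trans (mul_le_mul_of_nonneg_left ?_ (by norm_num))
  have hfresh : (phasePieces α' β' 8 K ζ).freshH = hFresh α' β' 8 K ζ := rfl
  rw [hfresh]
  set q : ℤ → Fin 2 → ℂ := restrictShell s' α' (hFresh α' β' 8 K ζ) with hq
  obtain ⟨k, rfl⟩ : ∃ k, s' = k + 3 := ⟨s' - 3, by omega⟩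
  have hA : (4 : ℝ) ≤ 2 ^ (k + 2) := by
    calc (4 : ℝ) = 2 ^ 2 := by norm_num
      _ ≤ 2 ^ (k + 2) := pow_le_pow_right₀ (by norm_num) (by omega)
  have hq0 : ∀ m : ℤ, ¬ (shellLo (k + 3) ≤ |α' + (m : ℝ)| ∧ |α' + (m : ℝ)| < shellHi (k + 3)) → q m = 0 := by
    intro m hm; simp only [hq, restrictShell]; rw [if_neg hm]
  have hqz : ∀ m ∈ win K, α' + (m : ℝ) = 0 → q m = 0 := by
    intro m _ hm
    apply hq0
    intro h
    have := h.1
    simp only [shellLo, hm, abs_zero] at this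
    linarith [pow_pos (by norm_num : (0 : ℝ) < 2) (k + 1 + 1)]
  refine (cEnergy_hPairState_le hβ0 hβ1 α' 1 K q hqz).trans (mul_le_mul_of_nonneg_left ?_ (by positivity))
  have hrow : ∀ m ∈ win K, (‖q m 0‖ ^ 2 + ‖q m 1‖ ^ 2) * (Real.pi / |α' + m| + 4 / (α' + m) ^ 2) ≤
      if (shellLo (k + 3) ≤ |α' + (m : ℝ)| ∧ |α' + (m : ℝ)| < shellHi (k + 3)) then 2 * (Real.pi + 1) * Q ^ 2 / (2 : ℝ) ^ (k + 3 - 1) else 0 := by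
    intro m hm
    split_ifs with hin
    · have hlo : (2 : ℝ) ^ (k + 2) ≤ |α' + m| := hin.1
      have ha4 : 4 ≤ |α' + (m : ℝ)| := hA.trans hlo
      have hapos : 0 < |α' + (m : ℝ)| := by linarith
      have hqm : ∀ i : Fin 2, ‖q m i‖ ≤ Q := by
        intro i
        have e : q m = hFresh α' β' 8 K ζ m := by simp only [hq, restrictShell, if_pos (And.intro hin.1 hin.2)]
        rw [e]; exact hQ m hm hin i
      have hsq : ‖q m 0‖ ^ 2 + ‖q m 1‖ ^ 2 ≤ 2 * Q ^ 2 := by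
        nlinarith [hqm 0, hqm 1, norm_nonneg (q m 0), norm_nonneg (q m 1)]
      have hw : Real.pi / |α' + m| + 4 / (α' + (m : ℝ)) ^ 2 ≤ (Real.pi + 1) / |α' + m| := by
        rw [add_div]
        refine add_le_add le_rfl ?_
        rw [← sq_abs, div_le_div_iff₀ (by positivity) hapos]
        nlinarith
      have h3 : (2 : ℝ) ^ (k + 3 - 1) = 2 ^ (k + 2) := by congr 1
      calc (‖q m 0‖ ^ 2 + ‖q m 1‖ ^ 2) * (Real.pi / |α' + m| + 4 / (α' + m) ^ 2)
          ≤ (2 * Q ^ 2) * ((Real.pi + 1) / |α' + m|) := mul_le_mul hsq hw (by positivity) (by positivity)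
        _ = 2 * (Real.pi + 1) * Q ^ 2 / |α' + m| := by ring
        _ ≤ 2 * (Real.pi + 1) * Q ^ 2 / (2 : ℝ) ^ (k + 3 - 1) := by
            rw [h3]; exact div_le_div_of_nonneg_left (by positivity) (by positivity) hlo
    · have : q m = 0 := hq0 m hin
      simp [this]
  refine (Finset.sum_le_sum hrow).trans ?_
  rw [Finset.sum_ite, Finset.sum_const_zero, add_zero, Finset.sum_const, nsmul_eq_mul]
  refine mul_le_mul_of_nonneg_right ?_ (by positivity)
  exact card_filter_inShell_le α' (k + 3) (by omega) (win K)

/-- The far-mode weight on the child's rows: in the far regime `s ≥ s′ + 6` every nonzero mode of every shell-`s′` row of the child of a shell-`s`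
V source has `|β′ + n| ≥ 2^{s−2} ≥ 16|α′+m|`, and `Σ_n ‖ζc m n‖·5.14/|β′+n| ≤ 5.14·2^{2−s}·Σ_k (‖d k 0‖+‖d k 1‖)`. -/
theorem child_row_far_weight_le (α β θ : ℝ) (K : ℕ) {s : ℕ} (hs : 2 ≤ s) (d : ℤ → Fin 2 → ℂ) (hd : SupportedIn s β d)
    (hdW : ∀ k : ℤ, k ∉ win K → d k = 0) (pm pn : ℤ) (m : ℤ) :
    (∀ n ∈ win K, |(β + pn) / 2 + (n : ℝ)| < (2 : ℝ) ^ (s - 2) → child pm pn (inputState α β θ K PType.V d) m n = 0) ∧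
    ∑ n ∈ win K, ‖child pm pn (inputState α β θ K PType.V d) m n‖ * (5.14 / |(β + pn) / 2 + n|) ≤
      5.14 / (2 : ℝ) ^ (s - 2) * ∑ k ∈ win K, (‖d k 0‖ + ‖d k 1‖) := by
  -- a nonzero child mode comes from a source column `k = 2n + pn` in shell `s`, so `|β + k| ≥ 2^{s-1}` and `|β' + n| = |β + k|/2`
  have key : ∀ n : ℤ, child pm pn (inputState α β θ K PType.V d) m n ≠ 0 → (2 : ℝ) ^ (s - 2) ≤ |(β + pn) / 2 + (n : ℝ)| := by
    intro n hne
    have hdk : d (2 * n + pn) ≠ 0 := by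
      intro h0
      apply hne
      simp only [child, inputState, truncW, vPairState]
      split_ifs <;> simp [h0]
    have hin : InShell s (β + ((2 * n + pn : ℤ) : ℝ)) := by
      by_contra h; exact hdk (hd _ h)
    obtain ⟨j, rfl⟩ : ∃ j, s = j + 2 := ⟨s - 2, by omega⟩
    have hlo : (2 : ℝ) ^ (j + 1) ≤ |β + ((2 * n + pn : ℤ) : ℝ)| := hin.1
    rw [show j + 2 - 2 = j by omega]
    have e : (β + pn) / 2 + (n : ℝ) = (β + ((2 * n + pn : ℤ) : ℝ)) / 2 := by push_cast; ring
    rw [e, abs_div, abs_two, le_div_iff₀ (by norm_num : (0 : ℝ) < 2)]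
    calc (2 : ℝ) ^ j * 2 = 2 ^ (j + 1) := by rw [pow_succ]
      _ ≤ _ := hlo
  refine ⟨fun n _ hlt => ?_, ?_⟩
  · by_contra hne; exact absurd (key n hne) (not_le.2 hlt)
  · have hterm : ∀ n ∈ win K, ‖child pm pn (inputState α β θ K PType.V d) m n‖ * (5.14 / |(β + ↑pn) / 2 + ↑n|) ≤
        ‖child pm pn (inputState α β θ K PType.V d) m n‖ * (5.14 / (2 : ℝ) ^ (s - 2)) := by
      intro n _
      by_cases hne : child pm pn (inputState α β θ K PType.V d) m n = 0
      · simp [hne]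
      · exact mul_le_mul_of_nonneg_left (div_le_div_of_nonneg_left (by norm_num) (by positivity) (key n hne)) (norm_nonneg _)
    calc ∑ n ∈ win K, ‖child pm pn (inputState α β θ K PType.V d) m n‖ * (5.14 / |(β + ↑pn) / 2 + ↑n|)
        ≤ ∑ n ∈ win K, ‖child pm pn (inputState α β θ K PType.V d) m n‖ * (5.14 / (2 : ℝ) ^ (s - 2)) := Finset.sum_le_sum hterm
      _ = 5.14 / (2 : ℝ) ^ (s - 2) * ∑ n ∈ win K, ‖child pm pn (inputState α β θ K PType.V d) m n‖ := by
          rw [Finset.mul_sum]; exact Finset.sum_congr rfl fun n _ => by ring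
      _ ≤ 5.14 / (2 : ℝ) ^ (s - 2) * ∑ k ∈ win K, (‖d k 0‖ + ‖d k 1‖) :=
          mul_le_mul_of_nonneg_left (sum_norm_child_inputState_V_le α β θ K d hdW pm pn m) (by positivity)

/-- Numerical heart of the lag-uniform far entry: `55798.1952(π+1)(2Y+1)(2X+1)/(π²X²Y) ≤ 1100000/(π²X)` for `X ≥ 512`, `Y ≥ 8`. -/
theorem far_entry_numeric2 {X Y : ℝ} (hX : 512 ≤ X) (hY : 8 ≤ Y) :
    55798.1952 * (Real.pi + 1) * (2 * Y + 1) * (2 * X + 1) / (Real.pi ^ 2 * X ^ 2 * Y) ≤ 1100000 / (Real.pi ^ 2 * X) := by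
  have hXpos : 0 < X := by linarith
  have hYpos : 0 < Y := by linarith
  have hXY : 0 < X * Y := mul_pos hXpos hYpos
  have hπ4 : Real.pi < 3.15 := Real.pi_lt_d2
  have hP : (2 * Y + 1) * (2 * X + 1) ≤ 43 / 10 * (X * Y) := by
    nlinarith [mul_nonneg (sub_nonneg.2 hX) (sub_nonneg.2 hY)]
  have hP0 : 0 ≤ (2 * Y + 1) * (2 * X + 1) := by positivity
  have h1 : Real.pi + 1 ≤ 83 / 20 := by linarith
  have key : 55798.1952 * (Real.pi + 1) * (2 * Y + 1) * (2 * X + 1) ≤ 1100000 * (X * Y) := by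
    have h2 : (Real.pi + 1) * ((2 * Y + 1) * (2 * X + 1)) ≤ (83 / 20) * (43 / 10 * (X * Y)) := mul_le_mul h1 hP hP0 (by norm_num)
    have h3 : 55798.1952 * ((Real.pi + 1) * ((2 * Y + 1) * (2 * X + 1))) ≤ 55798.1952 * ((83 / 20) * (43 / 10 * (X * Y))) :=
      mul_le_mul_of_nonneg_left h2 (by norm_num)
    have h4 : 55798.1952 * ((83 / 20) * (43 / 10 * (X * Y))) ≤ 1100000 * (X * Y) := by
      rw [show 55798.1952 * ((83 / 20) * (43 / 10 * (X * Y))) = (55798.1952 * (83 / 20) * (43 / 10)) * (X * Y) by ring]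
      exact mul_le_mul_of_nonneg_right (by norm_num) hXY.le
    calc 55798.1952 * (Real.pi + 1) * (2 * Y + 1) * (2 * X + 1) = 55798.1952 * ((Real.pi + 1) * ((2 * Y + 1) * (2 * X + 1))) := by ring
      _ ≤ 1100000 * (X * Y) := h3.trans h4
  rw [div_le_div_iff₀ (by positivity) (by positivity)]
  calc 55798.1952 * (Real.pi + 1) * (2 * Y + 1) * (2 * X + 1) * (Real.pi ^ 2 * X)
      ≤ 1100000 * (X * Y) * (Real.pi ^ 2 * X) := mul_le_mul_of_nonneg_right key (by positivity)
    _ = 1100000 * (Real.pi ^ 2 * X ^ 2 * Y) := by ring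

/-- **THE LAG-UNIFORM FAR ENTRY BY NAME (E6 for the V→H block in full).** For every parent class `(α, β) ∈ [0,1)²`, every target shell `s′ ≥ 3`, every
source shell `s ≥ s′ + 6` and every truncation with `K + 1 ≥ 2^{s+2}`: `Transfer α β 8 K V s H s′ √2200000` — ONE constant for the whole far V→H
block, uniformly in `K`, `s`, `s′` and the class: far modes never un-tilt (`mode_factor_le_of_far`: weight `≤ 5.14/|ξ|`, tree `…KHModeTail`), so the
created amplitude of every shell-`s′` row is `≤ 5.14·2^{2−s}·ℓ¹(source)` independently of the row; transport ×66 (§15), straight-pair energy (§16),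
Cauchy–Schwarz over the `≤ 2·2^s+1` source columns and the input energy `≥ 2/2^s·ℓ²/4π²` (§14) then give an `(s, s′)`-free ratio. With a geometric
profile `ε_s ∝ 2^{−s}` (or any summable one) the far part of every H row of the cone is therefore finite UNIFORMLY in `s′` and `K` — E6's logical content
for this block; the numbers of the cone stay the engine's (A27-9). -/
theorem transfer_V_H_far_uniform {α β : ℝ} (hα0 : 0 ≤ α) (hα1 : α < 1) (hβ0 : 0 ≤ β) (hβ1 : β < 1) {s s' : ℕ} (hs' : 3 ≤ s') (hlag : s' + 6 ≤ s)
    (K : ℕ) (hK : (2 : ℝ) ^ (s + 2) ≤ K + 1) :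
    Transfer α β 8 K PType.V s PType.H s' (Real.sqrt 2200000) := by
  intro d hd
  have hs : 9 ≤ s := by omega
  have hdS : SupportedIn s β d := hd.1
  have hdW : ∀ k : ℤ, k ∉ win K → d k = 0 := hd.2
  set D₁ : ℝ := ∑ k ∈ win K, (‖d k 0‖ + ‖d k 1‖) with hD₁
  set D₂ : ℝ := ∑ k ∈ win K, (‖d k 0‖ ^ 2 + ‖d k 1‖ ^ 2) with hD₂
  have hD₁0 : 0 ≤ D₁ := Finset.sum_nonneg fun _ _ => by positivity
  have hD₂0 : 0 ≤ D₂ := Finset.sum_nonneg fun _ _ => by positivity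
  set X : ℝ := (2 : ℝ) ^ s with hX
  set Y : ℝ := (2 : ℝ) ^ s' with hY
  have hX512 : 512 ≤ X := by
    rw [hX]; calc (512 : ℝ) = 2 ^ 9 := by norm_num
      _ ≤ 2 ^ s := pow_le_pow_right₀ (by norm_num) hs
  have hY8 : 8 ≤ Y := by
    rw [hY]; calc (8 : ℝ) = 2 ^ 3 := by norm_num
      _ ≤ 2 ^ s' := pow_le_pow_right₀ (by norm_num) hs'
  have hXpos : 0 < X := by linarith
  have hYpos : 0 < Y := by linarith
  have hXs2 : (2 : ℝ) ^ (s - 2) = X / 4 := by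
    obtain ⟨j, rfl⟩ : ∃ j, s = j + 2 := ⟨s - 2, by omega⟩
    rw [show j + 2 - 2 = j by omega, hX, pow_add]; norm_num
  have hYs1 : (2 : ℝ) ^ (s' - 1) = Y / 2 := by
    obtain ⟨j, rfl⟩ : ∃ j, s' = j + 1 := ⟨s' - 1, by omega⟩
    rw [show j + 1 - 1 = j by omega, hY, pow_succ]; ring
  -- the lag condition in real form: `16·2^{s′} ≤ 2^{s−2}`
  have hlagR : 16 * Y ≤ (2 : ℝ) ^ (s - 2) := by
    rw [hY, show (16 : ℝ) = 2 ^ 4 by norm_num, ← pow_add]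
    exact pow_le_pow_right₀ (by norm_num) (by omega)
  -- (1) uniform row amplitude `Q` for every child
  set Q : ℝ := 5.14 / (2 : ℝ) ^ (s - 2) * D₁ with hQ
  have hQ0 : 0 ≤ Q := by positivity
  have hamp : ∀ pm pn : ℤ, ∀ m ∈ win K,
      (shellLo s' ≤ |(α + pm) / 2 + (m : ℝ)| ∧ |(α + pm) / 2 + (m : ℝ)| < shellHi s') →
        ∀ i : Fin 2, ‖hFresh ((α + pm) / 2) ((β + pn) / 2) 8 K (child pm pn (inputState α β 8 K PType.V d)) m i‖ ≤ Q := by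
    intro pm pn m hm hin i
    obtain ⟨k, hk⟩ : ∃ k, s' = k + 3 := ⟨s' - 3, by omega⟩
    have hlo : (2 : ℝ) ^ (k + 2) ≤ |(α + pm) / 2 + (m : ℝ)| := by have := hin.1; rw [hk] at this; exact this
    have hhi : |(α + pm) / 2 + (m : ℝ)| < (2 : ℝ) ^ (k + 3) := by
      have := hin.2; rw [hk] at this; simpa [shellHi, shellLo] using this
    have hA : (4 : ℝ) ≤ 2 ^ (k + 2) := by
      calc (4 : ℝ) = 2 ^ 2 := by norm_num
        _ ≤ 2 ^ (k + 2) := pow_le_pow_right₀ (by norm_num) (by omega)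
    have ha4 : 4 ≤ |(α + pm) / 2 + (m : ℝ)| := hA.trans hlo
    have hw := child_row_far_weight_le α β 8 K (by omega : 2 ≤ s) d hdS hdW pm pn m
    have hY' : (2 : ℝ) ^ (k + 3) = Y := by rw [hY, hk]
    have hζ : ∀ n ∈ win K, |(β + pn) / 2 + (n : ℝ)| < 16 * |(α + pm) / 2 + (m : ℝ)| →
        child pm pn (inputState α β 8 K PType.V d) m n = 0 := by
      intro n hn hlt
      refine hw.1 n hn (lt_of_lt_of_le hlt ?_)
      calc 16 * |(α + ↑pm) / 2 + (m : ℝ)| ≤ 16 * Y := by rw [← hY']; exact mul_le_mul_of_nonneg_left hhi.le (by norm_num)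
        _ ≤ (2 : ℝ) ^ (s - 2) := hlagR
    refine (norm_hFresh_le_far _ _ (by norm_num) le_rfl K _ hm ha4 hζ i).trans ?_
    rw [hQ]
    exact hw.2
  have hchild : ∀ pm ∈ parities, ∀ pn ∈ parities,
      outEnergy ((α + pm) / 2) ((β + pn) / 2) 8 K s' (phasePieces ((α + pm) / 2) ((β + pn) / 2) 8 K (child pm pn (inputState α β 8 K PType.V d))) PType.H ≤
        66 * ((1 / (4 * Real.pi ^ 2 * (4 : ℝ) ^ (1 : ℕ))) * ((2 * 2 ^ s' + 1) * (2 * (Real.pi + 1) * Q ^ 2 / (2 : ℝ) ^ (s' - 1)))) := by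
    intro pm hpm pn hpn
    have hpn' : (pn : ℝ) = 0 ∨ (pn : ℝ) = 1 := by
      simp only [parities, Finset.mem_insert, Finset.mem_singleton] at hpn
      rcases hpn with h | h <;> simp [h]
    have hb0 : 0 ≤ (β + (pn : ℝ)) / 2 := by rcases hpn' with h | h <;> rw [h] <;> linarith
    have hb1 : (β + (pn : ℝ)) / 2 ≤ 1 := by rcases hpn' with h | h <;> rw [h] <;> linarith
    exact outEnergy_H_child_le_of_amp hb0 hb1 ((α + pm) / 2) K hs' _ hQ0 (hamp pm pn)
  have hsum : (∑ pm ∈ parities, ∑ pn ∈ parities,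
      outEnergy ((α + pm) / 2) ((β + pn) / 2) 8 K s' (phasePieces ((α + pm) / 2) ((β + pn) / 2) 8 K (child pm pn (inputState α β 8 K PType.V d))) PType.H) ≤
        4 * (66 * ((1 / (4 * Real.pi ^ 2 * (4 : ℝ) ^ (1 : ℕ))) * ((2 * 2 ^ s' + 1) * (2 * (Real.pi + 1) * Q ^ 2 / (2 : ℝ) ^ (s' - 1))))) := by
    refine (Finset.sum_le_sum fun pm hpm => Finset.sum_le_sum fun pn hpn => hchild pm hpm pn hpn).trans (le_of_eq ?_)
    rw [show parities = ({0, 1} : Finset ℤ) from rfl, Finset.sum_pair (by norm_num), Finset.sum_pair (by norm_num)]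
    ring
  -- (2) input energy and Cauchy–Schwarz
  have hden := cEnergy_inputState_V_shell_lower hα0 hα1.le β 8 K (by omega : 2 ≤ s) d hdS
  have hcoef : 2 / X ≤ Real.pi / 2 ^ s - 2 / ((K : ℝ) + 1) - 4 / 4 ^ (s - 1) := by
    rw [hX]; exact input_coef_lower (by omega) hK
  have hden' : (2 / X) * D₂ / (4 * Real.pi ^ 2) ≤ cEnergy α β 0 K (inputState α β 8 K PType.V d) := by
    refine le_trans ?_ hden
    refine div_le_div_of_nonneg_right (mul_le_mul_of_nonneg_right hcoef hD₂0) (by positivity)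
  have hD1 : D₁ ^ 2 ≤ (2 * X + 1) * (2 * D₂) := by rw [hX]; exact l1_sq_le_of_supportedIn β K (by omega) d hdS
  -- (3) assemble
  refine hsum.trans ?_
  rw [Real.sq_sqrt (by positivity)]
  have e3 : 4 * (66 * ((1 / (4 * Real.pi ^ 2 * (4 : ℝ) ^ (1 : ℕ))) * ((2 * 2 ^ s' + 1) * (2 * (Real.pi + 1) * Q ^ 2 / (2 : ℝ) ^ (s' - 1))))) =
      (27899.0976 * (Real.pi + 1) * (2 * Y + 1) / (Real.pi ^ 2 * X ^ 2 * Y)) * D₁ ^ 2 := by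
    rw [← hY, hYs1, hQ, hXs2]
    field_simp
    ring
  rw [e3]
  have hc : 0 ≤ 27899.0976 * (Real.pi + 1) * (2 * Y + 1) / (Real.pi ^ 2 * X ^ 2 * Y) := by positivity
  refine (mul_le_mul_of_nonneg_left hD1 hc).trans ?_
  refine le_trans ?_ (mul_le_mul_of_nonneg_left hden' (by positivity))
  have eL : 27899.0976 * (Real.pi + 1) * (2 * Y + 1) / (Real.pi ^ 2 * X ^ 2 * Y) * ((2 * X + 1) * (2 * D₂)) =
      (55798.1952 * (Real.pi + 1) * (2 * Y + 1) * (2 * X + 1) / (Real.pi ^ 2 * X ^ 2 * Y)) * D₂ := by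
    field_simp
    ring
  have eR : (2200000 : ℝ) * (2 / X * D₂ / (4 * Real.pi ^ 2)) = (1100000 / (Real.pi ^ 2 * X)) * D₂ := by
    field_simp
    ring
  rw [eL, eR]
  exact mul_le_mul_of_nonneg_right (far_entry_numeric2 hX512 hY8) hD₂0

theorem far_entry_numeric3 {X Y : ℝ} (hX : 8 ≤ X) (hY : 8 ≤ Y) :
    422.4 * (Real.pi + 1) * (2 * Y + 1) * (2 * X + 1) / (Real.pi ^ 2 * Y ^ 3) ≤ 16000 * X / (Real.pi ^ 2 * Y ^ 2) := by
  have hXpos : 0 < X := by linarith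
  have hYpos : 0 < Y := by linarith
  have hXY : 0 < X * Y := mul_pos hXpos hYpos
  have hπ4 : Real.pi < 3.15 := Real.pi_lt_d2
  have hP : (2 * Y + 1) * (2 * X + 1) ≤ 23 / 5 * (X * Y) := by
    nlinarith [mul_nonneg (sub_nonneg.2 hX) (sub_nonneg.2 hY)]
  have hP0 : 0 ≤ (2 * Y + 1) * (2 * X + 1) := by positivity
  have h1 : Real.pi + 1 ≤ 83 / 20 := by linarith
  have key : 422.4 * (Real.pi + 1) * (2 * Y + 1) * (2 * X + 1) ≤ 16000 * X * Y := by
    have h2 : (Real.pi + 1) * ((2 * Y + 1) * (2 * X + 1)) ≤ (83 / 20) * (23 / 5 * (X * Y)) :=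
      mul_le_mul h1 hP hP0 (by norm_num)
    have h3 : 422.4 * ((Real.pi + 1) * ((2 * Y + 1) * (2 * X + 1))) ≤ 422.4 * ((83 / 20) * (23 / 5 * (X * Y))) :=
      mul_le_mul_of_nonneg_left h2 (by norm_num)
    have h4 : 422.4 * ((83 / 20) * (23 / 5 * (X * Y))) ≤ 16000 * (X * Y) := by
      rw [show 422.4 * ((83 / 20) * (23 / 5 * (X * Y))) = (422.4 * (83 / 20) * (23 / 5)) * (X * Y) by ring]
      exact mul_le_mul_of_nonneg_right (by norm_num) hXY.le
    calc 422.4 * (Real.pi + 1) * (2 * Y + 1) * (2 * X + 1) = 422.4 * ((Real.pi + 1) * ((2 * Y + 1) * (2 * X + 1))) := by ring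
      _ ≤ 16000 * (X * Y) := h3.trans h4
      _ = 16000 * X * Y := by ring
  rw [div_le_div_iff₀ (by positivity) (by positivity)]
  calc 422.4 * (Real.pi + 1) * (2 * Y + 1) * (2 * X + 1) * (Real.pi ^ 2 * Y ^ 2)
      ≤ 16000 * X * Y * (Real.pi ^ 2 * Y ^ 2) := mul_le_mul_of_nonneg_right key (by positivity)
    _ = 16000 * X * (Real.pi ^ 2 * Y ^ 3) := by ring

/-- The input-energy coefficient from shell 3 on: `1/(2·2^s) ≤ π/2^s − 2/(K+1) − 4/4^{s−1}` for `s ≥ 3`, `K + 1 ≥ 2^{s+2}`. -/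
theorem input_coef_lower3 {s : ℕ} (hs : 3 ≤ s) {K : ℕ} (hK : (2 : ℝ) ^ (s + 2) ≤ K + 1) :
    1 / (2 * (2 : ℝ) ^ s) ≤ Real.pi / 2 ^ s - 2 / ((K : ℝ) + 1) - 4 / 4 ^ (s - 1) := by
  set X : ℝ := (2 : ℝ) ^ s with hX
  have hX8 : 8 ≤ X := by
    rw [hX]; calc (8 : ℝ) = 2 ^ 3 := by norm_num
      _ ≤ 2 ^ s := pow_le_pow_right₀ (by norm_num) hs
  have hXpos : 0 < X := by linarith
  have h4 : (4 : ℝ) / 4 ^ (s - 1) = 16 / X ^ 2 := by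
    obtain ⟨j, rfl⟩ : ∃ j, s = j + 1 := ⟨s - 1, by omega⟩
    rw [show j + 1 - 1 = j by omega]
    have h' : (4 : ℝ) ^ j * 4 = X ^ 2 := by
      rw [hX, ← pow_succ, ← pow_mul, show (4 : ℝ) = 2 ^ 2 by norm_num, ← pow_mul]; ring_nf
    rw [← h']
    field_simp
    ring
  have hK' : 2 / ((K : ℝ) + 1) ≤ 1 / (2 * X) := by
    rw [div_le_div_iff₀ (by positivity) (by positivity)]
    have : (2 : ℝ) ^ (s + 2) = 4 * X := by rw [hX, pow_add]; ring
    nlinarith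
  have hx16 : 16 / X ^ 2 ≤ (Real.pi - 1) / X := by
    rw [div_le_div_iff₀ (by positivity) hXpos]
    have hπ := Real.pi_gt_three
    nlinarith
  have e1 : (Real.pi - 1) / X = Real.pi / X - 1 / (2 * X) - 1 / (2 * X) := by ring
  rw [h4]
  linarith

/-- **The far entry from every source shell `s ≥ 3`** (same chain; input coefficient `1/(2·2^s)` for `s ≥ 3`, `K + 1 ≥ 2^{s+2}`):
`Transfer α β 8 K V s H s′ √(128000·4^s/4^{s′})` — covers the up-cascade entries `(V, s < s′) → (H, s′)` with `M² ≤ 128000·4^{−(s′−s)}`. -/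
theorem transfer_V_H_far3 {α β : ℝ} (hα0 : 0 ≤ α) (hα1 : α < 1) (hβ0 : 0 ≤ β) (hβ1 : β < 1) {s s' : ℕ} (hs : 3 ≤ s) (hs' : 3 ≤ s')
    (K : ℕ) (hK : (2 : ℝ) ^ (s + 2) ≤ K + 1) :
    Transfer α β 8 K PType.V s PType.H s' (Real.sqrt (128000 * 4 ^ s / 4 ^ s')) := by
  intro d hd
  have hdS : SupportedIn s β d := hd.1
  have hdW : ∀ k : ℤ, k ∉ win K → d k = 0 := hd.2
  set D₁ : ℝ := ∑ k ∈ win K, (‖d k 0‖ + ‖d k 1‖) with hD₁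
  set D₂ : ℝ := ∑ k ∈ win K, (‖d k 0‖ ^ 2 + ‖d k 1‖ ^ 2) with hD₂
  have hD₂0 : 0 ≤ D₂ := Finset.sum_nonneg fun _ _ => by positivity
  set X : ℝ := (2 : ℝ) ^ s with hX
  set Y : ℝ := (2 : ℝ) ^ s' with hY
  have hX32 : 8 ≤ X := by
    rw [hX]; calc (8 : ℝ) = 2 ^ 3 := by norm_num
      _ ≤ 2 ^ s := pow_le_pow_right₀ (by norm_num) hs
  have hY8 : 8 ≤ Y := by
    rw [hY]; calc (8 : ℝ) = 2 ^ 3 := by norm_num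
      _ ≤ 2 ^ s' := pow_le_pow_right₀ (by norm_num) hs'
  have h4s : (4 : ℝ) ^ s = X ^ 2 := by rw [hX, ← pow_mul, show (4 : ℝ) = 2 ^ 2 by norm_num, ← pow_mul]; ring_nf
  have h4s' : (4 : ℝ) ^ s' = Y ^ 2 := by rw [hY, ← pow_mul, show (4 : ℝ) = 2 ^ 2 by norm_num, ← pow_mul]; ring_nf
  have hY3 : (2 : ℝ) ^ (3 * (s' - 1)) * 8 = Y ^ 3 := by
    rw [hY, ← pow_mul, show (8 : ℝ) = 2 ^ 3 by norm_num, ← pow_add]; congr 1; omega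
  -- (1) the four children
  have hchild : ∀ pm ∈ parities, ∀ pn ∈ parities,
      outEnergy ((α + pm) / 2) ((β + pn) / 2) 8 K s' (phasePieces ((α + pm) / 2) ((β + pn) / 2) 8 K (child pm pn (inputState α β 8 K PType.V d))) PType.H ≤
        66 * ((1 / (4 * Real.pi ^ 2 * (4 : ℝ) ^ (1 : ℕ))) * ((2 * 2 ^ s' + 1) * (1.6 * (Real.pi + 1) * D₁ ^ 2 / (2 : ℝ) ^ (3 * (s' - 1))))) := by
    intro pm hpm pn hpn
    have hpn' : (pn : ℝ) = 0 ∨ (pn : ℝ) = 1 := by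
      simp only [parities, Finset.mem_insert, Finset.mem_singleton] at hpn
      rcases hpn with h | h <;> simp [h]
    have hb0 : 0 ≤ (β + (pn : ℝ)) / 2 := by rcases hpn' with h | h <;> rw [h] <;> linarith
    have hb1 : (β + (pn : ℝ)) / 2 ≤ 1 := by rcases hpn' with h | h <;> rw [h] <;> linarith
    exact outEnergy_H_child_le hb0 hb1 ((α + pm) / 2) K hs' _ (fun m _ => sum_norm_child_inputState_V_le α β 8 K d hdW pm pn m)
  have hsum : (∑ pm ∈ parities, ∑ pn ∈ parities,
      outEnergy ((α + pm) / 2) ((β + pn) / 2) 8 K s' (phasePieces ((α + pm) / 2) ((β + pn) / 2) 8 K (child pm pn (inputState α β 8 K PType.V d))) PType.H) ≤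
        4 * (66 * ((1 / (4 * Real.pi ^ 2 * (4 : ℝ) ^ (1 : ℕ))) * ((2 * 2 ^ s' + 1) * (1.6 * (Real.pi + 1) * D₁ ^ 2 / (2 : ℝ) ^ (3 * (s' - 1)))))) := by
    refine (Finset.sum_le_sum fun pm hpm => Finset.sum_le_sum fun pn hpn => hchild pm hpm pn hpn).trans (le_of_eq ?_)
    rw [show parities = ({0, 1} : Finset ℤ) from rfl, Finset.sum_pair (by norm_num), Finset.sum_pair (by norm_num)]
    ring
  -- (2) the input energy
  have hden := cEnergy_inputState_V_shell_lower hα0 hα1.le β 8 K (by omega : 2 ≤ s) d hdS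
  have hcoef : 1 / (2 * X) ≤ Real.pi / 2 ^ s - 2 / ((K : ℝ) + 1) - 4 / 4 ^ (s - 1) := by
    rw [hX]; exact input_coef_lower3 hs hK
  have hden' : (1 / (2 * X)) * D₂ / (4 * Real.pi ^ 2) ≤ cEnergy α β 0 K (inputState α β 8 K PType.V d) := by
    refine le_trans ?_ hden
    refine div_le_div_of_nonneg_right (mul_le_mul_of_nonneg_right hcoef hD₂0) (by positivity)
  -- (3) Cauchy–Schwarz over the source columns
  have hD1 : D₁ ^ 2 ≤ (2 * X + 1) * (2 * D₂) := by rw [hX]; exact l1_sq_le_of_supportedIn β K (by omega) d hdS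
  -- (4) assemble
  refine hsum.trans ?_
  rw [Real.sq_sqrt (by positivity), h4s, h4s']
  have hπ3 := Real.pi_gt_three
  have hπ4 : Real.pi < 3.15 := Real.pi_lt_d2
  have hXpos : 0 < X := by linarith
  have hYpos : 0 < Y := by linarith
  -- rewrite both sides as (coefficient) · D₂ and compare coefficients
  have e3 : 4 * (66 * ((1 / (4 * Real.pi ^ 2 * (4 : ℝ) ^ (1 : ℕ))) * ((2 * 2 ^ s' + 1) * (1.6 * (Real.pi + 1) * D₁ ^ 2 / (2 : ℝ) ^ (3 * (s' - 1)))))) =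
      (422.4 * (Real.pi + 1) * (2 * Y + 1) / (16 * Real.pi ^ 2 * Y ^ 3)) * (8 * D₁ ^ 2) := by
    rw [← hY, show (2 : ℝ) ^ (3 * (s' - 1)) = Y ^ 3 / 8 by rw [← hY3]; ring]
    field_simp
    ring
  rw [e3]
  have hc : 0 ≤ 422.4 * (Real.pi + 1) * (2 * Y + 1) / (16 * Real.pi ^ 2 * Y ^ 3) := by positivity
  have step : (422.4 * (Real.pi + 1) * (2 * Y + 1) / (16 * Real.pi ^ 2 * Y ^ 3)) * (8 * D₁ ^ 2) ≤
      (422.4 * (Real.pi + 1) * (2 * Y + 1) / (16 * Real.pi ^ 2 * Y ^ 3)) * (8 * ((2 * X + 1) * (2 * D₂))) :=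
    mul_le_mul_of_nonneg_left (by linarith [hD1]) hc
  refine step.trans ?_
  refine le_trans ?_ (mul_le_mul_of_nonneg_left hden' (by positivity))
  have eL : (422.4 * (Real.pi + 1) * (2 * Y + 1) / (16 * Real.pi ^ 2 * Y ^ 3)) * (8 * ((2 * X + 1) * (2 * D₂))) =
      (422.4 * (Real.pi + 1) * (2 * Y + 1) * (2 * X + 1) / (Real.pi ^ 2 * Y ^ 3)) * D₂ := by
    field_simp
    ring
  have eR : 128000 * X ^ 2 / Y ^ 2 * (1 / (2 * X) * D₂ / (4 * Real.pi ^ 2)) = (16000 * X / (Real.pi ^ 2 * Y ^ 2)) * D₂ := by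
    field_simp
    ring
  rw [eL, eR]
  refine mul_le_mul_of_nonneg_right ?_ hD₂0
  exact far_entry_numeric3 hX32 hY8


end

end Summit.AnomalousDissipation.AnomalousDissipation.Cruxes.K1LocalisedCascade.K2CombColumnLaw
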